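import Summits.AtomisticToContinuum.BoseEinsteinCondensation.Theses.BECInsertionCorrector
import Literature.MathematicalPhysics.QuantumManyBody.GroundStateDirichletForm
import Literature.MathematicalPhysics.QuantumManyBody.PeriodicBoseGasTagged
import Literature.MathematicalPhysics.QuantumManyBody.DyadicCoherentFractionRefinement
import Literature.MathematicalPhysics.QuantumManyBody.PeriodicBoseGasLemma33
import Literature.MathematicalPhysics.QuantumManyBody.LangevinGenerator
import Mathlib.Analysis.InnerProductSpace.Calculus

/-!
# Disproof work file for crux `CorrectorClosure` (stmt-AtomisticToContinuum-12058) — gen 4 (v10, 2026-08-16)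

Route `BECInsertionCorrector`; crux `CorrectorClosure := StaticResponseBound → InsertionResidue`.

Findings (ALL `sorry`-free, axioms `propext`/`Classical.choice`/`Quot.sound`):

* §1 `not_correctorClosure_iff` — logical shape: a refutation of the crux is EXACTLY a proof of
  `StaticResponseBound` (crux 12057, open) together with a refutation of the target
  `InsertionResidue` (12056, morally torus BEC); `InsertionResidue → CorrectorClosure` and
  `¬ StaticResponseBound → CorrectorClosure` are one-liners. The crux as typed is therefore
  refutation-proof short of (K1 proved ∧ target refuted); mechanism-level objections (second
  corrector, exponential moments, hard-core dressing) are not visible in the Lean statement.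
* §2 product plane-wave ("boosted condensate") states `productWave N L k = L^{-3N/2} ∏ⱼ e_k(xⱼ)`;
  for `k ≠ 0` the tagged zero-mode integral `∫_cell Ψ(x, X) dx` vanishes identically in `X`
  (`setIntegral_cell_productWave_succ`): zero insertion overlap with `φ₀ ⊗ Θ` for EVERY `Θ`.
* §3 `insertionResidue_false_without_window` — LOAD-BEARING: drop the hypothesis that `Ψ` is a
  `δ`-near-minimiser and the target is false (any admissible `v`).
  `correctorClosureWithoutWindow_iff : (K1 → windowless target) ↔ ¬ K1`.
* §4 `insertionResidue_false_without_finiteRange` — LOAD-BEARING: weaken `IsRepulsiveFiniteRange v`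
  to `Measurable v` and the target is false (`v ≡ 1`: `v^{per} = ∑_{ℤ³} 1 = ⊤`, `E₀^{per}(N+1) = ⊤`,
  every state is a near-minimiser). Any proof must use `E₀^{per}(N+1, L) < ⊤` at `ρ < ρ₀(v)`.
* §5 TIGHTNESS `overlap_sq_le_taggedZeroModeOccupation`, `overlap_sq_le_one`,
  `succ_mul_overlap_sq_le_condensateOccupation` — Cauchy–Schwarz: `L⁻³|overlap|² ≤ ⟨Ψ,P_{Ω,0}Ψ⟩ ≤ 1`
  and `(N+1) L⁻³|overlap|² ≤ ⟨Ψ, n₀Ψ⟩` (the analytic core of support item 12059; no target with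
  `c > 1`).
* §6 one-excitation technology on `cellN`: Fubini for products (`setIntegral_cellN_prod`),
  `∫ e_n(xⱼ) = 0`, orthogonality, `∫|N_k 1|² = M L^{3M}`, the normalised affine state
  `(a + b N_k 1)/‖·‖` (`affineState`), its free energy `≤ |k|²` (`periodicEnergy_zero_affineState_le`)
  and its insertion overlap as the linear form `c L³ (a w₁ + b w₂)` (`overlap_affineState`).
* §7 `insertionResidue_false_uniformWindow` — QUANTIFIER ORDER IS LOAD-BEARING: with `δ` chosen
  before `N` (an `N`-uniform window) the target is FALSE already at `v = 0`: for every `Θ` the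
  window `E ≤ E₀ + δ` contains, once `(2π/L)² ≤ δ`, the state `(w₂ − w₁ N_k 1)/‖·‖` with ZERO
  insertion overlap (`exists_lowEnergy_zero_overlap`). Hence the admissible `δ_N` is below the first
  excitation energy of the `(N+1)`-body torus Hamiltonian: `4π²/L² ∼ N^{-2/3}` free, the phonon
  `c_s·2π/L ∼ N^{-1/3}` interacting (insertion analogue of barrier `KineticGapLengthScalesNarrow` (3)).
  This closes gen-1's near-miss §10.
* §8 THE CONSTANT: `not_insertionResidueConst_of_one_lt` (no target with a fixed `c > 1`, already at
  `v = 0`) and `overlap_sq_const_const` (the bound `1` is ATTAINED: constant `N`-state inserted into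
  the constant `(N+1)`-state, every `N`, `L`; free gas has insertion residue exactly `1`).
* §9 PITFALL for card healing-scale-kac-insertion: its abstract `ResidueStability` inequality
  `(1−√θ)²(∫g)²∫h² ≤ (∫h)²∫g²` is FALSE without `θ ≤ 1` (`residueStability_false_without_theta_le_one`,
  two-point witness) and TRUE with it (`residueStability_two_point`); the card uses `θ = 1/16`.
* §10 `insertionResidue_false_allDensities` — LOAD-BEARING (diluteness): with `∀ ρ > 0` in place of
  `∃ ρ₀, ∀ ρ < ρ₀` the target is FALSE for the ADMISSIBLE hard core of radius `1` at `ρ = 64`: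
  pigeonhole on subcubes (`exists_close_pair`) ⇒ every configuration of the cell has an encounter ⇒
  every `(N+1)`-body energy is `⊤` (`periodicEnergy_hardCore_eq_top`) ⇒ every state is a
  near-minimiser ⇒ §2 applies. The target genuinely lives below close packing.
* §11 NON-VACUITY OF THE HYPOTHESIS: `srbAt_zero` — the body of `StaticResponseBound` holds for the
  free gas (`v = 0`) with `ρ₀ = 1`, `C = 1`: `free_static_response : -t²N/|p|² ≤ ⟨Ψ,-ΔΨ⟩ +
  t∫(∑ⱼcos p·xⱼ)|Ψ|²` for EVERY periodic `C¹` state, box, `k ≠ 0`, `t` (torus integration by parts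
  `ibp_response` + completing the square `free_square`, coordinate by coordinate with
  `α_c = -t p_c/|p|²`); `staticResponseBound_iff : StaticResponseBound ↔ ∀ v admissible, SRBAt v`.
  (Re-establishes gen-1's lost §8; the planner's "second check", sharpened to `C = 1`.)

* §12 (gen 3) TARGETS = the PICKED line `llp-fidelity-arc` (lead pick 2026-08-16): stub-by-stub cheap
  attacks — `stub_endpoints`, `stub_arcChord` TRUE as typed (PF-free convexity proof of (a); FS
  triangle inequality); `stub_undressedSpeed`, `stub_dressedPathBound` consistent with Bogoliubov
  (one-loop arc `≈ const·(ρ/a)^{1/4}‖v‖₁`, two-phonon pieces IR-finite, NO `log L`; hidden input =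
  uniqueness of the ground ray of `H_λ` at every `λ`, fixed `N`). One TRAP made a theorem:
  `Llp.not_localSpeedBound_zero_majorant` / `Llp.integral_pos_of_localSpeedBound_free` — over
  verbatim copies of the line's definitions — the derivative-free `LocalSpeedBound` forces the
  majorant to have positive mass on every `[λ,λ']` (zero majorant FALSE even for the motionless free
  path), fed by the free-gas witness pair §12a (= the landed `Negative.exists_lowEnergy_tagged_pair_norm_inner_lt_one`, p72198).
* §13 (gen 3) BARRIER REDUCTION — the crux is dimension-dependent: its `d = 1` analogue is FALSE
  (Pitaevskii–Stringari: the `d = 1` analogue of K1, a momentum-uniform compressibility bound, is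
  exactly the hypothesis that EXCLUDES condensation, and §5 turns no-BEC into `Z_N → 0`); catalogue
  entries `PitaevskiiStringariOneDimension(Narrow)`, `OneDimensionalHardCore`. What a proof must use:
  the infrared summability `L^{-d}∑_{0<|k|≤κL} L/|k| = O(1) ⇔ d ≥ 2` (the recoil integral
  `∫ d^dk m₋₁(k)/k²` of the first corrector / of `χ_F(0)` is the `d = 3` instance). Docstring only
  (the tree's `Space` is `ℝ³`).
* §15 (gen 3) ONE-LOOP CALIBRATION of the picked heart: with the dressed vertex `8πa_λ` the FS arc of
  the ceiling path has `arc² = (1/ρ)∫ v_k² = (8/(3√π))√(ρa³)` = Bogoliubov depletion EXACTLY (Lean: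
  `bogoliubov_arc_mode_identity`, `μ²S_k/(e_k+k²)² = v_k²`); `Z ≥ cos² arc` is saturated to leading
  order (the path is a one-loop geodesic), so no slack-based objection to `DressedPathBound` exists at
  small `ρ`; the budget `θ` is met once `1.5045√(ρa³) < θ²`.
* §14 (gen 3) census of the hypothesis side: K1's own disprover (`Cruxes/StaticResponseBound/
  Disproof.lean`) owns `k ≠ 0` / finite-energy-guard load-bearing and the tightness `C ≥ 1/2`; not
  duplicated here. Docstring only.
* §16 (gen 4) LINES B (`healing-scale-kac-insertion`, v3) AND C (`residue-area-law`, v1): cheap-attack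
  census — no stub false as typed. Theorems: the single-mode lower bound
  `ofReal_sq_div_dirichletFormW_le_hMinusOneSqW` (`‖g‖²₋₁ ≥ (∫g²F²)²/𝓔_F(g,g)`; so every `H₋₁`
  response bound `≤ C N/max(ρ'a,p²)` has `C ≥ S(k)²/2 → 1/2`: line B's heart is VACUOUS for `C < 1/2`)
  and `exists_bounded_sums_without_summable_majorant` (line C's summable-majorant heart is strictly
  stronger than the telescoped bound its glue consumes: escaping ledger mass would kill the stub, not
  the crux; restatement given). Shared hidden input of ALL lines for `⊤`-valued `v` — simplicity of
  the fixed-`N` hard-core ground state / connectivity of the dilute hard-sphere configuration space —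
  is an OPEN QUESTION in print at fixed packing fraction (Baryshnikov–Bubenik–Kahle 2014 §6).
* §17 (gen 4) HEART CALIBRATION II for (D∃) `stub_dressedPathExists`: attempted non-rectifiability
  kill through the two-body ceiling path (sliding fronts / graded shells with `Σ√gᵢ = ∞`) FAILS — the
  radial zero-energy family is convex, 1-Lipschitz, monotone in `h`, and the path `h ↦ f_h` is a
  NEAR-GEODESIC of `L²(B_{R₀})`: `Λ(v)/chord ∈ [1.000, 1.044]`, `Λ ≤ 2.14 R₀^{3/2}` over a zoo of 22
  admissible shapes incl. hard cores, Cantor dust and Born-divergent spikes (kit j013538). UV arc of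
  the heart `= √ρ Λ(v)`: the budget `θ` costs only `ρR₀³ ≲ θ²/18`, uniformly in the shape of `v`.

LANDED (importable, namespace `Summit.…Theorems.CorrectorClosure.Negative`, modules
`Summits.AtomisticToContinuum.BoseEinsteinCondensation.Theorems.CorrectorClosure.Negative.*`):
`InsertionResidueLoadBearing` (§1–§4; the product states are called `planeWave` there),
`InsertionResidueTorusPlaneWaves` (§6a), `InsertionResidueOneExcitationState` (§6b),
`InsertionResidueUniformWindowFalse` (§5, §7), `InsertionResidueHardCoreJamming` (§10),
`InsertionResidueConstantTight` (§8), `TaggedNearMinimisersNotParallel` (§12's witness pair, gen 3, p72198);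
§8/§9/§11 live in this work file (§11 also attached as evidence `FreeSRB.lean` on item 12057; a
full proof of support item 12059 `ResidueCondenses` is attached as evidence there).

WHY THE CRUX RESISTS (for provers): §1; K1 is the genuine uniform compressibility bound
`N m₋₁(p) ≤ C N / max(ρa, p²)` (Bogoliubov `1/(p²+16πρa)`, LDA `E(t)/N = ρa f(t/ρa)`), neither
cheaply refutable nor provable; the target is `[(n₀(Θ)+1)/(N+1)]·Z̃` with `Z̃ → 1` in Bogoliubov
theory, i.e. torus BEC. Mechanism-level numerics (Bogoliubov KV correctors, kit job j006427) and the
literature side are recorded in the item evidence notes / NOTES.md of the cdisprove seat.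
-/

noncomputable section

open MeasureTheory Filter Metric WithLp
open scoped ENNReal NNReal ComplexConjugate BigOperators

namespace Summit.AtomisticToContinuum.BoseEinsteinCondensation.Cruxes.CorrectorClosure.Disproof

open Literature.MathematicalPhysics.QuantumManyBody.BoseGas
open Summit.AtomisticToContinuum.BoseEinsteinCondensation.Theses.BECInsertionCorrector

/-! ## §1 Logical shape of the crux -/

/-- `¬ CorrectorClosure` is literally `StaticResponseBound ∧ ¬ InsertionResidue`. [folklore] -/
theorem not_correctorClosure_iff :
    ¬ CorrectorClosure ↔ (StaticResponseBound ∧ ¬ InsertionResidue) := by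
  unfold CorrectorClosure
  constructor
  · intro h
    by_cases hS : StaticResponseBound
    · exact ⟨hS, fun hI => h fun _ => hI⟩
    · exact (h fun hS' => (hS hS').elim).elim
  · rintro ⟨hS, hI⟩ h
    exact hI (h hS)

/-- The target alone closes the crux. [folklore] -/
theorem correctorClosure_of_insertionResidue (h : InsertionResidue) : CorrectorClosure :=
  fun _ => h

/-- A refutation of K1 (`StaticResponseBound`) closes the crux vacuously. [folklore] -/
theorem correctorClosure_of_not_staticResponseBound (h : ¬ StaticResponseBound) :
    CorrectorClosure :=
  fun hS => (h hS).elim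

/-! ## §2 Plane-wave (boosted condensate) periodic trial states -/

/-- The phase `θ_k(x) = (2π/L) k·x`. [folklore] -/
def phase (L : ℝ) (k : Fin 3 → ℤ) (x : Space) : ℝ :=
  2 * Real.pi / L * ∑ c, (k c : ℝ) * x c

/-- The plane wave `e_k(x) = exp(i θ_k(x))` on the torus of side `L`. [folklore] -/
def pw (L : ℝ) (k : Fin 3 → ℤ) (x : Space) : ℂ :=
  Complex.exp (phase L k x * Complex.I)

/-- `|e_k(x)| = 1`. [folklore] -/
theorem norm_pw (L : ℝ) (k : Fin 3 → ℤ) (x : Space) : ‖pw L k x‖ = 1 := by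
  unfold pw
  exact Complex.norm_exp_ofReal_mul_I _

/-- `θ_k` is additive. [folklore] -/
theorem phase_add (L : ℝ) (k : Fin 3 → ℤ) (x y : Space) :
    phase L k (x + y) = phase L k x + phase L k y := by
  unfold phase
  rw [← mul_add, ← Finset.sum_add_distrib]
  congr 1
  refine Finset.sum_congr rfl fun c _ => ?_
  rw [PiLp.add_apply, mul_add]

/-- `θ_k(0) = 0`. [folklore] -/
theorem phase_zero (L : ℝ) (k : Fin 3 → ℤ) : phase L k 0 = 0 := by
  simp [phase]

/-- `θ_k(L e_c) = 2π k_c`. [folklore] -/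
theorem phase_single (L : ℝ) (hL : L ≠ 0) (k : Fin 3 → ℤ) (c : Fin 3) :
    phase L k (EuclideanSpace.single c L) = 2 * Real.pi * k c := by
  unfold phase
  have : ∑ c', (k c' : ℝ) * (EuclideanSpace.single c L : Space) c' = (k c : ℝ) * L := by
    rw [Finset.sum_eq_single c]
    · simp
    · intro b _ hb
      simp [hb]
    · intro h; exact (h (Finset.mem_univ c)).elim
  rw [this]
  field_simp

/-- `e_k(x+y) = e_k(x) e_k(y)`. [folklore] -/
theorem pw_add (L : ℝ) (k : Fin 3 → ℤ) (x y : Space) :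
    pw L k (x + y) = pw L k x * pw L k y := by
  unfold pw
  rw [phase_add, Complex.ofReal_add, add_mul, Complex.exp_add]

/-- `e_k` is `Lℤ³`-periodic on generators: `e_k(L e_c) = 1`. [folklore] -/
theorem pw_single (L : ℝ) (hL : L ≠ 0) (k : Fin 3 → ℤ) (c : Fin 3) :
    pw L k (EuclideanSpace.single c L) = 1 := by
  unfold pw
  rw [phase_single L hL k c]
  have : ((2 * Real.pi * (k c : ℝ) : ℝ) : ℂ) * Complex.I = (k c : ℤ) * (2 * Real.pi * Complex.I) := by
    push_cast; ring
  rw [this]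
  exact Complex.exp_int_mul_two_pi_mul_I (k c)

/-- `e_k(0) = 1`. [folklore] -/
theorem pw_zero (L : ℝ) (k : Fin 3 → ℤ) : pw L k 0 = 1 := by
  simp [pw, phase_zero]

/-- `x ↦ θ_k(x)` is smooth (it is linear). [folklore] -/
theorem contDiff_phase (L : ℝ) (k : Fin 3 → ℤ) : ContDiff ℝ 1 (phase L k) := by
  unfold phase
  refine contDiff_const.mul ?_
  refine ContDiff.sum fun c _ => ?_
  refine contDiff_const.mul ?_
  exact (EuclideanSpace.proj (𝕜 := ℝ) (ι := Fin 3) c).contDiff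

/-- `e_k` is `C¹`. [folklore] -/
theorem contDiff_pw (L : ℝ) (k : Fin 3 → ℤ) : ContDiff ℝ 1 (pw L k) := by
  unfold pw
  exact ((Complex.ofRealCLM.contDiff.comp (contDiff_phase L k)).mul contDiff_const).cexp

/-- The `N`-body product `∏ⱼ e_k(xⱼ)` is `C¹`. [folklore] -/
theorem contDiff_prod_pw (N : ℕ) (L : ℝ) (k : Fin 3 → ℤ) :
    ContDiff ℝ 1 fun X : Config N => ∏ j, pw L k (X j) := by
  refine contDiff_prod fun j _ => ?_
  exact (contDiff_pw L k).comp (ContinuousLinearMap.proj (R := ℝ) (φ := fun _ : Fin N => Space) j).contDiff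

/-- The normalisation constant `L^{-3N/2}` (as a real number). [folklore] -/
def normConst (N : ℕ) (L : ℝ) : ℝ := ((Real.sqrt (L ^ 3))⁻¹) ^ N

/-- `L^{-3N/2} > 0`. [folklore] -/
theorem normConst_pos {N : ℕ} {L : ℝ} (hL : 0 < L) : 0 < normConst N L := by
  unfold normConst; positivity

/-- **Plane-wave (boosted condensate) trial state** `Ψ(X) = L^{-3N/2} ∏ⱼ exp(2πi k·xⱼ/L)`:
`C¹`, periodic, Bose-symmetric, `|Ψ|² ≡ L^{-3N}` so normalised on the cell. For `k = 0` this is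
the constant state (the free periodic ground state). [folklore] -/
def productWave (N : ℕ) {L : ℝ} (hL : 0 < L) (k : Fin 3 → ℤ) : PeriodicTrialState N L where
  ψ X := (normConst N L : ℂ) * ∏ j, pw L k (X j)
  contDiff := contDiff_const.mul (contDiff_prod_pw N L k)
  periodic X i c := by
    congr 1
    refine Finset.prod_congr rfl fun j _ => ?_
    rcases eq_or_ne j i with rfl | hji
    · rw [Pi.add_apply, Pi.single_eq_same, pw_add, pw_single L hL.ne' k c, mul_one]
    · rw [Pi.add_apply, Pi.single_eq_of_ne hji, add_zero]
  symm σ X := by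
    congr 1
    exact Equiv.prod_comp σ (fun j => pw L k (X j))
  norm_eq := by
    have hL3 : 0 < L ^ 3 := by positivity
    have hsq : normConst N L ^ 2 = ((L ^ 3)⁻¹) ^ N := by
      rw [normConst, ← pow_mul, mul_comm, pow_mul, inv_pow, Real.sq_sqrt hL3.le]
    have hconst : ∀ X : Config N,
        ((‖(normConst N L : ℂ) * ∏ j, pw L k (X j)‖₊ : ℝ≥0∞) ^ 2) =
          ENNReal.ofReal (((L ^ 3)⁻¹) ^ N) := by
      intro X
      have hn : ‖(normConst N L : ℂ) * ∏ j, pw L k (X j)‖ = normConst N L := by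
        rw [norm_mul, Complex.norm_real, Real.norm_of_nonneg (normConst_pos hL).le,
          norm_prod, Finset.prod_eq_one (fun j _ => norm_pw L k (X j)), mul_one]
      rw [coe_nnnorm_sq_eq_ofReal, hn, hsq]
    simp_rw [hconst]
    rw [setLIntegral_const, volume_cellN, ← ENNReal.ofReal_pow hL.le,
      ENNReal.ofReal_pow (inv_nonneg.2 hL3.le), ← mul_pow,
      ← ENNReal.ofReal_mul (inv_nonneg.2 hL3.le), inv_mul_cancel₀ hL3.ne', ENNReal.ofReal_one,
      one_pow]

/-- Unfolding lemma for `productWave`. [folklore] -/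
@[simp] theorem productWave_ψ (N : ℕ) {L : ℝ} (hL : 0 < L) (k : Fin 3 → ℤ) (X : Config N) :
    (productWave N hL k).ψ X = (normConst N L : ℂ) * ∏ j, pw L k (X j) := rfl

/-- The one-dimensional zero mode of a non-trivial plane wave vanishes:
`∫₀ᴸ exp(2πi m t/L) dt = 0` for `m ∈ ℤ ∖ {0}`. [folklore] -/
theorem integral_Ico_exp_eq_zero {L : ℝ} (hL : 0 < L) {m : ℤ} (hm : m ≠ 0) :
    ∫ t in Set.Ico 0 L, Complex.exp (((2 * Real.pi / L * ((m : ℝ) * t) : ℝ) : ℂ) * Complex.I) = 0 := by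
  set C : ℂ := ((2 * Real.pi * m / L : ℝ) : ℂ) * Complex.I with hC
  have hC0 : C ≠ 0 := by
    rw [hC]
    refine mul_ne_zero ?_ Complex.I_ne_zero
    rw [Complex.ofReal_ne_zero]
    have : (m : ℝ) ≠ 0 := Int.cast_ne_zero.mpr hm
    positivity
  have hint : ∀ t : ℝ, Complex.exp (((2 * Real.pi / L * ((m : ℝ) * t) : ℝ) : ℂ) * Complex.I) =
      Complex.exp (C * t) := by
    intro t; rw [hC]; congr 1; push_cast; ring
  simp_rw [hint]
  rw [integral_Ico_eq_integral_Ioc, ← intervalIntegral.integral_of_le hL.le,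
    integral_exp_mul_complex hC0]
  have h1 : Complex.exp (C * (L : ℝ)) = 1 := by
    have hL' : (L : ℂ) ≠ 0 := Complex.ofReal_ne_zero.mpr hL.ne'
    have : C * (L : ℝ) = (m : ℤ) * (2 * Real.pi * Complex.I) := by
      rw [hC]; push_cast; field_simp
    rw [this]; exact Complex.exp_int_mul_two_pi_mul_I m
  rw [h1]
  simp

/-- The zero mode of a non-trivial plane wave on the cell vanishes: `∫_{[0,L)³} e_k = 0` for
`k ≠ 0`. [folklore] -/
theorem setIntegral_cell_pw {L : ℝ} (hL : 0 < L) {k : Fin 3 → ℤ} (hk : k ≠ 0) :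
    ∫ x in cell L, pw L k x = 0 := by
  have hpre : (toLp 2 : (Fin 3 → ℝ) → Space) ⁻¹' cell L = Set.univ.pi fun _ => Set.Ico 0 L := by
    ext y; simp [cell]
  have hmp := PiLp.volume_preserving_toLp (Fin 3)
  have hme : MeasurableEmbedding (toLp 2 : (Fin 3 → ℝ) → Space) :=
    (MeasurableEquiv.toLp 2 (Fin 3 → ℝ)).measurableEmbedding
  rw [← hmp.setIntegral_preimage_emb hme, hpre]
  have hprod : ∀ y : Fin 3 → ℝ, pw L k (toLp 2 y) =
      ∏ c, Complex.exp (((2 * Real.pi / L * ((k c : ℝ) * y c) : ℝ) : ℂ) * Complex.I) := by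
    intro y
    simp only [pw, phase]
    rw [Finset.mul_sum, Complex.ofReal_sum, Finset.sum_mul, Complex.exp_sum]
  simp_rw [hprod]
  rw [volume_pi, Measure.restrict_pi_pi,
    integral_fintype_prod_eq_prod
      (fun c (t : ℝ) => Complex.exp (((2 * Real.pi / L * ((k c : ℝ) * t) : ℝ) : ℂ) * Complex.I))]
  obtain ⟨c₀, hc₀⟩ : ∃ c, k c ≠ 0 := by
    by_contra h
    push Not at h
    exact hk (funext h)
  exact Finset.prod_eq_zero (Finset.mem_univ c₀) (integral_Ico_exp_eq_zero hL hc₀)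

/-- **Key identity.** For the `(N+1)`-body plane-wave state with `k ≠ 0`, the tagged-particle
zero-mode integral vanishes identically: `∫_cell Ψ(x, X) dx = 0` for every `X`. Hence its insertion
overlap with `φ₀ ⊗ Θ` is `0` for EVERY `N`-body state `Θ`. [folklore] -/
theorem setIntegral_cell_productWave_succ (N : ℕ) {L : ℝ} (hL : 0 < L) {k : Fin 3 → ℤ} (hk : k ≠ 0)
    (X : Config N) :
    ∫ x in cell L, (productWave (N + 1) hL k).ψ (Matrix.vecCons x X) = 0 := by
  have h : ∀ x : Space, (productWave (N + 1) hL k).ψ (Matrix.vecCons x X) =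
      ((normConst (N + 1) L : ℂ) * ∏ j : Fin N, pw L k (X j)) * pw L k x := by
    intro x
    rw [productWave_ψ, Fin.prod_univ_succ, Matrix.cons_val_zero]
    simp only [Matrix.cons_val_succ]
    ring
  simp_rw [h]
  rw [integral_const_mul, setIntegral_cell_pw hL hk, mul_zero]

/-- The insertion overlap of the boosted condensate with `φ₀ ⊗ Θ` vanishes for every `Θ`. [folklore] -/
theorem insertionOverlap_productWave_succ (N : ℕ) {L : ℝ} (hL : 0 < L) {k : Fin 3 → ℤ} (hk : k ≠ 0)
    (Θ : Config N → ℂ) :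
    ∫ X in cellN N L, conj (Θ X) * ∫ x in cell L, (productWave (N + 1) hL k).ψ (Matrix.vecCons x X)
      = 0 := by
  simp_rw [setIntegral_cell_productWave_succ N hL hk, mul_zero]
  exact integral_zero _ _

/-- The unit lattice vector `e₀ = (1,0,0) ≠ 0`. [folklore] -/
def e0 : Fin 3 → ℤ := Pi.single 0 1

/-- `e₀ ≠ 0`. [folklore] -/
theorem e0_ne_zero : e0 ≠ 0 := by
  intro h
  have := congrFun h 0
  simp [e0] at this

/-- `sideLength ρ (N+1) > 0` for `ρ > 0`. [folklore] -/
theorem sideLength_succ_pos {ρ : ℝ} (hρ : 0 < ρ) (N : ℕ) : 0 < sideLength ρ (N + 1) := by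
  unfold sideLength
  apply Real.rpow_pos_of_pos
  positivity

/-! ## §3 Load-bearing: the near-minimiser window on `Ψ` -/

/-- `InsertionResidue` with the hypothesis "`Ψ` is a `δ`-near-minimiser" DROPPED (everything else
verbatim). -/
def InsertionResidueWithoutWindow : Prop :=
  ∀ v : ℝ → ENNReal, IsRepulsiveFiniteRange v → ∃ ρ₀ : ℝ, 0 < ρ₀ ∧ ∀ ρ : ℝ, 0 < ρ → ρ < ρ₀ →
    ∃ c : ℝ, 0 < c ∧ ∀ᶠ N : ℕ in Filter.atTop, ∃ δ : ENNReal, 0 < δ ∧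
      ∃ Θ : PeriodicTrialState N (sideLength ρ (N + 1)),
        periodicEnergy v Θ ≤ periodicGroundStateEnergy v N (sideLength ρ (N + 1)) + δ ∧
        ∀ Ψ : PeriodicTrialState (N + 1) (sideLength ρ (N + 1)),
          ENNReal.ofReal c ≤ ENNReal.ofReal ((sideLength ρ (N + 1) ^ 3)⁻¹) *
            (‖∫ X in cellN N (sideLength ρ (N + 1)), conj (Θ.ψ X) *
                ∫ x in cell (sideLength ρ (N + 1)), Ψ.ψ (Matrix.vecCons x X)‖₊ : ENNReal) ^ 2

/-- The crux with the window dropped from its conclusion. -/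
def CorrectorClosureWithoutWindow : Prop :=
  StaticResponseBound → InsertionResidueWithoutWindow

/-- The free gas `v = 0` is an admissible (repulsive, finite-range) potential. [folklore] -/
theorem isRepulsiveFiniteRange_zero : IsRepulsiveFiniteRange (0 : ℝ → ENNReal) :=
  ⟨measurable_const, ⟨0, fun _ _ => rfl⟩⟩

/-- **Load-bearing (window).** Without the near-minimiser hypothesis on `Ψ` the target is false,
for every admissible `v` (here `v = 0`): the boosted condensate has zero insertion overlap with
`φ₀ ⊗ Θ` whatever `Θ` is. Any proof of the crux must use the energy window of `Ψ`. [folklore] -/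
theorem insertionResidue_false_without_window : ¬ InsertionResidueWithoutWindow := by
  intro h
  obtain ⟨ρ₀, hρ₀, h⟩ := h 0 isRepulsiveFiniteRange_zero
  obtain ⟨c, hc, h⟩ := h (ρ₀ / 2) (by positivity) (by linarith)
  obtain ⟨N, δ, _hδ, Θ, _hΘ, h⟩ := h.exists
  have hL := sideLength_succ_pos (show (0 : ℝ) < ρ₀ / 2 by positivity) N
  have h := h (productWave (N + 1) hL e0)
  rw [insertionOverlap_productWave_succ N hL e0_ne_zero] at h
  simp only [nnnorm_zero, ENNReal.coe_zero, ne_eq, OfNat.ofNat_ne_zero, not_false_eq_true,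
    zero_pow, mul_zero, nonpos_iff_eq_zero, ENNReal.ofReal_eq_zero] at h
  linarith

/-- Hence the window-less crux holds iff K1 fails: it carries no information beyond `¬ K1`. [folklore] -/
theorem correctorClosureWithoutWindow_iff :
    CorrectorClosureWithoutWindow ↔ ¬ StaticResponseBound :=
  ⟨fun h hS => insertionResidue_false_without_window (h hS), fun h hS => (h hS).elim⟩

/-! ## §4 Load-bearing: finite range (finiteness of the ground-state energy) -/

/-- `InsertionResidue` with `IsRepulsiveFiniteRange v` WEAKENED to `Measurable v` (everything else
verbatim). -/
def InsertionResidueWithoutFiniteRange : Prop :=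
  ∀ v : ℝ → ENNReal, Measurable v → ∃ ρ₀ : ℝ, 0 < ρ₀ ∧ ∀ ρ : ℝ, 0 < ρ → ρ < ρ₀ →
    ∃ c : ℝ, 0 < c ∧ ∀ᶠ N : ℕ in Filter.atTop, ∃ δ : ENNReal, 0 < δ ∧
      ∃ Θ : PeriodicTrialState N (sideLength ρ (N + 1)),
        periodicEnergy v Θ ≤ periodicGroundStateEnergy v N (sideLength ρ (N + 1)) + δ ∧
        ∀ Ψ : PeriodicTrialState (N + 1) (sideLength ρ (N + 1)),
          periodicEnergy v Ψ ≤ periodicGroundStateEnergy v (N + 1) (sideLength ρ (N + 1)) + δ →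
          ENNReal.ofReal c ≤ ENNReal.ofReal ((sideLength ρ (N + 1) ^ 3)⁻¹) *
            (‖∫ X in cellN N (sideLength ρ (N + 1)), conj (Θ.ψ X) *
                ∫ x in cell (sideLength ρ (N + 1)), Ψ.ψ (Matrix.vecCons x X)‖₊ : ENNReal) ^ 2

/-- For the constant potential `v ≡ 1` the periodised potential is `∑_{n ∈ ℤ³} 1 = ⊤`. [folklore] -/
theorem periodizedPotential_one (L : ℝ) (x : Space) :
    periodizedPotential (fun _ => 1) L x = ⊤ := by
  unfold periodizedPotential
  exact ENNReal.tsum_const_eq_top_of_ne_zero one_ne_zero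

/-- Hence every configuration of at least two particles has infinite interaction. [folklore] -/
theorem periodicInteraction_one {N : ℕ} (hN : 2 ≤ N) (L : ℝ) (X : Config N) :
    periodicInteraction (fun _ => 1) L X = ⊤ := by
  unfold periodicInteraction
  have h0 : (⟨0, by omega⟩ : Fin N) ∈ (Finset.univ : Finset (Fin N)) := Finset.mem_univ _
  refine ENNReal.sum_eq_top.2 ⟨⟨0, by omega⟩, h0, ?_⟩
  refine ENNReal.sum_eq_top.2 ⟨⟨1, by omega⟩, ?_, ?_⟩
  · simp [Fin.lt_def]
  · exact periodizedPotential_one L _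

/-- And every periodic trial state of at least two particles has infinite energy. [folklore] -/
theorem periodicEnergy_one_eq_top {N : ℕ} (hN : 2 ≤ N) {L : ℝ} (Ψ : PeriodicTrialState N L) :
    periodicEnergy (fun _ => 1) Ψ = ⊤ := by
  unfold periodicEnergy
  have hmeas : Measurable fun X : Config N => (‖Ψ.ψ X‖₊ : ℝ≥0∞) ^ 2 :=
    (Ψ.contDiff.continuous.measurable.nnnorm.coe_nnreal_ennreal.pow_const 2)
  refine top_le_iff.1 ?_
  calc (⊤ : ℝ≥0∞) = ⊤ * ∫⁻ X in cellN N L, (‖Ψ.ψ X‖₊ : ℝ≥0∞) ^ 2 := by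
        rw [Ψ.norm_eq, mul_one]
    _ = ∫⁻ X in cellN N L, ⊤ * (‖Ψ.ψ X‖₊ : ℝ≥0∞) ^ 2 := (lintegral_const_mul ⊤ hmeas).symm
    _ = ∫⁻ X in cellN N L, periodicInteraction (fun _ => 1) L X * (‖Ψ.ψ X‖₊ : ℝ≥0∞) ^ 2 := by
        simp_rw [periodicInteraction_one hN]
    _ ≤ _ := lintegral_mono fun X => le_add_self

/-- So the ground-state energy is `⊤` and EVERY state is a `δ`-near-minimiser. [folklore] -/
theorem periodicGroundStateEnergy_one_eq_top {N : ℕ} (hN : 2 ≤ N) (L : ℝ) :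
    periodicGroundStateEnergy (fun _ => 1) N L = ⊤ := by
  unfold periodicGroundStateEnergy
  exact iInf_eq_top.2 fun Ψ => periodicEnergy_one_eq_top hN Ψ

/-- **Load-bearing (finite range).** With `Measurable v` only, the target is false: `v ≡ 1`.
Any proof must use `E₀^{per}(N+1, L) < ⊤` for `ρ < ρ₀(v)`, the only place finite range enters the
target. [folklore] -/
theorem insertionResidue_false_without_finiteRange : ¬ InsertionResidueWithoutFiniteRange := by
  intro h
  obtain ⟨ρ₀, hρ₀, h⟩ := h (fun _ => 1) measurable_const
  obtain ⟨c, hc, h⟩ := h (ρ₀ / 2) (by positivity) (by linarith)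
  obtain ⟨N, ⟨δ, _hδ, Θ, _hΘ, h⟩, hN1⟩ := (h.and (Filter.eventually_ge_atTop 1)).exists
  have hL := sideLength_succ_pos (show (0 : ℝ) < ρ₀ / 2 by positivity) N
  have h := h (productWave (N + 1) hL e0)
    (by rw [periodicGroundStateEnergy_one_eq_top (by omega)]; exact le_top)
  rw [insertionOverlap_productWave_succ N hL e0_ne_zero] at h
  simp only [nnnorm_zero, ENNReal.coe_zero, ne_eq, OfNat.ofNat_ne_zero, not_false_eq_true,
    zero_pow, mul_zero, nonpos_iff_eq_zero, ENNReal.ofReal_eq_zero] at h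
  linarith


/-! ## §5 Tightness: the insertion overlap is a probability (`c ≤ 1` is forced and attained) -/

/-- **Cauchy–Schwarz.** For normalised `Θ` (N bodies) and any `(N+1)`-body function,
`L⁻³ |∫ conj Θ(X) ∫_cell Ψ(x,X) dx dX|² ≤ ⟨Ψ, P_{Ω,0} Ψ⟩` (the tagged zero-mode occupation).
[folklore] -/
theorem overlap_sq_le_taggedZeroModeOccupation {N : ℕ} {L : ℝ} (hL : 0 < L)
    (Θ : PeriodicTrialState N L) (Ψ : PeriodicTrialState (N + 1) L) :
    ENNReal.ofReal ((L ^ 3)⁻¹) *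
      (‖∫ X in cellN N L, conj (Θ.ψ X) * ∫ x in cell L, Ψ.ψ (Matrix.vecCons x X)‖₊ : ℝ≥0∞) ^ 2
      ≤ taggedZeroModeOccupation N L Ψ.ψ := by
  set g : Config N → ℂ := fun X => ∫ x in cell L, Ψ.ψ (Matrix.vecCons x X) with hg_def
  have hg : Measurable g := measurable_setIntegral_vecCons Ψ.contDiff.continuous.measurable _
  have hΘ : Measurable Θ.ψ := Θ.contDiff.continuous.measurable
  have hCS := sq_nnnorm_integral_mul_conj_le (ν := volume.restrict (cellN N L)) (f := g)
    (g := Θ.ψ) hg.aemeasurable hΘ.aemeasurable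
  rw [Θ.norm_eq, mul_one] at hCS
  have hcomm : (∫ X in cellN N L, conj (Θ.ψ X) * g X) = ∫ X in cellN N L, g X * conj (Θ.ψ X) := by
    congr 1; funext X; ring
  rw [hcomm, ENNReal.ofReal_inv_of_pos (by positivity), ENNReal.ofReal_pow hL.le]
  unfold taggedZeroModeOccupation
  gcongr

/-- Hence `L⁻³ |overlap|² ≤ 1`: no version of the target with a constant `c > 1` can hold, and the
insertion overlap is a genuine probability. [folklore] -/
theorem overlap_sq_le_one {N : ℕ} {L : ℝ} (hL : 0 < L)
    (Θ : PeriodicTrialState N L) (Ψ : PeriodicTrialState (N + 1) L) :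
    ENNReal.ofReal ((L ^ 3)⁻¹) *
      (‖∫ X in cellN N L, conj (Θ.ψ X) * ∫ x in cell L, Ψ.ψ (Matrix.vecCons x X)‖₊ : ℝ≥0∞) ^ 2
      ≤ 1 := by
  refine (overlap_sq_le_taggedZeroModeOccupation hL Θ Ψ).trans ?_
  have h := Ψ.toTagged.taggedZeroModeOccupation_le_one
  rwa [PeriodicTrialState.toTagged_ψ] at h

/-- **The analytic core of `ResidueCondenses` (item 12059)**: `(N+1) L⁻³ |overlap|² ≤ ⟨Ψ, n₀ Ψ⟩`,
so an insertion residue `≥ c` forces `condensateOccupation ≥ c (N+1)`. [folklore] -/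
theorem succ_mul_overlap_sq_le_condensateOccupation {N : ℕ} {L : ℝ} (hL : 0 < L)
    (Θ : PeriodicTrialState N L) (Ψ : PeriodicTrialState (N + 1) L) :
    (N + 1 : ℝ≥0∞) * (ENNReal.ofReal ((L ^ 3)⁻¹) *
      (‖∫ X in cellN N L, conj (Θ.ψ X) * ∫ x in cell L, Ψ.ψ (Matrix.vecCons x X)‖₊ : ℝ≥0∞) ^ 2)
      ≤ condensateOccupation (N + 1) L Ψ.ψ := by
  rw [← succ_mul_taggedZeroModeOccupation hL Ψ.ψ]
  gcongr
  exact overlap_sq_le_taggedZeroModeOccupation hL Θ Ψ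

/-! ## §6 Cell integrals of plane waves over `cellN` (Fubini) -/

section CellNIntegrals

variable {M : ℕ} {L : ℝ}

/-- Fubini on the fundamental cell for product integrands:
`∫_{[0,L)^{3M}} ∏ᵢ fᵢ(xᵢ) dX = ∏ᵢ ∫_{[0,L)³} fᵢ`. [folklore] -/
theorem setIntegral_cellN_prod (L : ℝ) (f : Fin M → Space → ℂ) :
    ∫ X in cellN M L, ∏ i, f i (X i) = ∏ i, ∫ x in cell L, f i x := by
  have h : cellN M L = Set.univ.pi fun _ : Fin M => cell L := by ext X; simp [cellN]
  rw [h, volume_pi, Measure.restrict_pi_pi, integral_fintype_prod_eq_prod]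

/-- `∫_{[0,L)³} c = L³ c`. [folklore] -/
theorem setIntegral_cell_const (hL : 0 ≤ L) (c : ℂ) : ∫ _ in cell L, c = ((L ^ 3 : ℝ) : ℂ) * c := by
  rw [setIntegral_const, Measure.real, volume_cell, ← ENNReal.ofReal_pow hL,
    ENNReal.toReal_ofReal (pow_nonneg hL 3), Complex.real_smul]

/-- `∫_{[0,L)^{3M}} c = L^{3M} c`. [folklore] -/
theorem setIntegral_cellN_const (hL : 0 ≤ L) (c : ℂ) :
    ∫ _ in cellN M L, c = (((L ^ 3) ^ M : ℝ) : ℂ) * c := by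
  rw [setIntegral_const, Measure.real, volume_cellN, ← ENNReal.ofReal_pow hL,
    ← ENNReal.ofReal_pow (pow_nonneg hL 3), ENNReal.toReal_ofReal (by positivity), Complex.real_smul]

/-- `∫_{[0,L)^{3M}} e_n(xⱼ) dX = 0` for `n ≠ 0`. [folklore] -/
theorem setIntegral_cellN_cellWave_apply (hL : 0 < L) {n : Fin 3 → ℤ} (hn : n ≠ 0) (j : Fin M) :
    ∫ X in cellN M L, cellWave L n (X j) = 0 := by
  have h := setIntegral_cellN_prod L (fun i x => if i = j then cellWave L n x else 1)
  simp only [Finset.prod_ite_eq', Finset.mem_univ, if_true] at h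
  rw [h]
  exact Finset.prod_eq_zero (Finset.mem_univ j) (by
    simp only [if_true]
    exact integral_cell_cellWave_eq_zero hL hn)

/-- `∫_{[0,L)^{3M}} e_n(xⱼ) conj(e_n(x_l)) dX = 0` for `j ≠ l`, `n ≠ 0`. [folklore] -/
theorem setIntegral_cellN_cellWave_mul_conj (hL : 0 < L) {n : Fin 3 → ℤ} (hn : n ≠ 0)
    {j l : Fin M} (hjl : j ≠ l) :
    ∫ X in cellN M L, cellWave L n (X j) * conj (cellWave L n (X l)) = 0 := by
  set f : Fin M → Space → ℂ := fun i x =>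
    if i = j then cellWave L n x else if i = l then conj (cellWave L n x) else 1 with hf
  have h : ∀ X : Config M, ∏ i, f i (X i) = cellWave L n (X j) * conj (cellWave L n (X l)) := by
    intro X
    rw [← Finset.mul_prod_erase _ _ (Finset.mem_univ j),
      ← Finset.mul_prod_erase _ _ (Finset.mem_erase.2 ⟨hjl.symm, Finset.mem_univ l⟩)]
    have h1 : f j (X j) = cellWave L n (X j) := by simp [hf]
    have h2 : f l (X l) = conj (cellWave L n (X l)) := by simp [hf, hjl.symm]
    have h3 : ∏ i ∈ (Finset.univ.erase j).erase l, f i (X i) = 1 :=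
      Finset.prod_eq_one fun i hi => by
        simp only [Finset.mem_erase] at hi
        simp [hf, hi.1, hi.2.1]
    rw [h1, h2, h3, mul_one]
  have hint := setIntegral_cellN_prod L f
  simp_rw [h] at hint
  rw [hint]
  exact Finset.prod_eq_zero (Finset.mem_univ j) (by
    simp only [hf, if_true]
    exact integral_cell_cellWave_eq_zero hL hn)

/-- `e_n(xⱼ) conj(e_n(xⱼ)) = 1`. [folklore] -/
theorem cellWave_mul_conj_self (L : ℝ) (n : Fin 3 → ℤ) (x : Space) :
    cellWave L n x * conj (cellWave L n x) = 1 := by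
  rw [Complex.mul_conj', norm_cellWave]
  simp

/-- The one-excitation function `F = N_k 1 = ∑ⱼ e_n(xⱼ)` has zero mean on the cell (`n ≠ 0`).
[folklore] -/
theorem setIntegral_cellN_planeWaveSum (hL : 0 < L) {n : Fin 3 → ℤ} (hn : n ≠ 0) :
    ∫ X in cellN M L, planeWaveSum L n X = 0 := by
  unfold planeWaveSum
  rw [integral_finsetSum _ (f := fun (j : Fin M) (Y : Config M) => cellWave L n (Y j)) (fun j _ =>
    integrableOn_cellN (f := fun Y : Config M => cellWave L n (Y j))
      ((contDiff_cellWave L n).continuous.comp (continuous_apply j)) L)]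
  exact Finset.sum_eq_zero fun j _ => setIntegral_cellN_cellWave_apply hL hn j

/-- `∫_{[0,L)^{3M}} |N_k 1|² = M L^{3M}` (orthogonality of the `M` one-particle excitations).
[folklore] -/
theorem setIntegral_cellN_planeWaveSum_mul_conj (hL : 0 < L) {n : Fin 3 → ℤ} (hn : n ≠ 0) :
    ∫ X in cellN M L, planeWaveSum L n X * conj (planeWaveSum L n X) =
      (M : ℂ) * (((L ^ 3) ^ M : ℝ) : ℂ) := by
  have hcont : ∀ j : Fin M, Continuous fun X : Config M => cellWave L n (X j) := fun j =>
    (contDiff_cellWave L n).continuous.comp (continuous_apply j)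
  have hexp : ∀ X : Config M, planeWaveSum L n X * conj (planeWaveSum L n X) =
      ∑ j, ∑ l, cellWave L n (X j) * conj (cellWave L n (X l)) := by
    intro X
    unfold planeWaveSum
    rw [map_sum, Finset.sum_mul_sum]
  simp_rw [hexp]
  rw [integral_finsetSum _
    (f := fun (j : Fin M) (X : Config M) => ∑ l, cellWave L n (X j) * conj (cellWave L n (X l)))
    (fun j _ => ?_)]
  · have hinner : ∀ j : Fin M, (∫ X in cellN M L, ∑ l, cellWave L n (X j) * conj (cellWave L n (X l)))
        = (((L ^ 3) ^ M : ℝ) : ℂ) := by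
      intro j
      rw [integral_finsetSum _
        (f := fun (l : Fin M) (X : Config M) => cellWave L n (X j) * conj (cellWave L n (X l)))
        (fun l _ => ?_)]
      · rw [Finset.sum_eq_single j]
        · simp_rw [cellWave_mul_conj_self]
          rw [setIntegral_cellN_const hL.le, mul_one]
        · intro l _ hlj
          exact setIntegral_cellN_cellWave_mul_conj hL hn (Ne.symm hlj)
        · intro h; exact (h (Finset.mem_univ j)).elim
      · exact integrableOn_cellN (f := fun X : Config M => cellWave L n (X j) * conj (cellWave L n (X l)))
          ((hcont j).mul (hcont l).star) L
    simp_rw [hinner]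
    rw [Finset.sum_const, Finset.card_univ, Fintype.card_fin, nsmul_eq_mul]
  · exact integrableOn_cellN
      (f := fun X : Config M => ∑ l, cellWave L n (X j) * conj (cellWave L n (X l)))
      (continuous_finsetSum _ fun l _ => (hcont j).mul (hcont l).star) L

/-- **Norm of an affine one-excitation function**: for `G = a + b N_k 1`,
`∫_{[0,L)^{3M}} |G|² = (|a|² + M |b|²) L^{3M}` (as an `ℝ≥0∞` lower integral). [folklore] -/
theorem lintegral_cellN_nnnorm_sq_affine (hL : 0 < L) {n : Fin 3 → ℤ} (hn : n ≠ 0) (a b : ℂ) :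
    ∫⁻ X in cellN M L, (‖a + b * planeWaveSum L n X‖₊ : ℝ≥0∞) ^ 2 =
      ENNReal.ofReal ((‖a‖ ^ 2 + M * ‖b‖ ^ 2) * (L ^ 3) ^ M) := by
  set G : Config M → ℂ := fun X => a + b * planeWaveSum L n X with hG
  have hGc : Continuous G := continuous_const.add (continuous_const.mul (contDiff_planeWaveSum L n).continuous)
  have hFc : Continuous (planeWaveSum (M := M) L n) := (contDiff_planeWaveSum L n).continuous
  -- complex computation of ∫ G conj G
  have hcplx : ∫ X in cellN M L, G X * conj (G X) =
      (((‖a‖ ^ 2 + M * ‖b‖ ^ 2) * (L ^ 3) ^ M : ℝ) : ℂ) := by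
    have hexp : ∀ X, G X * conj (G X) = a * conj a + (a * conj b) * conj (planeWaveSum L n X) +
        (b * conj a) * planeWaveSum L n X +
        (b * conj b) * (planeWaveSum L n X * conj (planeWaveSum L n X)) := by
      intro X; simp only [hG, map_add, map_mul]; ring
    simp_rw [hexp]
    have i1 : IntegrableOn (fun _ : Config M => a * conj a) (cellN M L) volume := integrableOn_cellN continuous_const L
    have i2 : IntegrableOn (fun X : Config M => (a * conj b) * conj (planeWaveSum L n X)) (cellN M L) volume :=
      integrableOn_cellN (continuous_const.mul hFc.star) L
    have i3 : IntegrableOn (fun X : Config M => (b * conj a) * planeWaveSum L n X) (cellN M L) volume :=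
      integrableOn_cellN (continuous_const.mul hFc) L
    have i4 : IntegrableOn (fun X : Config M => (b * conj b) * (planeWaveSum L n X * conj (planeWaveSum L n X))) (cellN M L) volume :=
      integrableOn_cellN (continuous_const.mul (hFc.mul hFc.star)) L
    have i12 : IntegrableOn (fun X : Config M =>
        a * conj a + (a * conj b) * conj (planeWaveSum L n X)) (cellN M L) volume := i1.add i2
    have i123 : IntegrableOn (fun X : Config M =>
        a * conj a + (a * conj b) * conj (planeWaveSum L n X) + (b * conj a) * planeWaveSum L n X)
        (cellN M L) volume := i12.add i3
    have e1 : ∫ _ in cellN M L, a * conj a = (((L ^ 3) ^ M : ℝ) : ℂ) * (a * conj a) :=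
      setIntegral_cellN_const hL.le _
    have e2 : ∫ X in cellN M L, (a * conj b) * conj (planeWaveSum L n X) = 0 := by
      rw [integral_const_mul, integral_conj, setIntegral_cellN_planeWaveSum hL hn, map_zero,
        mul_zero]
    have e3 : ∫ X in cellN M L, (b * conj a) * planeWaveSum L n X = 0 := by
      rw [integral_const_mul, setIntegral_cellN_planeWaveSum hL hn, mul_zero]
    have e4 : ∫ X in cellN M L, (b * conj b) * (planeWaveSum L n X * conj (planeWaveSum L n X)) =
        (b * conj b) * ((M : ℂ) * (((L ^ 3) ^ M : ℝ) : ℂ)) := by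
      rw [integral_const_mul, setIntegral_cellN_planeWaveSum_mul_conj hL hn]
    rw [integral_add i123 i4, integral_add i12 i3, integral_add i1 i2, e1, e2, e3, e4,
      Complex.mul_conj', Complex.mul_conj']
    push_cast
    ring
  -- real integral of ‖G‖²
  have hreal : ∫ X in cellN M L, ‖G X‖ ^ 2 = (‖a‖ ^ 2 + M * ‖b‖ ^ 2) * (L ^ 3) ^ M := by
    have h1 : ((∫ X in cellN M L, ‖G X‖ ^ 2 : ℝ) : ℂ) = ∫ X in cellN M L, G X * conj (G X) := by
      rw [← integral_complex_ofReal]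
      congr 1
      funext X
      rw [Complex.mul_conj']
      push_cast
      rfl
    exact_mod_cast h1.trans hcplx
  have hint : IntegrableOn (fun X => ‖G X‖ ^ 2) (cellN M L) volume :=
    integrableOn_cellN (hGc.norm.pow 2) L
  calc ∫⁻ X in cellN M L, (‖G X‖₊ : ℝ≥0∞) ^ 2
      = ∫⁻ X in cellN M L, ENNReal.ofReal (‖G X‖ ^ 2) := by simp_rw [coe_nnnorm_sq_eq_ofReal]
    _ = ENNReal.ofReal (∫ X in cellN M L, ‖G X‖ ^ 2) :=
        (ofReal_integral_eq_lintegral_ofReal hint (Filter.Eventually.of_forall fun X => by positivity)).symm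
    _ = _ := by rw [hreal]

/-! ### Derivative and kinetic energy of the one-excitation function -/

/-- `D(N_k 1)(X) = ∑ⱼ De_n(xⱼ) ∘ projⱼ`. [folklore] -/
theorem hasFDerivAt_planeWaveSum (L : ℝ) (n : Fin 3 → ℤ) (X : Config M) :
    HasFDerivAt (planeWaveSum (M := M) L n)
      (∑ j, (fderiv ℝ (cellWave L n) (X j)).comp (ContinuousLinearMap.proj j)) X := by
  have h : ∀ j : Fin M, HasFDerivAt (fun Y : Config M => cellWave L n (Y j))
      ((fderiv ℝ (cellWave L n) (X j)).comp (ContinuousLinearMap.proj j)) X := fun j => by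
    have := ((hasFDerivAt_cellWave L n (X j)).differentiableAt.hasFDerivAt).comp X
      (hasFDerivAt_apply (𝕜 := ℝ) j X)
    exact this
  show HasFDerivAt (fun Y : Config M => ∑ j, cellWave L n (Y j)) _ X
  exact HasFDerivAt.fun_sum (u := Finset.univ) fun j _ => h j

/-- `∂_{i,c}(N_k 1)(X) = (2πi n_c / L) e_n(xᵢ)`. [folklore] -/
theorem fderiv_planeWaveSum_apply_single (L : ℝ) (n : Fin 3 → ℤ) (X : Config M) (i : Fin M)
    (c : Fin 3) :
    fderiv ℝ (planeWaveSum (M := M) L n) X (Pi.single i (EuclideanSpace.single c 1)) =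
      (2 * Real.pi * Complex.I * (n c) / L) * cellWave L n (X i) := by
  rw [(hasFDerivAt_planeWaveSum L n X).fderiv, FunLike.coe_sum, Finset.sum_apply,
    Finset.sum_eq_single i]
  · rw [ContinuousLinearMap.comp_apply, ContinuousLinearMap.proj_apply, Pi.single_eq_same,
      fderiv_cellWave_apply_single]
  · intro j _ hji
    rw [ContinuousLinearMap.comp_apply, ContinuousLinearMap.proj_apply, Pi.single_eq_of_ne hji,
      map_zero]
  · intro h; exact (h (Finset.mem_univ i)).elim

/-- The squared lattice momentum `|2πn/L|² = ∑_c (2π n_c/L)²`. [folklore] -/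
def momSq (L : ℝ) (n : Fin 3 → ℤ) : ℝ := ∑ c : Fin 3, (2 * Real.pi * (n c) / L) ^ 2

/-- `momSq ≥ 0`. [folklore] -/
theorem momSq_nonneg (L : ℝ) (n : Fin 3 → ℤ) : 0 ≤ momSq L n :=
  Finset.sum_nonneg fun _ _ => sq_nonneg _

/-- `|2π e₀/L|² = (2π/L)²`. [folklore] -/
theorem momSq_e0 (L : ℝ) : momSq L e0 = (2 * Real.pi / L) ^ 2 := by
  simp [momSq, e0, Fin.sum_univ_three]

/-- **Kinetic density of an affine one-excitation function** `G = a + b N_k 1`: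
`|∇G|² ≡ M |b|² |2πn/L|²` (a constant). [folklore] -/
theorem kineticDensity_affine (L : ℝ) (n : Fin 3 → ℤ) (a b : ℂ) (X : Config M) :
    kineticDensity (fun Y : Config M => a + b * planeWaveSum L n Y) X =
      ENNReal.ofReal (M * (‖b‖ ^ 2 * momSq L n)) := by
  have hG : HasFDerivAt (fun Y : Config M => a + b * planeWaveSum L n Y)
      (b • ∑ j, (fderiv ℝ (cellWave L n) (X j)).comp (ContinuousLinearMap.proj j)) X :=
    ((hasFDerivAt_planeWaveSum L n X).const_mul b).const_add a
  unfold kineticDensity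
  rw [hG.fderiv]
  have hterm : ∀ (i : Fin M) (c : Fin 3),
      ((‖(b • ∑ j, (fderiv ℝ (cellWave L n) (X j)).comp (ContinuousLinearMap.proj j))
          (Pi.single i (EuclideanSpace.single c 1))‖₊ : ℝ≥0∞) ^ 2) =
        ENNReal.ofReal (‖b‖ ^ 2 * (2 * Real.pi * (n c) / L) ^ 2) := by
    intro i c
    rw [FunLike.coe_smul, Pi.smul_apply, ← (hasFDerivAt_planeWaveSum L n X).fderiv,
      fderiv_planeWaveSum_apply_single, coe_nnnorm_sq_eq_ofReal, smul_eq_mul]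
    congr 1
    have hr : (2 * ↑Real.pi * Complex.I * ↑(n c) / ↑L : ℂ) =
        ((2 * Real.pi * (n c) / L : ℝ) : ℂ) * Complex.I := by
      push_cast; ring
    rw [hr, norm_mul, norm_mul, norm_mul, Complex.norm_real, Complex.norm_I, norm_cellWave, mul_one,
      mul_one, Real.norm_eq_abs, mul_pow, sq_abs]
  simp_rw [hterm]
  rw [Finset.sum_comm]
  simp_rw [Finset.sum_const, Finset.card_univ, Fintype.card_fin, nsmul_eq_mul]
  rw [← Finset.mul_sum, ← ENNReal.ofReal_sum_of_nonneg (fun c _ => by positivity),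
    ← Finset.mul_sum, ← ENNReal.ofReal_natCast, ← ENNReal.ofReal_mul (by positivity)]
  rfl

/-! ### The normalised one-excitation trial state and its free energy -/

/-- The affine one-excitation function is `C¹`. [folklore] -/
theorem contDiff_affine (L : ℝ) (n : Fin 3 → ℤ) (a b : ℂ) :
    ContDiff ℝ 1 fun Y : Config M => a + b * planeWaveSum L n Y :=
  contDiff_const.add (contDiff_const.mul (contDiff_planeWaveSum L n))

/-- It is periodic. [folklore] -/
theorem affine_periodic (hL : L ≠ 0) (n : Fin 3 → ℤ) (a b : ℂ) (X : Config M) (i : Fin M)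
    (c : Fin 3) :
    (fun Y : Config M => a + b * planeWaveSum L n Y) (X + Pi.single i (EuclideanSpace.single c L)) =
      (fun Y : Config M => a + b * planeWaveSum L n Y) X := by
  simp only [planeWaveSum_periodic hL]

/-- It is Bose-symmetric. [folklore] -/
theorem affine_symm (L : ℝ) (n : Fin 3 → ℤ) (a b : ℂ) (σ : Equiv.Perm (Fin M)) (X : Config M) :
    (fun Y : Config M => a + b * planeWaveSum L n Y) (X ∘ σ) =
      (fun Y : Config M => a + b * planeWaveSum L n Y) X := by
  simp only [planeWaveSum_symm]

/-- Its norm on the cell is finite. [folklore] -/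
theorem lintegral_affine_ne_top (hL : 0 < L) {n : Fin 3 → ℤ} (hn : n ≠ 0) (a b : ℂ) :
    ∫⁻ X in cellN M L, (‖a + b * planeWaveSum L n X‖₊ : ℝ≥0∞) ^ 2 ≠ ⊤ := by
  rw [lintegral_cellN_nnnorm_sq_affine hL hn]
  exact ENNReal.ofReal_ne_top

/-- Its norm on the cell is non-zero as soon as `(a, b) ≠ 0` and `M ≥ 1`. [folklore] -/
theorem lintegral_affine_ne_zero (hL : 0 < L) (hM : 0 < M) {n : Fin 3 → ℤ} (hn : n ≠ 0) {a b : ℂ}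
    (hab : a ≠ 0 ∨ b ≠ 0) :
    ∫⁻ X in cellN M L, (‖a + b * planeWaveSum L n X‖₊ : ℝ≥0∞) ^ 2 ≠ 0 := by
  rw [lintegral_cellN_nnnorm_sq_affine hL hn, ne_eq, ENNReal.ofReal_eq_zero, not_le]
  have hV : 0 < (L ^ 3) ^ M := by positivity
  have hM' : (0 : ℝ) < M := by exact_mod_cast hM
  rcases hab with ha | hb
  · have : 0 < ‖a‖ := norm_pos_iff.2 ha
    positivity
  · have : 0 < ‖b‖ := norm_pos_iff.2 hb
    positivity

/-- **The normalised one-excitation state** `(a + b N_k 1)/‖·‖`, `(a,b) ≠ 0`, `M ≥ 1`, `n ≠ 0`.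
[folklore] -/
def affineState (hL : 0 < L) (hM : 0 < M) {n : Fin 3 → ℤ} (hn : n ≠ 0) {a b : ℂ}
    (hab : a ≠ 0 ∨ b ≠ 0) : PeriodicTrialState M L :=
  PeriodicTrialState.ofFun (fun Y : Config M => a + b * planeWaveSum L n Y) (contDiff_affine L n a b)
    (affine_periodic hL.ne' n a b) (affine_symm L n a b) (lintegral_affine_ne_zero hL hM hn hab)
    (lintegral_affine_ne_top hL hn a b)

/-- **Free energy of a normalised state** `ψ/‖ψ‖`: `⟨·,-Δ·⟩ = ‖ψ‖⁻² ∫ |∇ψ|²`. [folklore] -/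
theorem periodicEnergy_zero_ofFun (ψ : Config M → ℂ) (hC : ContDiff ℝ 1 ψ)
    (hper : ∀ (X : Config M) (i : Fin M) (a : Fin 3),
      ψ (X + Pi.single i (EuclideanSpace.single a L)) = ψ X)
    (hsymm : ∀ (σ : Equiv.Perm (Fin M)) (X : Config M), ψ (X ∘ σ) = ψ X)
    (h0 : ∫⁻ X in cellN M L, ((‖ψ X‖₊ : ℝ≥0∞)) ^ 2 ≠ 0)
    (htop : ∫⁻ X in cellN M L, ((‖ψ X‖₊ : ℝ≥0∞)) ^ 2 ≠ ⊤) :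
    periodicEnergy 0 (PeriodicTrialState.ofFun ψ hC hper hsymm h0 htop) =
      (∫⁻ X in cellN M L, ((‖ψ X‖₊ : ℝ≥0∞)) ^ 2)⁻¹ * ∫⁻ X in cellN M L, kineticDensity ψ X := by
  set I := ∫⁻ X in cellN M L, ((‖ψ X‖₊ : ℝ≥0∞)) ^ 2 with hI
  have hIpos : 0 < I.toReal := ENNReal.toReal_pos h0 htop
  have hfun : (PeriodicTrialState.ofFun ψ hC hper hsymm h0 htop).ψ =
      fun X => ((Real.sqrt I.toReal)⁻¹ : ℂ) * ψ X := rfl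
  unfold periodicEnergy
  have hint0 : ∀ X : Config M, periodicInteraction 0 L X = 0 := fun X => by
    simp [periodicInteraction, periodizedPotential_zero]
  simp_rw [hint0, zero_mul, add_zero]
  rw [hfun]
  simp_rw [kineticDensity_const_mul_complex]
  rw [lintegral_const_mul' _ _ (ENNReal.pow_ne_top ENNReal.coe_ne_top)]
  congr 1
  rw [coe_nnnorm_sq_eq_ofReal, norm_inv, Complex.norm_real,
    Real.norm_of_nonneg (Real.sqrt_nonneg _), inv_pow, Real.sq_sqrt hIpos.le,
    ENNReal.ofReal_inv_of_pos hIpos, ENNReal.ofReal_toReal htop]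

/-- **The one-excitation state costs at most one quantum**: `⟨Ψ, -ΔΨ⟩ ≤ |2πn/L|²` for
`Ψ = (a + b N_k 1)/‖·‖` (exactly `M|b|²|k|²/(|a|² + M|b|²)`). [folklore] -/
theorem periodicEnergy_zero_affineState_le (hL : 0 < L) (hM : 0 < M) {n : Fin 3 → ℤ} (hn : n ≠ 0)
    {a b : ℂ} (hab : a ≠ 0 ∨ b ≠ 0) :
    periodicEnergy 0 (affineState hL hM hn hab) ≤ ENNReal.ofReal (momSq L n) := by
  unfold affineState
  rw [periodicEnergy_zero_ofFun]
  simp_rw [kineticDensity_affine]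
  rw [setLIntegral_const, volume_cellN, lintegral_cellN_nnnorm_sq_affine hL hn]
  have hV : ((ENNReal.ofReal L) ^ 3) ^ M = ENNReal.ofReal ((L ^ 3) ^ M) := by
    rw [← ENNReal.ofReal_pow hL.le, ← ENNReal.ofReal_pow (by positivity)]
  rw [hV, ← ENNReal.ofReal_mul
    (mul_nonneg (Nat.cast_nonneg _) (mul_nonneg (sq_nonneg _) (momSq_nonneg L n)))]
  have hVpos : 0 < (L ^ 3) ^ M := by positivity
  have hM' : (0 : ℝ) < M := by exact_mod_cast hM
  have hI : 0 < (‖a‖ ^ 2 + M * ‖b‖ ^ 2) * (L ^ 3) ^ M := by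
    rcases hab with ha | hb
    · have : 0 < ‖a‖ := norm_pos_iff.2 ha
      positivity
    · have : 0 < ‖b‖ := norm_pos_iff.2 hb
      positivity
  rw [mul_comm, ← div_eq_mul_inv,
    ENNReal.div_le_iff (ENNReal.ofReal_pos.2 hI).ne' ENNReal.ofReal_ne_top,
    ← ENNReal.ofReal_mul (momSq_nonneg L n)]
  apply ENNReal.ofReal_le_ofReal
  have hp := momSq_nonneg L n
  have h1 : 0 ≤ momSq L n * ‖a‖ ^ 2 * (L ^ 3) ^ M := by positivity
  have key : momSq L n * ((‖a‖ ^ 2 + M * ‖b‖ ^ 2) * (L ^ 3) ^ M) -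
      M * (‖b‖ ^ 2 * momSq L n) * (L ^ 3) ^ M = momSq L n * ‖a‖ ^ 2 * (L ^ 3) ^ M := by ring
  linarith

/-! ### The insertion overlap of the one-excitation state -/

/-- `N_k 1 (x, Y) = e_n(x) + N_k 1 (Y)`. [folklore] -/
theorem planeWaveSum_vecCons (L : ℝ) (n : Fin 3 → ℤ) (x : Space) (Y : Config M) :
    planeWaveSum L n (Matrix.vecCons x Y : Config (M + 1)) = cellWave L n x + planeWaveSum L n Y := by
  unfold planeWaveSum
  rw [Fin.sum_univ_succ, Matrix.cons_val_zero]
  simp only [Matrix.cons_val_succ]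

/-- The tagged zero-mode integral of the affine function: `∫_cell (a + bN_k 1)(x,Y)dx = L³(a + b N_k 1(Y))`.
[folklore] -/
theorem setIntegral_cell_affine_vecCons (hL : 0 < L) {n : Fin 3 → ℤ} (hn : n ≠ 0) (a b : ℂ)
    (Y : Config M) :
    ∫ x in cell L, (a + b * planeWaveSum L n (Matrix.vecCons x Y : Config (M + 1))) =
      ((L ^ 3 : ℝ) : ℂ) * (a + b * planeWaveSum L n Y) := by
  simp_rw [planeWaveSum_vecCons, mul_add]
  have i1 : IntegrableOn (fun _ : Space => a) (cell L) volume := integrableOn_cell continuous_const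
  have i2 : IntegrableOn (fun x : Space => b * cellWave L n x) (cell L) volume :=
    integrableOn_cell (continuous_const.mul (contDiff_cellWave L n).continuous)
  have i3 : IntegrableOn (fun _ : Space => b * planeWaveSum L n Y) (cell L) volume :=
    integrableOn_cell continuous_const
  have i23 : IntegrableOn (fun x : Space => b * cellWave L n x + b * planeWaveSum L n Y) (cell L) volume :=
    i2.add i3
  rw [integral_add i1 i23, integral_add i2 i3, integral_const_mul, integral_cell_cellWave_eq_zero hL hn,
    setIntegral_cell_const hL.le, setIntegral_cell_const hL.le]
  ring

/-- **The insertion overlap of the affine state is the linear form `c L³ (a w₁ + b w₂)`** with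
`w₁ = ∫ conj Θ`, `w₂ = ∫ conj Θ · N_k 1`. [folklore] -/
theorem overlap_affineState {N : ℕ} (hL : 0 < L) {n : Fin 3 → ℤ} (hn : n ≠ 0) {a b : ℂ}
    (hab : a ≠ 0 ∨ b ≠ 0) (Θ : Config N → ℂ) (hΘ : Continuous Θ) :
    ∫ Y in cellN N L, conj (Θ Y) *
        ∫ x in cell L, (affineState (M := N + 1) hL (Nat.succ_pos N) hn hab).ψ (Matrix.vecCons x Y) =
      ((Real.sqrt (∫⁻ X in cellN (N + 1) L,
          ((‖a + b * planeWaveSum L n X‖₊ : ℝ≥0∞)) ^ 2).toReal)⁻¹ : ℂ) * ((L ^ 3 : ℝ) : ℂ) *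
        (a * (∫ Y in cellN N L, conj (Θ Y)) +
          b * ∫ Y in cellN N L, conj (Θ Y) * planeWaveSum L n Y) := by
  unfold affineState
  simp only [PeriodicTrialState.ofFun_apply]
  set C : ℂ := ((Real.sqrt (∫⁻ X in cellN (N + 1) L,
          ((‖a + b * planeWaveSum L n X‖₊ : ℝ≥0∞)) ^ 2).toReal)⁻¹ : ℂ) with hC
  have inner : ∀ Y : Config N,
      (∫ x in cell L, C * (a + b * planeWaveSum L n (Matrix.vecCons x Y : Config (N + 1)))) =
        C * (((L ^ 3 : ℝ) : ℂ) * (a + b * planeWaveSum L n Y)) := fun Y => by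
    rw [integral_const_mul, setIntegral_cell_affine_vecCons hL hn]
  simp_rw [inner]
  have hF : Continuous (planeWaveSum (M := N) L n) := (contDiff_planeWaveSum L n).continuous
  have i1 : IntegrableOn (fun Y : Config N => conj (Θ Y) * a) (cellN N L) volume :=
    integrableOn_cellN (hΘ.star.mul continuous_const) L
  have i2 : IntegrableOn (fun Y : Config N => conj (Θ Y) * (b * planeWaveSum L n Y)) (cellN N L) volume :=
    integrableOn_cellN (hΘ.star.mul (continuous_const.mul hF)) L
  have hexp : ∀ Y : Config N, conj (Θ Y) * (C * (((L ^ 3 : ℝ) : ℂ) * (a + b * planeWaveSum L n Y))) =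
      (C * ((L ^ 3 : ℝ) : ℂ)) * (conj (Θ Y) * a + conj (Θ Y) * (b * planeWaveSum L n Y)) := by
    intro Y; ring
  simp_rw [hexp]
  have e1 : ∫ Y in cellN N L, conj (Θ Y) * a = (∫ Y in cellN N L, conj (Θ Y)) * a :=
    integral_mul_const a _
  have e2 : ∫ Y in cellN N L, conj (Θ Y) * (b * planeWaveSum L n Y) =
      b * ∫ Y in cellN N L, conj (Θ Y) * planeWaveSum L n Y := by
    have : (fun Y : Config N => conj (Θ Y) * (b * planeWaveSum L n Y)) =
        fun Y => b * (conj (Θ Y) * planeWaveSum L n Y) := by funext Y; ring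
    rw [this, integral_const_mul]
  rw [integral_const_mul (C * ((L ^ 3 : ℝ) : ℂ)), integral_add i1 i2, e1, e2]
  ring

end CellNIntegrals


/-! ## §7 Quantifier order: the energy window must shrink with `N` -/

/-- `InsertionResidue` with the window `δ` chosen BEFORE `N` (`∃ δ, ∀ᶠ N` instead of
`∀ᶠ N, ∃ δ`; everything else verbatim): an `N`-uniform near-minimiser window. -/
def InsertionResidueUniformWindow : Prop :=
  ∀ v : ℝ → ENNReal, IsRepulsiveFiniteRange v → ∃ ρ₀ : ℝ, 0 < ρ₀ ∧ ∀ ρ : ℝ, 0 < ρ → ρ < ρ₀ →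
    ∃ c : ℝ, 0 < c ∧ ∃ δ : ENNReal, 0 < δ ∧ ∀ᶠ N : ℕ in Filter.atTop,
      ∃ Θ : PeriodicTrialState N (sideLength ρ (N + 1)),
        periodicEnergy v Θ ≤ periodicGroundStateEnergy v N (sideLength ρ (N + 1)) + δ ∧
        ∀ Ψ : PeriodicTrialState (N + 1) (sideLength ρ (N + 1)),
          periodicEnergy v Ψ ≤ periodicGroundStateEnergy v (N + 1) (sideLength ρ (N + 1)) + δ →
          ENNReal.ofReal c ≤ ENNReal.ofReal ((sideLength ρ (N + 1) ^ 3)⁻¹) *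
            (‖∫ X in cellN N (sideLength ρ (N + 1)), conj (Θ.ψ X) *
                ∫ x in cell (sideLength ρ (N + 1)), Ψ.ψ (Matrix.vecCons x X)‖₊ : ENNReal) ^ 2

/-- `L³ = (N+1)/ρ` for `L = sideLength ρ (N+1)`. [folklore] -/
theorem sideLength_succ_pow_three {ρ : ℝ} (hρ : 0 < ρ) (N : ℕ) :
    sideLength ρ (N + 1) ^ 3 = ((N : ℝ) + 1) / ρ := by
  unfold sideLength
  rw [← Real.rpow_natCast, ← Real.rpow_mul (by positivity)]
  norm_num

/-- **The one-excitation energy `(2π/L)²` eventually fits in any fixed window.** [folklore] -/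
theorem exists_window_threshold {ρ d : ℝ} (hρ : 0 < ρ) (hd : 0 < d) :
    ∃ N₀ : ℕ, ∀ N : ℕ, N₀ ≤ N → (2 * Real.pi / sideLength ρ (N + 1)) ^ 2 ≤ d := by
  set K : ℝ := max 1 (4 * Real.pi ^ 2 / d) with hK
  refine ⟨⌈ρ * K ^ 3⌉₊, fun N hN => ?_⟩
  have hL := sideLength_succ_pos hρ N
  set L := sideLength ρ (N + 1) with hLdef
  have hL3 : L ^ 3 = ((N : ℝ) + 1) / ρ := sideLength_succ_pow_three hρ N
  have hK1 : 1 ≤ K := le_max_left _ _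
  have hKd : 4 * Real.pi ^ 2 / d ≤ K := le_max_right _ _
  have hK0 : 0 ≤ K := zero_le_one.trans hK1
  have hNK : ρ * K ^ 3 ≤ (N : ℝ) + 1 := by
    have h1 : ρ * K ^ 3 ≤ ⌈ρ * K ^ 3⌉₊ := Nat.le_ceil _
    have h2 : (⌈ρ * K ^ 3⌉₊ : ℝ) ≤ N := by exact_mod_cast hN
    linarith
  have hLK3 : K ^ 3 ≤ L ^ 3 := by
    rw [hL3, le_div_iff₀ hρ]
    linarith [mul_comm ρ (K ^ 3)]
  have hLK : K ≤ L := le_of_pow_le_pow_left₀ (by norm_num) hL.le hLK3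
  have hL1 : 1 ≤ L := hK1.trans hLK
  have hdL : 4 * Real.pi ^ 2 ≤ d * L := by
    have := hKd.trans hLK
    rw [div_le_iff₀ hd] at this
    linarith
  rw [div_pow, div_le_iff₀ (by positivity)]
  nlinarith [hdL, hL1, hd.le, mul_le_mul_of_nonneg_left hL1 hd.le]

/-- **For every `Θ` there is a free `(N+1)`-body state within ONE excitation quantum of the ground
state and with ZERO insertion overlap** (the linear form `Ψ ↦ ⟨φ₀ ⊗ Θ, Ψ⟩` has a kernel meeting
the plane spanned by the condensate `1` and the one-phonon state `N_k 1`, `k = 2π e₀/L`). [folklore] -/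
theorem exists_lowEnergy_zero_overlap {N : ℕ} {L : ℝ} (hL : 0 < L) (Θ : Config N → ℂ)
    (hΘ : Continuous Θ) :
    ∃ Ψ : PeriodicTrialState (N + 1) L,
      periodicEnergy 0 Ψ ≤ ENNReal.ofReal ((2 * Real.pi / L) ^ 2) ∧
      ∫ Y in cellN N L, conj (Θ Y) * ∫ x in cell L, Ψ.ψ (Matrix.vecCons x Y) = 0 := by
  set w₁ : ℂ := ∫ Y in cellN N L, conj (Θ Y) with hw₁
  set w₂ : ℂ := ∫ Y in cellN N L, conj (Θ Y) * planeWaveSum L e0 Y with hw₂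
  by_cases hw : w₁ = 0
  · have hab : (1 : ℂ) ≠ 0 ∨ (0 : ℂ) ≠ 0 := Or.inl one_ne_zero
    refine ⟨affineState hL (Nat.succ_pos N) e0_ne_zero hab, ?_, ?_⟩
    · exact (periodicEnergy_zero_affineState_le hL _ e0_ne_zero hab).trans_eq (by rw [momSq_e0])
    · rw [overlap_affineState hL e0_ne_zero hab Θ hΘ, ← hw₁, hw]
      ring
  · have hab : w₂ ≠ 0 ∨ -w₁ ≠ 0 := Or.inr (neg_ne_zero.2 hw)
    refine ⟨affineState hL (Nat.succ_pos N) e0_ne_zero hab, ?_, ?_⟩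
    · exact (periodicEnergy_zero_affineState_le hL _ e0_ne_zero hab).trans_eq (by rw [momSq_e0])
    · rw [overlap_affineState hL e0_ne_zero hab Θ hΘ, ← hw₁, ← hw₂]
      ring

/-- **Per-box form of the obstruction**: at `v = 0`, as soon as the window `δ` is at least ONE
excitation quantum `(2π/L)²`, every `Θ` admits a `δ`-near-minimiser of the `(N+1)`-body problem with
ZERO insertion overlap. So in `InsertionResidue` at `v = 0` necessarily `δ_N < (2π/L_N)² = 4π² (ρ/(N+1))^{2/3}`.
[folklore] -/
theorem exists_nearMinimiser_zero_overlap_of_gap_le_window {N : ℕ} {L : ℝ} (hL : 0 < L)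
    {δ : ℝ≥0∞} (hδ : ENNReal.ofReal ((2 * Real.pi / L) ^ 2) ≤ δ) (Θ : Config N → ℂ)
    (hΘ : Continuous Θ) :
    ∃ Ψ : PeriodicTrialState (N + 1) L,
      periodicEnergy 0 Ψ ≤ periodicGroundStateEnergy 0 (N + 1) L + δ ∧
      ∫ Y in cellN N L, conj (Θ Y) * ∫ x in cell L, Ψ.ψ (Matrix.vecCons x Y) = 0 := by
  obtain ⟨Ψ, hE, hO⟩ := exists_lowEnergy_zero_overlap hL Θ hΘ
  exact ⟨Ψ, (hE.trans hδ).trans le_add_self, hO⟩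

/-- **The `N`-uniform window is FALSE** (at `v = 0`, every density): however small `δ > 0` is,
once `(2π/L)² ≤ δ` (i.e. `N + 1 ≥ ρ (2π)³ δ^{-3/2}`) the window contains, for every `Θ`, a state
with zero insertion overlap. Consequently in `InsertionResidue` the admissible `δ_N` is at most
the first excitation energy of the `(N+1)`-body torus Hamiltonian (free: `4π²/L² ∼ N^{-2/3}`;
interacting: the phonon `c_s 2π/L ∼ N^{-1/3}`), and any proof must use `δ`'s dependence on `N`.
[folklore] -/
theorem insertionResidue_false_uniformWindow : ¬ InsertionResidueUniformWindow := by
  intro h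
  obtain ⟨ρ₀, hρ₀, h⟩ := h 0 isRepulsiveFiniteRange_zero
  have hρ : (0 : ℝ) < ρ₀ / 2 := by positivity
  obtain ⟨c, hc, δ, hδ, hev⟩ := h (ρ₀ / 2) hρ (by linarith)
  obtain ⟨N₀, hN₀⟩ : ∃ N₀ : ℕ, ∀ N : ℕ, N₀ ≤ N →
      ENNReal.ofReal ((2 * Real.pi / sideLength (ρ₀ / 2) (N + 1)) ^ 2) ≤ δ := by
    by_cases htop : δ = ⊤
    · exact ⟨0, fun N _ => htop ▸ le_top⟩
    · obtain ⟨N₀, hN₀⟩ := exists_window_threshold hρ (ENNReal.toReal_pos hδ.ne' htop)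
      exact ⟨N₀, fun N hN => (ENNReal.ofReal_le_ofReal (hN₀ N hN)).trans ENNReal.ofReal_toReal_le⟩
  obtain ⟨N, ⟨Θ, _hΘ, H⟩, hN⟩ := (hev.and (Filter.eventually_ge_atTop N₀)).exists
  have hL := sideLength_succ_pos hρ N
  obtain ⟨Ψ, hE, hO⟩ := exists_lowEnergy_zero_overlap hL Θ.ψ Θ.contDiff.continuous
  have hwin : periodicEnergy 0 Ψ ≤
      periodicGroundStateEnergy 0 (N + 1) (sideLength (ρ₀ / 2) (N + 1)) + δ :=
    (hE.trans (hN₀ N hN)).trans le_add_self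
  have h := H Ψ hwin
  rw [hO] at h
  simp only [nnnorm_zero, ENNReal.coe_zero, ne_eq, OfNat.ofNat_ne_zero, not_false_eq_true,
    zero_pow, mul_zero, nonpos_iff_eq_zero, ENNReal.ofReal_eq_zero] at h
  linarith


/-! ## §8 The constant `c`: no target with `c > 1`, and `c = 1` is attained by the free gas -/

/-- `InsertionResidue` with a FIXED constant `c` in place of `∃ c > 0` (everything else verbatim). -/
def InsertionResidueConst (c : ℝ) : Prop :=
  ∀ v : ℝ → ENNReal, IsRepulsiveFiniteRange v → ∃ ρ₀ : ℝ, 0 < ρ₀ ∧ ∀ ρ : ℝ, 0 < ρ → ρ < ρ₀ →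
    ∀ᶠ N : ℕ in Filter.atTop, ∃ δ : ENNReal, 0 < δ ∧
      ∃ Θ : PeriodicTrialState N (sideLength ρ (N + 1)),
        periodicEnergy v Θ ≤ periodicGroundStateEnergy v N (sideLength ρ (N + 1)) + δ ∧
        ∀ Ψ : PeriodicTrialState (N + 1) (sideLength ρ (N + 1)),
          periodicEnergy v Ψ ≤ periodicGroundStateEnergy v (N + 1) (sideLength ρ (N + 1)) + δ →
          ENNReal.ofReal c ≤ ENNReal.ofReal ((sideLength ρ (N + 1) ^ 3)⁻¹) *
            (‖∫ X in cellN N (sideLength ρ (N + 1)), conj (Θ.ψ X) *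
                ∫ x in cell (sideLength ρ (N + 1)), Ψ.ψ (Matrix.vecCons x X)‖₊ : ENNReal) ^ 2

/-- The constant state (`b = 0`) has zero free energy. [folklore] -/
theorem periodicEnergy_zero_affineState_const {M : ℕ} {L : ℝ} (hL : 0 < L) (hM : 0 < M)
    {n : Fin 3 → ℤ} (hn : n ≠ 0) {a : ℂ} (hab : a ≠ 0 ∨ (0 : ℂ) ≠ 0) :
    periodicEnergy 0 (affineState hL hM hn hab) = 0 := by
  unfold affineState
  rw [periodicEnergy_zero_ofFun]
  simp_rw [kineticDensity_affine]
  simp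

/-- **No insertion residue above `1`.** For every `c > 1` the fixed-constant target is false
(already for `v = 0`: the constant state is a near-minimiser and §5 bounds the quantity by `1`).
[folklore] -/
theorem not_insertionResidueConst_of_one_lt {c : ℝ} (hc : 1 < c) : ¬ InsertionResidueConst c := by
  intro h
  obtain ⟨ρ₀, hρ₀, h⟩ := h 0 isRepulsiveFiniteRange_zero
  have hρ : (0 : ℝ) < ρ₀ / 2 := by positivity
  obtain ⟨N, δ, _hδ, Θ, _hΘ, H⟩ := (h (ρ₀ / 2) hρ (by linarith)).exists
  have hL := sideLength_succ_pos hρ N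
  have hab : (1 : ℂ) ≠ 0 ∨ (0 : ℂ) ≠ 0 := Or.inl one_ne_zero
  have hwin : periodicEnergy 0 (affineState (M := N + 1) hL (Nat.succ_pos N) e0_ne_zero hab) ≤
      periodicGroundStateEnergy 0 (N + 1) (sideLength (ρ₀ / 2) (N + 1)) + δ := by
    rw [periodicEnergy_zero_affineState_const hL (Nat.succ_pos N) e0_ne_zero hab]
    exact zero_le
  have h1 := (H _ hwin).trans (overlap_sq_le_one hL Θ _)
  rw [ENNReal.ofReal_le_one] at h1
  linarith

/-- `e_0 = 1` for the plane waves of §2. [folklore] -/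
theorem pw_k_zero (L : ℝ) (x : Space) : pw L 0 x = 1 := by
  simp [pw, phase]

/-- The constant product state is the constant `L^{-3N/2}`. [folklore] -/
theorem productWave_zero_ψ (N : ℕ) {L : ℝ} (hL : 0 < L) (X : Config N) :
    (productWave N hL 0).ψ X = (normConst N L : ℂ) := by
  rw [productWave_ψ, Finset.prod_eq_one (fun j _ => pw_k_zero L (X j)), mul_one]

/-- **`c = 1` is attained**: inserting a zero-momentum particle into the free `N`-body ground state
(the constant) gives exactly the free `(N+1)`-body ground state: `L⁻³ |⟨φ₀ ⊗ Θ₀, Ψ₀⟩|² = 1`.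
So the Cauchy–Schwarz bound of §5 is sharp and the free gas has insertion residue `1`. [folklore] -/
theorem overlap_sq_const_const (N : ℕ) {L : ℝ} (hL : 0 < L) :
    ENNReal.ofReal ((L ^ 3)⁻¹) *
      (‖∫ X in cellN N L, conj ((productWave N hL 0).ψ X) *
          ∫ x in cell L, (productWave (N + 1) hL 0).ψ (Matrix.vecCons x X)‖₊ : ℝ≥0∞) ^ 2 = 1 := by
  have hL3 : 0 < L ^ 3 := by positivity
  set s : ℝ := Real.sqrt (L ^ 3) with hs
  have hs0 : 0 < s := Real.sqrt_pos.2 hL3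
  have hs2 : s ^ 2 = L ^ 3 := Real.sq_sqrt hL3.le
  simp_rw [productWave_zero_ψ]
  rw [setIntegral_cell_const hL.le, Complex.conj_ofReal, setIntegral_cellN_const hL.le]
  -- the overlap is the real number r = (L³)^N L^{-3N/2} L³ L^{-3(N+1)/2} = √(L³)
  have hr : ((((L ^ 3) ^ N : ℝ) : ℂ) * ((normConst N L : ℂ) * (((L ^ 3 : ℝ) : ℂ) *
      (normConst (N + 1) L : ℂ)))) = (s : ℂ) := by
    have hreal : (L ^ 3) ^ N * (normConst N L * (L ^ 3 * normConst (N + 1) L)) = s := by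
      unfold normConst
      rw [← hs, ← hs2, inv_pow, inv_pow]
      field_simp
      ring
    exact_mod_cast hreal
  rw [hr, coe_nnnorm_sq_eq_ofReal, Complex.norm_real, Real.norm_of_nonneg hs0.le, hs2,
    ← ENNReal.ofReal_mul (inv_nonneg.2 hL3.le), inv_mul_cancel₀ hL3.ne', ENNReal.ofReal_one]


/-! ## §9 Pitfall for the lines (card healing-scale-kac-insertion, lemma `ResidueStability`):
the residue-stability inequality needs `θ ≤ 1` -/

/-- **The abstract residue-stability inequality is FALSE without `θ ≤ 1`.** The card's transfer
`Z(h) ≥ (1 − √θ)² Z(h_κ)` rests on "`(1 − √θ)² (∫g)² ∫h² ≤ (∫h)² ∫g²` whenever `∫g = ∫h` and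
`∫(h−g)² ≤ θ ∫h²`"; this holds for `θ ≤ 1` (reverse triangle inequality `‖g‖ ≥ ‖h‖ − ‖h − g‖`) but
not for all `θ ≥ 0`: two-point space, `h = (11, −9)`, `g = (1, 1)`, `θ = 4` (`∑(h−g)² = 200 ≤ 4·202`,
yet `(1−2)²·2²·202 = 808 > 2²·2 = 8`). Any typed version must carry `θ ≤ 1` (or `(1 − √θ)₊`).
[folklore] -/
theorem residueStability_false_without_theta_le_one :
    ¬ ∀ (θ : ℝ) (h g : Fin 2 → ℝ), 0 ≤ θ → ∑ i, g i = ∑ i, h i →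
        ∑ i, (h i - g i) ^ 2 ≤ θ * ∑ i, (h i) ^ 2 →
        (1 - Real.sqrt θ) ^ 2 * (∑ i, g i) ^ 2 * ∑ i, (h i) ^ 2 ≤ (∑ i, h i) ^ 2 * ∑ i, (g i) ^ 2 := by
  intro H
  have h4 : Real.sqrt 4 = 2 := by
    rw [show (4 : ℝ) = 2 ^ 2 by norm_num, Real.sqrt_sq (by norm_num)]
  have := H 4 ![11, -9] ![1, 1] (by norm_num) (by simp [Fin.sum_univ_two]; norm_num)
    (by simp [Fin.sum_univ_two]; norm_num)
  simp [Fin.sum_univ_two, h4] at this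
  norm_num at this

/-- …and it is TRUE for `θ ≤ 1` (the form the card actually uses, with `θ = 1/16`): from
`√(∑g²) ≥ √(∑h²) − √(∑(h−g)²) ≥ (1 − √θ)√(∑h²) ≥ 0`. Recorded here for two-point spaces as a sanity
anchor; the general `L²` version is the same one-line argument. [folklore] -/
theorem residueStability_two_point {θ : ℝ} (hθ0 : 0 ≤ θ) (hθ1 : θ ≤ 1) (h g : Fin 2 → ℝ)
    (hmean : ∑ i, g i = ∑ i, h i) (hclose : ∑ i, (h i - g i) ^ 2 ≤ θ * ∑ i, (h i) ^ 2) :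
    (1 - Real.sqrt θ) ^ 2 * (∑ i, g i) ^ 2 * ∑ i, (h i) ^ 2 ≤ (∑ i, h i) ^ 2 * ∑ i, (g i) ^ 2 := by
  rw [hmean]
  have hH : 0 ≤ ∑ i, (h i) ^ 2 := Finset.sum_nonneg fun i _ => sq_nonneg _
  have hG : 0 ≤ ∑ i, (g i) ^ 2 := Finset.sum_nonneg fun i _ => sq_nonneg _
  have hD : 0 ≤ ∑ i, (h i - g i) ^ 2 := Finset.sum_nonneg fun i _ => sq_nonneg _
  -- norms
  set nh := Real.sqrt (∑ i, (h i) ^ 2) with hnh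
  set ng := Real.sqrt (∑ i, (g i) ^ 2) with hng
  set nd := Real.sqrt (∑ i, (h i - g i) ^ 2) with hnd
  have hsθ : Real.sqrt θ ≤ 1 := Real.sqrt_le_one.mpr hθ1
  have hsθ0 : 0 ≤ Real.sqrt θ := Real.sqrt_nonneg _
  -- triangle inequality in ℝ² (Euclidean): nh ≤ ng + nd
  have htri : nh ≤ ng + nd := by
    -- (nh)² = ∑ h² = ∑ (g + (h-g))² ≤ (ng + nd)² by Cauchy–Schwarz on the cross term
    have hcs2 : (∑ i, g i * (h i - g i)) ^ 2 ≤ (∑ i, (g i) ^ 2) * ∑ i, (h i - g i) ^ 2 :=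
      Finset.sum_mul_sq_le_sq_mul_sq _ _ _
    have hcs : ∑ i, g i * (h i - g i) ≤ ng * nd := by
      have habs : |∑ i, g i * (h i - g i)| ≤ ng * nd := by
        rw [← Real.sqrt_sq_eq_abs, hng, hnd, ← Real.sqrt_mul hG]
        exact Real.sqrt_le_sqrt hcs2
      exact (le_abs_self _).trans habs
    have hsq : nh ^ 2 ≤ (ng + nd) ^ 2 := by
      rw [hnh, Real.sq_sqrt hH, add_sq, hng, hnd, Real.sq_sqrt hG, Real.sq_sqrt hD]
      have : ∑ i, (h i) ^ 2 = ∑ i, (g i) ^ 2 + 2 * ∑ i, g i * (h i - g i) + ∑ i, (h i - g i) ^ 2 := by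
        simp only [Fin.sum_univ_two]; ring
      rw [this]
      nlinarith [hcs, Real.sqrt_nonneg (∑ i, (g i) ^ 2), Real.sqrt_nonneg (∑ i, (h i - g i) ^ 2)]
    nlinarith [hsq, Real.sqrt_nonneg (∑ i, (h i) ^ 2), Real.sqrt_nonneg (∑ i, (g i) ^ 2),
      Real.sqrt_nonneg (∑ i, (h i - g i) ^ 2)]
  -- nd ≤ √θ nh
  have hnd_le : nd ≤ Real.sqrt θ * nh := by
    rw [hnd, hnh, ← Real.sqrt_mul hθ0]
    exact Real.sqrt_le_sqrt hclose
  -- hence (1 - √θ) nh ≤ ng, both sides ≥ 0 after clipping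
  have hkey : (1 - Real.sqrt θ) * nh ≤ ng := by nlinarith [htri, hnd_le, Real.sqrt_nonneg (∑ i, (h i) ^ 2)]
  have hlhs0 : 0 ≤ (1 - Real.sqrt θ) * nh := mul_nonneg (by linarith) (Real.sqrt_nonneg _)
  have hsq := mul_self_le_mul_self hlhs0 hkey
  have e1 : nh * nh = ∑ i, (h i) ^ 2 := by rw [hnh, Real.mul_self_sqrt hH]
  have e2 : ng * ng = ∑ i, (g i) ^ 2 := by rw [hng, Real.mul_self_sqrt hG]
  have hS0 : 0 ≤ (∑ i, h i) ^ 2 := sq_nonneg _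
  calc (1 - Real.sqrt θ) ^ 2 * (∑ i, h i) ^ 2 * ∑ i, (h i) ^ 2
      = (∑ i, h i) ^ 2 * ((1 - Real.sqrt θ) * nh * ((1 - Real.sqrt θ) * nh)) := by rw [← e1]; ring
    _ ≤ (∑ i, h i) ^ 2 * (ng * ng) := by gcongr
    _ = (∑ i, h i) ^ 2 * ∑ i, (g i) ^ 2 := by rw [e2]


/-! ## §10 Load-bearing: diluteness (`∃ ρ₀`, `ρ < ρ₀`) — hard spheres jam at high density -/

/-- The hard core of radius `1`: `v(r) = ⊤` for `r ≤ 1`, `0` beyond (an ADMISSIBLE potential). [folklore] -/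
def hardCore : ℝ → ℝ≥0∞ := fun r => if r ≤ 1 then ⊤ else 0

/-- The hard core is repulsive, measurable and of finite range. [folklore] -/
theorem isRepulsiveFiniteRange_hardCore : IsRepulsiveFiniteRange hardCore :=
  ⟨Measurable.ite measurableSet_Iic measurable_const measurable_const,
    ⟨1, fun r hr => by simp [hardCore, not_le.2 hr]⟩⟩

/-- `InsertionResidue` asserted at EVERY density (`∀ ρ > 0` instead of `∃ ρ₀, ∀ ρ < ρ₀`; everything
else verbatim). -/
def InsertionResidueAllDensities : Prop :=
  ∀ v : ℝ → ENNReal, IsRepulsiveFiniteRange v → ∀ ρ : ℝ, 0 < ρ →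
    ∃ c : ℝ, 0 < c ∧ ∀ᶠ N : ℕ in Filter.atTop, ∃ δ : ENNReal, 0 < δ ∧
      ∃ Θ : PeriodicTrialState N (sideLength ρ (N + 1)),
        periodicEnergy v Θ ≤ periodicGroundStateEnergy v N (sideLength ρ (N + 1)) + δ ∧
        ∀ Ψ : PeriodicTrialState (N + 1) (sideLength ρ (N + 1)),
          periodicEnergy v Ψ ≤ periodicGroundStateEnergy v (N + 1) (sideLength ρ (N + 1)) + δ →
          ENNReal.ofReal c ≤ ENNReal.ofReal ((sideLength ρ (N + 1) ^ 3)⁻¹) *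
            (‖∫ X in cellN N (sideLength ρ (N + 1)), conj (Θ.ψ X) *
                ∫ x in cell (sideLength ρ (N + 1)), Ψ.ψ (Matrix.vecCons x X)‖₊ : ENNReal) ^ 2

/-- Two reals in `[0, L)` with the same subcube index `⌊x m/L⌋₊` are within `L/m`. [folklore] -/
theorem abs_sub_lt_of_floor_eq {L : ℝ} {m : ℕ} (hL : 0 < L) (hm : 0 < (m : ℝ)) {x y : ℝ}
    (hx : 0 ≤ x) (hy : 0 ≤ y) (h : ⌊x * m / L⌋₊ = ⌊y * m / L⌋₊) : |x - y| < L / m := by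
  have h0x : 0 ≤ x * m / L := by positivity
  have h0y : 0 ≤ y * m / L := by positivity
  have hfx := (Nat.floor_eq_iff h0x).1 rfl
  have hfy := (Nat.floor_eq_iff h0y).1 rfl
  rw [h] at hfx
  have hdiff : |x * m / L - y * m / L| < 1 := by
    rw [abs_sub_lt_iff]; constructor <;> linarith [hfx.1, hfx.2, hfy.1, hfy.2]
  have hmL : 0 < (m : ℝ) / L := div_pos hm hL
  have : |x - y| * ((m : ℝ) / L) < 1 := by
    rw [← abs_of_pos hmL, ← abs_mul]
    have : (x - y) * ((m : ℝ) / L) = x * m / L - y * m / L := by ring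
    rw [this]; exact hdiff
  calc |x - y| = |x - y| * ((m : ℝ) / L) * (L / m) := by field_simp
    _ < 1 * (L / m) := by gcongr
    _ = L / m := one_mul _

/-- **Pigeonhole on the cell.** If `m³ < M` and `2L ≤ m` then among the `M` particles of any
configuration of the cell `[0,L)^{3M}` two distinct ones are at distance `≤ 1`. [folklore] -/
theorem exists_close_pair {M m : ℕ} {L : ℝ} (hL : 0 < L) (hm : 2 * L ≤ m) (hcard : m ^ 3 < M)
    (X : Config M) (hX : X ∈ cellN M L) :
    ∃ i j : Fin M, i < j ∧ ‖X i - X j‖ ≤ 1 := by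
  have hm0 : 0 < (m : ℝ) := by linarith
  have hidx : ∀ (i : Fin M) (k : Fin 3), ⌊(X i) k * m / L⌋₊ < m := by
    intro i k
    have hx := hX i k
    have h0 : 0 ≤ (X i) k * m / L := by have := hx.1; positivity
    have h2 : (X i) k * m / L < m := by
      rw [div_lt_iff₀ hL]
      nlinarith [hx.2, hm0]
    exact (Nat.floor_lt h0).2 h2
  let ι : Fin M → (Fin 3 → Fin m) := fun i k => ⟨⌊(X i) k * m / L⌋₊, hidx i k⟩
  have hcardι : Fintype.card (Fin 3 → Fin m) < Fintype.card (Fin M) := by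
    simpa [Fintype.card_fin, Fintype.card_fun] using hcard
  obtain ⟨i, j, hij, hιij⟩ := Fintype.exists_ne_map_eq_of_card_lt ι hcardι
  have hcoord : ∀ k : Fin 3, |(X i) k - (X j) k| < L / m := by
    intro k
    have hk : ⌊(X i) k * m / L⌋₊ = ⌊(X j) k * m / L⌋₊ := by
      have := congrArg (fun f : Fin 3 → Fin m => ((f k : Fin m) : ℕ)) hιij
      simpa [ι] using this
    exact abs_sub_lt_of_floor_eq hL hm0 (hX i k).1 (hX j k).1 hk
  have hLm : L / m ≤ 1 / 2 := by
    rw [div_le_iff₀ hm0]; linarith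
  have hnorm : ‖X i - X j‖ ≤ 1 := by
    rw [EuclideanSpace.norm_eq]
    have hsum : ∑ k, ‖(X i - X j) k‖ ^ 2 ≤ 3 / 4 := by
      have hterm : ∀ k : Fin 3, ‖(X i - X j) k‖ ^ 2 ≤ 1 / 4 := by
        intro k
        rw [PiLp.sub_apply, Real.norm_eq_abs]
        have h1 : |(X i) k - (X j) k| ≤ 1 / 2 := ((hcoord k).le.trans hLm)
        have h0 : 0 ≤ |(X i) k - (X j) k| := abs_nonneg _
        nlinarith
      calc ∑ k, ‖(X i - X j) k‖ ^ 2 ≤ ∑ _k : Fin 3, (1 / 4 : ℝ) := Finset.sum_le_sum fun k _ => hterm k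
        _ = 3 / 4 := by simp; norm_num
    calc Real.sqrt (∑ k, ‖(X i - X j) k‖ ^ 2) ≤ Real.sqrt (3 / 4) := Real.sqrt_le_sqrt hsum
      _ ≤ 1 := by
          rw [Real.sqrt_le_one]; norm_num
  rcases lt_or_gt_of_ne hij with h | h
  · exact ⟨i, j, h, hnorm⟩
  · exact ⟨j, i, h, by rwa [norm_sub_rev]⟩

/-- Above close packing every configuration of the cell has a hard-core encounter, so the periodic
interaction of the hard core is `⊤` on the whole cell. [folklore] -/
theorem periodicInteraction_hardCore_eq_top {M m : ℕ} {L : ℝ} (hL : 0 < L) (hm : 2 * L ≤ m)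
    (hcard : m ^ 3 < M) (X : Config M) (hX : X ∈ cellN M L) :
    periodicInteraction hardCore L X = ⊤ := by
  obtain ⟨i, j, hij, hd⟩ := exists_close_pair hL hm hcard X hX
  unfold periodicInteraction
  refine ENNReal.sum_eq_top.2 ⟨i, Finset.mem_univ _, ENNReal.sum_eq_top.2 ⟨j, ?_, ?_⟩⟩
  · simpa using hij
  · refine top_le_iff.1 ((le_periodizedPotential hardCore L (X i - X j)).trans' ?_)
    simp [hardCore, hd]

/-- Hence above close packing every periodic hard-sphere state has infinite energy. [folklore] -/
theorem periodicEnergy_hardCore_eq_top {M m : ℕ} {L : ℝ} (hL : 0 < L) (hm : 2 * L ≤ m)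
    (hcard : m ^ 3 < M) (Ψ : PeriodicTrialState M L) : periodicEnergy hardCore Ψ = ⊤ := by
  unfold periodicEnergy
  have hmeas : Measurable fun X : Config M => (‖Ψ.ψ X‖₊ : ℝ≥0∞) ^ 2 :=
    (Ψ.contDiff.continuous.measurable.nnnorm.coe_nnreal_ennreal.pow_const 2)
  refine top_le_iff.1 ?_
  calc (⊤ : ℝ≥0∞) = ⊤ * ∫⁻ X in cellN M L, (‖Ψ.ψ X‖₊ : ℝ≥0∞) ^ 2 := by rw [Ψ.norm_eq, mul_one]
    _ = ∫⁻ X in cellN M L, ⊤ * (‖Ψ.ψ X‖₊ : ℝ≥0∞) ^ 2 := (lintegral_const_mul ⊤ hmeas).symm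
    _ ≤ ∫⁻ X in cellN M L, periodicInteraction hardCore L X * (‖Ψ.ψ X‖₊ : ℝ≥0∞) ^ 2 :=
        setLIntegral_mono' (measurableSet_cellN M L) fun X hX => by
          rw [periodicInteraction_hardCore_eq_top hL hm hcard X hX]
    _ ≤ _ := lintegral_mono fun X => le_add_self

/-- **Load-bearing (diluteness).** `InsertionResidue` at ALL densities is FALSE: for the hard core of
radius `1` at density `ρ = 64` (box `L³ = (N+1)/64`, subcubes of side `≤ 1/2`: `⌈2L⌉³ < 27L³ < N+1`
once `L ≥ 1`) no configuration avoids an encounter, every `(N+1)`-body energy is `⊤`, every state is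
a near-minimiser, and the boosted condensate of §2 has zero insertion overlap. Any proof must use
`ρ < ρ₀(v)` (below close packing for hard cores). [folklore] -/
theorem insertionResidue_false_allDensities : ¬ InsertionResidueAllDensities := by
  intro h
  obtain ⟨c, hc, hev⟩ := h hardCore isRepulsiveFiniteRange_hardCore 64 (by norm_num)
  obtain ⟨N, ⟨δ, _hδ, Θ, _hΘ, H⟩, hN⟩ := (hev.and (Filter.eventually_ge_atTop 63)).exists
  have hρ : (0 : ℝ) < 64 := by norm_num
  have hL := sideLength_succ_pos hρ N
  set L := sideLength 64 (N + 1) with hLdef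
  have hL3 : L ^ 3 = ((N : ℝ) + 1) / 64 := sideLength_succ_pow_three hρ N
  have hL1 : 1 ≤ L := by
    have h1 : (1 : ℝ) ≤ L ^ 3 := by
      rw [hL3, le_div_iff₀ hρ]
      have : (63 : ℝ) ≤ N := by exact_mod_cast hN
      linarith
    by_contra hlt
    push Not at hlt
    have : L ^ 3 < 1 ^ 3 := pow_lt_pow_left₀ hlt hL.le (by norm_num)
    linarith
  -- subcube count m = ⌈2L⌉
  set m : ℕ := ⌈2 * L⌉₊ with hm
  have hm2 : 2 * L ≤ m := Nat.le_ceil _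
  have hmlt : (m : ℝ) < 2 * L + 1 := Nat.ceil_lt_add_one (by positivity)
  have hm3L : (m : ℝ) ≤ 3 * L := by linarith
  have hcardR : (m : ℝ) ^ 3 < (N : ℝ) + 1 := by
    have : (m : ℝ) ^ 3 ≤ (3 * L) ^ 3 := pow_le_pow_left₀ (by positivity) hm3L 3
    nlinarith [hL3, this, hL1]
  have hcard : m ^ 3 < N + 1 := by exact_mod_cast hcardR
  have hE : ∀ Ψ : PeriodicTrialState (N + 1) L, periodicEnergy hardCore Ψ = ⊤ := fun Ψ =>
    periodicEnergy_hardCore_eq_top hL hm2 hcard Ψ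
  have hE0 : periodicGroundStateEnergy hardCore (N + 1) L = ⊤ :=
    iInf_eq_top.2 hE
  have h := H (productWave (N + 1) hL e0) (by rw [hE0]; exact le_top)
  rw [insertionOverlap_productWave_succ N hL e0_ne_zero] at h
  simp only [nnnorm_zero, ENNReal.coe_zero, ne_eq, OfNat.ofNat_ne_zero, not_false_eq_true,
    zero_pow, mul_zero, nonpos_iff_eq_zero, ENNReal.ofReal_eq_zero] at h
  linarith


/-! ## §11 Non-vacuity of the hypothesis: the FREE static response bound (K1 at `v = 0`, `C = 1`)

The body of `StaticResponseBound` for the free gas is a theorem: for every periodic `C¹` state,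
`-t ∫ (∑ⱼ cos θⱼ)|Ψ|² - t² N/|p|² ≤ ⟨Ψ, -ΔΨ⟩` (torus integration by parts + completing the square,
particle by particle and coordinate by coordinate). So the crux hypothesis is consistent with its
free instance (the planner's "second check", `C = 2` there; `C = 1` suffices). -/

section FreeResponse

variable {N : ℕ} {L : ℝ}

/-- The phase of particle `j`: `θⱼ(X) = (2π/L) k·xⱼ`. [folklore] -/
def phaseAt (L : ℝ) (k : Fin 3 → ℤ) (j : Fin N) (X : Config N) : ℝ :=
  2 * Real.pi / L * ∑ c, (k c : ℝ) * X j c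

/-- `θⱼ` as a continuous linear form on `(ℝ³)^N`. [folklore] -/
def phaseAtCLM (L : ℝ) (k : Fin 3 → ℤ) (j : Fin N) : Config N →L[ℝ] ℝ :=
  (2 * Real.pi / L) • ∑ c : Fin 3, (k c : ℝ) •
    ((EuclideanSpace.proj (𝕜 := ℝ) (ι := Fin 3) c).comp (ContinuousLinearMap.proj (R := ℝ) j))

/-- The linear form evaluates to the phase. [folklore] -/
theorem phaseAtCLM_apply (L : ℝ) (k : Fin 3 → ℤ) (j : Fin N) (X : Config N) :
    phaseAtCLM L k j X = phaseAt L k j X := by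
  simp [phaseAtCLM, phaseAt, smul_eq_mul]

/-- `Dθⱼ = θⱼ` (linear). [folklore] -/
theorem hasFDerivAt_phaseAt (L : ℝ) (k : Fin 3 → ℤ) (j : Fin N) (X : Config N) :
    HasFDerivAt (phaseAt L k j) (phaseAtCLM L k j) X := by
  have h : (phaseAt L k j : Config N → ℝ) = phaseAtCLM L k j := by
    funext Y; exact (phaseAtCLM_apply L k j Y).symm
  rw [h]
  exact (phaseAtCLM L k j).hasFDerivAt

/-- `θⱼ` is continuous. [folklore] -/
theorem continuous_phaseAt (L : ℝ) (k : Fin 3 → ℤ) (j : Fin N) : Continuous (phaseAt L k j : Config N → ℝ) := by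
  have h : (phaseAt L k j : Config N → ℝ) = phaseAtCLM L k j := by
    funext Y; exact (phaseAtCLM_apply L k j Y).symm
  rw [h]
  exact (phaseAtCLM L k j).continuous

/-- `θⱼ(e_{i,c}) = (2π/L) k_c [i = j]`. [folklore] -/
theorem phaseAtCLM_single (L : ℝ) (k : Fin 3 → ℤ) (j i : Fin N) (c : Fin 3) :
    phaseAtCLM L k j (Pi.single i (EuclideanSpace.single c 1) : Config N) =
      if i = j then 2 * Real.pi / L * k c else 0 := by
  rw [phaseAtCLM_apply, phaseAt]
  by_cases hij : i = j
  · subst hij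
    simp [Pi.single_eq_same, Finset.sum_ite_eq', mul_comm]
  · simp [hij]

/-- `θⱼ(X + L e_{i,a}) = θⱼ(X) + 2π k_a [i = j]`. [folklore] -/
theorem phaseAt_add_single (hL : L ≠ 0) (k : Fin 3 → ℤ) (j i : Fin N) (a : Fin 3) (X : Config N) :
    phaseAt L k j (X + Pi.single i (EuclideanSpace.single a L)) =
      phaseAt L k j X + (if i = j then (k a : ℤ) * (2 * Real.pi) else 0) := by
  have hlin : phaseAt L k j (X + Pi.single i (EuclideanSpace.single a L)) =
      phaseAt L k j X + phaseAtCLM L k j (Pi.single i (EuclideanSpace.single a L)) := by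
    rw [← phaseAtCLM_apply, ← phaseAtCLM_apply, map_add]
  rw [hlin]
  congr 1
  have hs : (Pi.single i (EuclideanSpace.single a L) : Config N) =
      L • (Pi.single i (EuclideanSpace.single a 1) : Config N) := by
    rw [← Pi.single_smul]
    congr 1
    ext c
    simp
  rw [hs, map_smul, phaseAtCLM_single, smul_eq_mul]
  by_cases hij : i = j
  · simp only [hij, if_true]
    field_simp
  · simp [hij]

/-- The directional derivative `∂_{j,c}Ψ`. [folklore] -/
def dpsi (Ψ : PeriodicTrialState N L) (j : Fin N) (c : Fin 3) (X : Config N) : ℂ :=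
  fderiv ℝ Ψ.ψ X (Pi.single j (EuclideanSpace.single c 1))

/-- `∂_{j,c}Ψ` is continuous. [folklore] -/
theorem continuous_dpsi (Ψ : PeriodicTrialState N L) (j : Fin N) (c : Fin 3) :
    Continuous (dpsi Ψ j c) :=
  (Ψ.contDiff.continuous_fderiv one_ne_zero).clm_apply continuous_const

/-- `∂_{j,c}|Ψ|² = 2 Re(∂_{j,c}Ψ · conj Ψ)`. [folklore] -/
theorem pderiv_norm_sq (Ψ : PeriodicTrialState N L) (j : Fin N) (c : Fin 3) (X : Config N) :
    pderiv j c (fun Y => ‖Ψ.ψ Y‖ ^ 2) X = 2 * (dpsi Ψ j c X * conj (Ψ.ψ X)).re := by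
  have hd : HasFDerivAt Ψ.ψ (fderiv ℝ Ψ.ψ X) X :=
    ((Ψ.contDiff.differentiable one_ne_zero) X).hasFDerivAt
  have h : HasFDerivAt (fun Y => ‖Ψ.ψ Y‖ ^ 2) (2 • (innerSL ℝ (Ψ.ψ X)).comp (fderiv ℝ Ψ.ψ X)) X :=
    hd.norm_sq
  unfold pderiv dpsi
  rw [h.fderiv]
  simp [Complex.inner, two_smul]
  ring

/-- `∂_{i,c} sin θⱼ = cos θⱼ · (2π/L) k_c [i = j]`. [folklore] -/
theorem pderiv_sin_phaseAt (L : ℝ) (k : Fin 3 → ℤ) (j i : Fin N) (c : Fin 3) (X : Config N) :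
    pderiv i c (fun Y => Real.sin (phaseAt L k j Y)) X =
      Real.cos (phaseAt L k j X) * (if i = j then 2 * Real.pi / L * k c else 0) := by
  have h : HasFDerivAt (fun Y : Config N => Real.sin (phaseAt L k j Y))
      (Real.cos (phaseAt L k j X) • phaseAtCLM L k j) X :=
    (Real.hasDerivAt_sin (phaseAt L k j X)).comp_hasFDerivAt X (hasFDerivAt_phaseAt L k j X)
  unfold pderiv
  rw [h.fderiv, FunLike.coe_smul, Pi.smul_apply, phaseAtCLM_single, smul_eq_mul]

/-- `sin θⱼ` is smooth. [folklore] -/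
theorem contDiff_sin_phaseAt (L : ℝ) (k : Fin 3 → ℤ) (j : Fin N) :
    ContDiff ℝ 1 fun Y : Config N => Real.sin (phaseAt L k j Y) := by
  have h : (phaseAt L k j : Config N → ℝ) = phaseAtCLM L k j := by
    funext Y; exact (phaseAtCLM_apply L k j Y).symm
  rw [h]
  exact Real.contDiff_sin.comp (phaseAtCLM L k j).contDiff

/-- **Integration by parts for the response**: `2 ∫ sin θⱼ Re(∂_{j,c}Ψ conj Ψ) = -(2π k_c/L) ∫ cos θⱼ |Ψ|²`.
[folklore] -/
theorem ibp_response (hL : 0 < L) (k : Fin 3 → ℤ) (Ψ : PeriodicTrialState N L) (j : Fin N) (c : Fin 3) :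
    ∫ X in cellN N L, Real.sin (phaseAt L k j X) * (2 * (dpsi Ψ j c X * conj (Ψ.ψ X)).re) =
      -(2 * Real.pi / L * k c) * ∫ X in cellN N L, Real.cos (phaseAt L k j X) * ‖Ψ.ψ X‖ ^ 2 := by
  set S : Config N → ℝ := fun Y => Real.sin (phaseAt L k j Y) with hS
  set G : Config N → ℝ := fun Y => ‖Ψ.ψ Y‖ ^ 2 with hG
  have hSc : ContDiff ℝ 1 S := contDiff_sin_phaseAt L k j
  have hGc : ContDiff ℝ 1 G := Ψ.contDiff.norm_sq (𝕜 := ℂ)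
  have hper : IsLatticePeriodic L (fun Y => S Y * G Y) := by
    intro Y i a
    simp only [hS, hG, Ψ.periodic Y i a, phaseAt_add_single hL.ne' k j i a Y]
    by_cases hij : i = j
    · simp only [hij, if_true, Real.sin_add_int_mul_two_pi]
    · simp [hij]
  have hIBP := integral_cellN_pderiv_eq_zero hL (hSc.mul hGc) hper j c
  have hprod : ∀ Y, pderiv j c (fun Y => S Y * G Y) Y = S Y * pderiv j c G Y + G Y * pderiv j c S Y :=
    fun Y => pderiv_fun_mul ((hSc.differentiable one_ne_zero) Y) ((hGc.differentiable one_ne_zero) Y) j c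
  simp_rw [hprod] at hIBP
  have hpG : ∀ Y, pderiv j c G Y = 2 * (dpsi Ψ j c Y * conj (Ψ.ψ Y)).re := pderiv_norm_sq Ψ j c
  have hpS : ∀ Y, pderiv j c S Y = Real.cos (phaseAt L k j Y) * (2 * Real.pi / L * k c) := by
    intro Y; rw [hS, pderiv_sin_phaseAt]; simp
  simp_rw [hpG, hpS] at hIBP
  have hcont1 : Continuous fun Y => S Y * (2 * (dpsi Ψ j c Y * conj (Ψ.ψ Y)).re) :=
    hSc.continuous.mul (continuous_const.mul (Complex.continuous_re.comp
      ((continuous_dpsi Ψ j c).mul Ψ.contDiff.continuous.star)))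
  have hcont2 : Continuous fun Y => G Y * (Real.cos (phaseAt L k j Y) * (2 * Real.pi / L * k c)) :=
    hGc.continuous.mul ((Real.continuous_cos.comp (continuous_phaseAt L k j)).mul continuous_const)
  rw [integral_add (integrableOn_cellN hcont1 L) (integrableOn_cellN hcont2 L)] at hIBP
  have h2 : ∫ X in cellN N L, G X * (Real.cos (phaseAt L k j X) * (2 * Real.pi / L * k c)) =
      (2 * Real.pi / L * k c) * ∫ X in cellN N L, Real.cos (phaseAt L k j X) * ‖Ψ.ψ X‖ ^ 2 := by
    rw [← integral_const_mul]
    congr 1; funext Y; simp only [hG]; ring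
  rw [h2] at hIBP
  linarith

/-- **Completing the square**: for every real `α`,
`0 ≤ ∫|∂_{j,c}Ψ|² - α (2πk_c/L) ∫ cos θⱼ |Ψ|² + α² ∫ sin² θⱼ |Ψ|²`
(`= ∫ |∂_{j,c}Ψ + α sin θⱼ Ψ|²` after the integration by parts `ibp_response`). [folklore] -/
theorem free_square (hL : 0 < L) (k : Fin 3 → ℤ) (Ψ : PeriodicTrialState N L) (j : Fin N)
    (c : Fin 3) (α : ℝ) :
    0 ≤ (∫ X in cellN N L, ‖dpsi Ψ j c X‖ ^ 2)
      - α * (2 * Real.pi / L * k c) * (∫ X in cellN N L, Real.cos (phaseAt L k j X) * ‖Ψ.ψ X‖ ^ 2)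
      + α ^ 2 * ∫ X in cellN N L, Real.sin (phaseAt L k j X) ^ 2 * ‖Ψ.ψ X‖ ^ 2 := by
  have hnn : 0 ≤ ∫ X in cellN N L,
      ‖dpsi Ψ j c X + ((α * Real.sin (phaseAt L k j X) : ℝ) : ℂ) * Ψ.ψ X‖ ^ 2 :=
    integral_nonneg fun X => by positivity
  have hexp : ∀ X, ‖dpsi Ψ j c X + ((α * Real.sin (phaseAt L k j X) : ℝ) : ℂ) * Ψ.ψ X‖ ^ 2 =
      ‖dpsi Ψ j c X‖ ^ 2
        + α * (Real.sin (phaseAt L k j X) * (2 * (dpsi Ψ j c X * conj (Ψ.ψ X)).re))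
        + α ^ 2 * (Real.sin (phaseAt L k j X) ^ 2 * ‖Ψ.ψ X‖ ^ 2) := by
    intro X
    rw [Complex.sq_norm, Complex.sq_norm, Complex.sq_norm, Complex.normSq_add, Complex.normSq_mul,
      Complex.normSq_ofReal, map_mul, Complex.conj_ofReal]
    have hre : (dpsi Ψ j c X * (((α * Real.sin (phaseAt L k j X) : ℝ) : ℂ) * conj (Ψ.ψ X))).re =
        α * Real.sin (phaseAt L k j X) * (dpsi Ψ j c X * conj (Ψ.ψ X)).re := by
      rw [← mul_assoc, mul_comm (dpsi Ψ j c X), mul_assoc, Complex.re_ofReal_mul]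
    rw [hre]
    ring
  simp_rw [hexp] at hnn
  have hc1 : Continuous fun X => ‖dpsi Ψ j c X‖ ^ 2 := (continuous_dpsi Ψ j c).norm.pow 2
  have hc2 : Continuous fun X =>
      α * (Real.sin (phaseAt L k j X) * (2 * (dpsi Ψ j c X * conj (Ψ.ψ X)).re)) :=
    continuous_const.mul ((Real.continuous_sin.comp (continuous_phaseAt L k j)).mul
      (continuous_const.mul (Complex.continuous_re.comp
        ((continuous_dpsi Ψ j c).mul Ψ.contDiff.continuous.star))))
  have hc3 : Continuous fun X => α ^ 2 * (Real.sin (phaseAt L k j X) ^ 2 * ‖Ψ.ψ X‖ ^ 2) :=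
    continuous_const.mul (((Real.continuous_sin.comp (continuous_phaseAt L k j)).pow 2).mul
      (Ψ.contDiff.continuous.norm.pow 2))
  have i1 : IntegrableOn (fun X => ‖dpsi Ψ j c X‖ ^ 2) (cellN N L) volume := integrableOn_cellN hc1 L
  have i2 := integrableOn_cellN hc2 L
  have i3 := integrableOn_cellN hc3 L
  have i12 : IntegrableOn (fun X => ‖dpsi Ψ j c X‖ ^ 2
      + α * (Real.sin (phaseAt L k j X) * (2 * (dpsi Ψ j c X * conj (Ψ.ψ X)).re))) (cellN N L) volume :=
    i1.add i2
  rw [integral_add i12 i3, integral_add i1 i2, integral_const_mul, integral_const_mul,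
    ibp_response hL k Ψ j c] at hnn
  have e : α * (-(2 * Real.pi / L * ↑(k c)) * ∫ X in cellN N L, Real.cos (phaseAt L k j X) * ‖Ψ.ψ X‖ ^ 2)
      = -(α * (2 * Real.pi / L * k c) * ∫ X in cellN N L, Real.cos (phaseAt L k j X) * ‖Ψ.ψ X‖ ^ 2) := by
    ring
  rw [e] at hnn
  linarith

/-- `∫_{cell} sin² θⱼ |Ψ|² ≤ 1`. [folklore] -/
theorem integral_sin_sq_mul_le_one (k : Fin 3 → ℤ) (Ψ : PeriodicTrialState N L) (j : Fin N) :
    ∫ X in cellN N L, Real.sin (phaseAt L k j X) ^ 2 * ‖Ψ.ψ X‖ ^ 2 ≤ 1 := by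
  have hnorm : ∫ X in cellN N L, ‖Ψ.ψ X‖ ^ 2 = 1 := by
    have h := Ψ.norm_eq
    simp_rw [coe_nnnorm_sq_eq_ofReal] at h
    rw [← ofReal_integral_eq_lintegral_ofReal
      (integrableOn_cellN (f := fun X : Config N => ‖Ψ.ψ X‖ ^ 2) (Ψ.contDiff.continuous.norm.pow 2) L)
      (Filter.Eventually.of_forall fun X => by positivity)] at h
    have h' := congrArg ENNReal.toReal h
    rwa [ENNReal.toReal_ofReal (integral_nonneg fun X => by positivity), ENNReal.toReal_one] at h'
  rw [← hnorm]
  refine integral_mono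
    (integrableOn_cellN (f := fun X : Config N => Real.sin (phaseAt L k j X) ^ 2 * ‖Ψ.ψ X‖ ^ 2)
      (((Real.continuous_sin.comp (continuous_phaseAt L k j)).pow 2).mul
        (Ψ.contDiff.continuous.norm.pow 2)) L)
    (integrableOn_cellN (f := fun X : Config N => ‖Ψ.ψ X‖ ^ 2) (Ψ.contDiff.continuous.norm.pow 2) L)
    fun X => ?_
  have hs : Real.sin (phaseAt L k j X) ^ 2 ≤ 1 := by
    rw [sq_le_one_iff_abs_le_one]; exact Real.abs_sin_le_one _
  have h0 : 0 ≤ ‖Ψ.ψ X‖ ^ 2 := by positivity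
  nlinarith

/-- The squared lattice momentum in K1's normalisation: `|p|² = (2π/L)² ∑ k_c² = ∑_c (2πk_c/L)²`. [folklore] -/
theorem sum_sq_eq_p2 (L : ℝ) (k : Fin 3 → ℤ) :
    ∑ c : Fin 3, (2 * Real.pi / L * k c) ^ 2 = (2 * Real.pi / L) ^ 2 * ∑ c, (k c : ℝ) ^ 2 := by
  rw [Finset.mul_sum]
  refine Finset.sum_congr rfl fun c _ => ?_
  ring

/-- `|p|² > 0` for `k ≠ 0`, `L > 0`. [folklore] -/
theorem p2_pos (hL : 0 < L) {k : Fin 3 → ℤ} (hk : k ≠ 0) :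
    0 < (2 * Real.pi / L) ^ 2 * ∑ c, (k c : ℝ) ^ 2 := by
  obtain ⟨c₀, hc₀⟩ : ∃ c, k c ≠ 0 := by
    by_contra h
    push Not at h
    exact hk (funext h)
  have hsum : 0 < ∑ c, (k c : ℝ) ^ 2 := by
    refine lt_of_lt_of_le ?_ (Finset.single_le_sum (fun c _ => sq_nonneg ((k c : ℝ))) (Finset.mem_univ c₀))
    have : (k c₀ : ℝ) ≠ 0 := Int.cast_ne_zero.mpr hc₀
    positivity
  positivity

/-- **Per particle**: `0 ≤ ∑_c ∫|∂_{j,c}Ψ|² + t ∫ cos θⱼ |Ψ|² + t²/|p|²`. [folklore] -/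
theorem free_response_particle (hL : 0 < L) {k : Fin 3 → ℤ} (hk : k ≠ 0) (t : ℝ)
    (Ψ : PeriodicTrialState N L) (j : Fin N) :
    0 ≤ (∑ c, ∫ X in cellN N L, ‖dpsi Ψ j c X‖ ^ 2)
      + t * (∫ X in cellN N L, Real.cos (phaseAt L k j X) * ‖Ψ.ψ X‖ ^ 2)
      + t ^ 2 / ((2 * Real.pi / L) ^ 2 * ∑ c, (k c : ℝ) ^ 2) := by
  set p2 : ℝ := (2 * Real.pi / L) ^ 2 * ∑ c, (k c : ℝ) ^ 2 with hp2
  have hp : 0 < p2 := p2_pos hL hk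
  set I : ℝ := ∫ X in cellN N L, Real.cos (phaseAt L k j X) * ‖Ψ.ψ X‖ ^ 2 with hI
  -- per coordinate with α_c = -t κ_c / p2
  have hc : ∀ c : Fin 3, 0 ≤ (∫ X in cellN N L, ‖dpsi Ψ j c X‖ ^ 2)
      + t * (2 * Real.pi / L * k c) ^ 2 / p2 * I + t ^ 2 * (2 * Real.pi / L * k c) ^ 2 / p2 ^ 2 := by
    intro c
    have h := free_square hL k Ψ j c (-(t * (2 * Real.pi / L * k c) / p2))
    have hs := integral_sin_sq_mul_le_one k Ψ j (L := L)
    have hsq : 0 ≤ (-(t * (2 * Real.pi / L * ↑(k c)) / p2)) ^ 2 := sq_nonneg _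
    have hmono : (-(t * (2 * Real.pi / L * ↑(k c)) / p2)) ^ 2 *
        ∫ X in cellN N L, Real.sin (phaseAt L k j X) ^ 2 * ‖Ψ.ψ X‖ ^ 2 ≤
        (-(t * (2 * Real.pi / L * ↑(k c)) / p2)) ^ 2 * 1 := mul_le_mul_of_nonneg_left hs hsq
    have e1 : (-(t * (2 * Real.pi / L * ↑(k c)) / p2)) ^ 2 * 1 =
        t ^ 2 * (2 * Real.pi / L * k c) ^ 2 / p2 ^ 2 := by ring
    have e2 : -(t * (2 * Real.pi / L * ↑(k c)) / p2) * (2 * Real.pi / L * ↑(k c)) * I =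
        -(t * (2 * Real.pi / L * k c) ^ 2 / p2 * I) := by ring
    rw [e2] at h
    linarith
  have hsum := Finset.sum_nonneg fun c (_ : c ∈ Finset.univ) => hc c
  rw [Finset.sum_add_distrib, Finset.sum_add_distrib, ← Finset.sum_mul, ← Finset.sum_div,
    ← Finset.mul_sum, ← Finset.sum_div, ← Finset.mul_sum, sum_sq_eq_p2, ← hp2] at hsum
  have e3 : t * p2 / p2 = t := by field_simp
  have e4 : t ^ 2 * p2 / p2 ^ 2 = t ^ 2 / p2 := by field_simp
  rw [e3, e4] at hsum
  exact hsum

/-- **The free kinetic energy is the sum of the squared partial derivatives** (real form), and is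
finite for every `C¹` periodic state. [folklore] -/
theorem periodicEnergy_zero_eq_ofReal (Ψ : PeriodicTrialState N L) :
    periodicEnergy 0 Ψ = ENNReal.ofReal (∑ j, ∑ c, ∫ X in cellN N L, ‖dpsi Ψ j c X‖ ^ 2) := by
  have hint0 : ∀ X : Config N, periodicInteraction 0 L X = 0 := fun X => by
    simp [periodicInteraction, periodizedPotential_zero]
  have hkin : ∀ X, kineticDensity Ψ.ψ X = ENNReal.ofReal (∑ j, ∑ c, ‖dpsi Ψ j c X‖ ^ 2) := by
    intro X
    unfold kineticDensity dpsi
    simp only [coe_nnnorm_sq_eq_ofReal]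
    rw [ENNReal.ofReal_sum_of_nonneg fun j _ => Finset.sum_nonneg fun c _ => sq_nonneg _]
    exact Finset.sum_congr rfl fun j _ => (ENNReal.ofReal_sum_of_nonneg fun c _ => sq_nonneg _).symm
  unfold periodicEnergy
  simp_rw [hint0, zero_mul, add_zero, hkin]
  have hcont : Continuous fun X => ∑ j, ∑ c, ‖dpsi Ψ j c X‖ ^ 2 :=
    continuous_finsetSum _ fun j _ => continuous_finsetSum _ fun c _ => (continuous_dpsi Ψ j c).norm.pow 2
  rw [← ofReal_integral_eq_lintegral_ofReal (integrableOn_cellN hcont L)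
    (Filter.Eventually.of_forall fun X => Finset.sum_nonneg fun j _ =>
      Finset.sum_nonneg fun c _ => sq_nonneg _)]
  congr 1
  rw [integral_finsetSum _ (f := fun (j : Fin N) (X : Config N) => ∑ c, ‖dpsi Ψ j c X‖ ^ 2)
    (fun j _ => integrableOn_cellN (f := fun X : Config N => ∑ c, ‖dpsi Ψ j c X‖ ^ 2)
      (continuous_finsetSum _ fun c _ => (continuous_dpsi Ψ j c).norm.pow 2) L)]
  refine Finset.sum_congr rfl fun j _ => ?_
  exact integral_finsetSum _ (f := fun (c : Fin 3) (X : Config N) => ‖dpsi Ψ j c X‖ ^ 2)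
    (fun c _ => integrableOn_cellN (f := fun X : Config N => ‖dpsi Ψ j c X‖ ^ 2)
      ((continuous_dpsi Ψ j c).norm.pow 2) L)

/-- **THE FREE STATIC RESPONSE BOUND** (`K1`'s body at `v = 0`, `C = 1`, every box): for every
periodic `C¹` state of `N` bosons on a torus of side `L > 0`, every `k ∈ ℤ³ ∖ 0` (`p = 2πk/L`) and
every coupling `t`,
`-t² N/|p|² ≤ ⟨Ψ, -ΔΨ⟩ + t ∫ (∑ⱼ cos(p·xⱼ)) |Ψ|²`. [folklore] -/
theorem free_static_response (hL : 0 < L) {k : Fin 3 → ℤ} (hk : k ≠ 0) (t : ℝ)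
    (Ψ : PeriodicTrialState N L) :
    -(t ^ 2 * N / ((2 * Real.pi / L) ^ 2 * ∑ i, (k i : ℝ) ^ 2)) ≤
      (periodicEnergy 0 Ψ).toReal +
        t * ∫ X in cellN N L, (∑ j, Real.cos (2 * Real.pi / L * ∑ i, (k i : ℝ) * X j i)) * ‖Ψ.ψ X‖ ^ 2 := by
  have hE : (periodicEnergy 0 Ψ).toReal = ∑ j, ∑ c, ∫ X in cellN N L, ‖dpsi Ψ j c X‖ ^ 2 := by
    rw [periodicEnergy_zero_eq_ofReal, ENNReal.toReal_ofReal]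
    exact Finset.sum_nonneg fun j _ => Finset.sum_nonneg fun c _ => integral_nonneg fun X => sq_nonneg _
  have hcos : (∫ X in cellN N L, (∑ j, Real.cos (2 * Real.pi / L * ∑ i, (k i : ℝ) * X j i)) * ‖Ψ.ψ X‖ ^ 2)
      = ∑ j, ∫ X in cellN N L, Real.cos (phaseAt L k j X) * ‖Ψ.ψ X‖ ^ 2 := by
    simp_rw [Finset.sum_mul]
    rw [integral_finsetSum _
      (f := fun (j : Fin N) (X : Config N) =>
        Real.cos (2 * Real.pi / L * ∑ i, (k i : ℝ) * X j i) * ‖Ψ.ψ X‖ ^ 2)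
      (fun j _ => integrableOn_cellN
        (f := fun X : Config N => Real.cos (2 * Real.pi / L * ∑ i, (k i : ℝ) * X j i) * ‖Ψ.ψ X‖ ^ 2)
        ((Real.continuous_cos.comp (continuous_phaseAt L k j)).mul (Ψ.contDiff.continuous.norm.pow 2)) L)]
    rfl
  rw [hE, hcos]
  have hsum := Finset.sum_nonneg fun j (_ : j ∈ Finset.univ) => free_response_particle hL hk t Ψ j
  simp only [Finset.sum_add_distrib, Finset.sum_const, Finset.card_univ, Fintype.card_fin,
    nsmul_eq_mul, ← Finset.mul_sum] at hsum
  have e : (N : ℝ) * (t ^ 2 / ((2 * Real.pi / L) ^ 2 * ∑ c, (k c : ℝ) ^ 2)) =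
      t ^ 2 * N / ((2 * Real.pi / L) ^ 2 * ∑ i, (k i : ℝ) ^ 2) := by ring
  rw [e] at hsum
  linarith

/-- `K1` specialised to one potential (the body of `StaticResponseBound`). -/
def SRBAt (v : ℝ → ℝ≥0∞) : Prop :=
  ∃ ρ₀ : ℝ, 0 < ρ₀ ∧ ∃ C : ℝ, 0 < C ∧ ∀ ρ : ℝ, 0 < ρ → ρ < ρ₀ → ∀ N : ℕ, ∀ k : Fin 3 → ℤ, k ≠ 0 →
    ∀ t : ℝ, ∀ Ψ : PeriodicTrialState N (sideLength ρ N), periodicEnergy v Ψ ≠ ⊤ →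
      (periodicGroundStateEnergy v N (sideLength ρ N)).toReal -
          C * t ^ 2 * N / max (ρ * (scatteringLength v).toReal)
            ((2 * Real.pi / sideLength ρ N) ^ 2 * ∑ i, (k i : ℝ) ^ 2) ≤
        (periodicEnergy v Ψ).toReal + t * ∫ X in cellN N (sideLength ρ N),
          (∑ j, Real.cos (2 * Real.pi / sideLength ρ N * ∑ i, (k i : ℝ) * X j i)) * ‖Ψ.ψ X‖ ^ 2

/-- `StaticResponseBound` is `∀ v` admissible, `SRBAt v` (definitionally). [folklore] -/
theorem staticResponseBound_iff : StaticResponseBound ↔ ∀ v, IsRepulsiveFiniteRange v → SRBAt v :=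
  Iff.rfl

/-- The free periodic ground-state energy vanishes (the constant state). [folklore] -/
theorem periodicGroundStateEnergy_zero (N : ℕ) (hL : 0 < L) :
    periodicGroundStateEnergy 0 N L = 0 := by
  refine le_antisymm ((periodicGroundStateEnergy_le 0 (productWave N hL 0)).trans (le_of_eq ?_)) bot_le
  have hfun : (productWave N hL 0).ψ = fun _ => (normConst N L : ℂ) := funext (productWave_zero_ψ N hL)
  unfold periodicEnergy
  rw [hfun]
  have hint0 : ∀ X : Config N, periodicInteraction 0 L X = 0 := fun X => by
    simp [periodicInteraction, periodizedPotential_zero]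
  simp [kineticDensity_const, hint0]

/-- **Non-vacuity of the crux hypothesis at `v = 0`: `SRBAt 0` holds with `ρ₀ = 1`, `C = 1`.**
(`scatteringLength 0 = 0`, `E₀^{per} = 0`, and `free_static_response`; `N = 0` is the trivial
`E₀ ≤ E`.) [folklore] -/
theorem srbAt_zero : SRBAt 0 := by
  refine ⟨1, one_pos, 1, one_pos, fun ρ hρ _ N k hk t Ψ hE => ?_⟩
  cases N with
  | zero =>
    simp only [Nat.cast_zero, mul_zero, zero_div, sub_zero, Finset.univ_eq_empty,
      Finset.sum_empty, zero_mul, integral_zero, add_zero]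
    exact ENNReal.toReal_mono hE (periodicGroundStateEnergy_le 0 Ψ)
  | succ n =>
    have hL : 0 < sideLength ρ (n + 1) := sideLength_succ_pos hρ n
    rw [scatteringLength_zero, ENNReal.toReal_zero, mul_zero,
      max_eq_right (le_of_lt (p2_pos hL hk)), periodicGroundStateEnergy_zero (n + 1) hL,
      ENNReal.toReal_zero, zero_sub, one_mul]
    have h := free_static_response hL hk t Ψ
    push_cast at h ⊢
    linarith

end FreeResponse

/-! ## §12a The free-gas witness pair (verbatim the landed `Negative/TaggedNearMinimisersNotParallel.lean`,
p72198, re-proved here over this file's own §6/§8 copies so that the work file needs no new import) -/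

section WitnessPair

variable {M : ℕ} {L : ℝ}

/-! ### Exact free energy of the one-excitation state -/

/-- **Exact free energy** of `(a + b N_k 1)/‖·‖`: `⟨Ψ,-ΔΨ⟩ = M|b|²|k|²/(|a|² + M|b|²)`. [folklore] -/
theorem periodicEnergy_zero_affineState_eq (hL : 0 < L) (hM : 0 < M) {n : Fin 3 → ℤ} (hn : n ≠ 0)
    {a b : ℂ} (hab : a ≠ 0 ∨ b ≠ 0) :
    periodicEnergy 0 (affineState hL hM hn hab) =
      ENNReal.ofReal (M * ‖b‖ ^ 2 * momSq L n / (‖a‖ ^ 2 + M * ‖b‖ ^ 2)) := by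
  unfold affineState
  rw [periodicEnergy_zero_ofFun]
  simp_rw [kineticDensity_affine]
  rw [setLIntegral_const, volume_cellN, lintegral_cellN_nnnorm_sq_affine hL hn]
  have hV : ((ENNReal.ofReal L) ^ 3) ^ M = ENNReal.ofReal ((L ^ 3) ^ M) := by
    rw [← ENNReal.ofReal_pow hL.le, ← ENNReal.ofReal_pow (by positivity)]
  rw [hV]
  have hM' : (0 : ℝ) < M := by exact_mod_cast hM
  have hS : 0 < ‖a‖ ^ 2 + M * ‖b‖ ^ 2 := by
    rcases hab with ha | hb
    · have : 0 < ‖a‖ := norm_pos_iff.2 ha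
      positivity
    · have : 0 < ‖b‖ := norm_pos_iff.2 hb
      positivity
  have hVpos : 0 < (L ^ 3) ^ M := by positivity
  have hp := momSq_nonneg L n
  have hX : 0 ≤ (M : ℝ) * (‖b‖ ^ 2 * momSq L n) := by positivity
  have hSV : 0 < (‖a‖ ^ 2 + M * ‖b‖ ^ 2) * (L ^ 3) ^ M := mul_pos hS hVpos
  rw [← ENNReal.ofReal_mul hX, ← ENNReal.ofReal_inv_of_pos hSV,
    ← ENNReal.ofReal_mul (inv_nonneg.2 hSV.le)]
  congr 1
  field_simp

/-! ### The constant and the tilted constant -/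

/-! Below, the "constant state" is the affine one-excitation state with `a = 1`, `b = 0`
(`affineState … (a := 1) (b := 0) …`, the normalised constant `L^{-3M/2}`) and the "tilted
constant" is the one with `a = 1`, `b = ε ∈ ℝ` (`(1 + ε N_{e₀} 1)/‖·‖`); both are written out in
full (no auxiliary definitions). -/

/-- The constant state has zero free energy. [folklore] -/
theorem periodicEnergy_zero_constState (hL : 0 < L) (hM : 0 < M) :
    periodicEnergy 0 (affineState (n := e0) (a := (1 : ℂ)) (b := (0 : ℂ)) hL hM e0_ne_zero (Or.inl one_ne_zero)) = 0 :=
  periodicEnergy_zero_affineState_const hL hM e0_ne_zero _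

/-- The tilted constant has free energy `Mε²|k|²/(1+Mε²) ≤ M ε² |k|²`. [folklore] -/
theorem periodicEnergy_zero_tiltState_le (hL : 0 < L) (hM : 0 < M) (ε : ℝ) :
    periodicEnergy 0 (affineState (n := e0) (a := (1 : ℂ)) (b := ((ε : ℝ) : ℂ)) hL hM e0_ne_zero (Or.inl one_ne_zero)) ≤ ENNReal.ofReal (M * ε ^ 2 * momSq L e0) := by
  rw [periodicEnergy_zero_affineState_eq hL hM e0_ne_zero]
  refine ENNReal.ofReal_le_ofReal ?_
  have hε : ‖(ε : ℂ)‖ ^ 2 = ε ^ 2 := by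
    rw [Complex.norm_real, Real.norm_eq_abs, sq_abs]
  rw [hε, norm_one, one_pow]
  have hp := momSq_nonneg L e0
  have hnum : 0 ≤ (M : ℝ) * ε ^ 2 * momSq L e0 := by positivity
  have hden : 1 ≤ 1 + (M : ℝ) * ε ^ 2 := by
    have : 0 ≤ (M : ℝ) * ε ^ 2 := by positivity
    linarith
  exact div_le_self hnum hden

/-- Pointwise form of the constant state: `L^{-3M/2}`. [folklore] -/
theorem constState_ψ (hL : 0 < L) (hM : 0 < M) (X : Config M) :
    (affineState (n := e0) (a := (1 : ℂ)) (b := (0 : ℂ)) hL hM e0_ne_zero (Or.inl one_ne_zero)).ψ X = ((Real.sqrt ((L ^ 3) ^ M) : ℝ) : ℂ)⁻¹ := by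
  unfold affineState
  rw [PeriodicTrialState.ofFun_apply, lintegral_cellN_nnnorm_sq_affine hL e0_ne_zero,
    ENNReal.toReal_ofReal (by positivity)]
  simp

/-- Pointwise form of the tilted constant. [folklore] -/
theorem tiltState_ψ (hL : 0 < L) (hM : 0 < M) (ε : ℝ) (X : Config M) :
    (affineState (n := e0) (a := (1 : ℂ)) (b := ((ε : ℝ) : ℂ)) hL hM e0_ne_zero (Or.inl one_ne_zero)).ψ X =
      ((Real.sqrt ((1 + M * ε ^ 2) * (L ^ 3) ^ M) : ℝ) : ℂ)⁻¹ *
        (1 + (ε : ℂ) * planeWaveSum L e0 X) := by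
  unfold affineState
  rw [PeriodicTrialState.ofFun_apply, lintegral_cellN_nnnorm_sq_affine hL e0_ne_zero,
    ENNReal.toReal_ofReal (by positivity)]
  have hε : ‖(ε : ℂ)‖ ^ 2 = ε ^ 2 := by
    rw [Complex.norm_real, Real.norm_eq_abs, sq_abs]
  rw [hε, norm_one, one_pow]

/-- **The inner product of the two states**: `⟨1/‖1‖, (1 + εN_k1)/‖·‖⟩ = (1 + Mε²)^{-1/2}`.
[folklore] -/
theorem integral_conj_constState_mul_tiltState (hL : 0 < L) (hM : 0 < M) (ε : ℝ) :
    ∫ X in cellN M L, conj ((affineState (n := e0) (a := (1 : ℂ)) (b := (0 : ℂ)) hL hM e0_ne_zero (Or.inl one_ne_zero)).ψ X) * (affineState (n := e0) (a := (1 : ℂ)) (b := ((ε : ℝ) : ℂ)) hL hM e0_ne_zero (Or.inl one_ne_zero)).ψ X =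
      ((Real.sqrt (1 + M * ε ^ 2) : ℝ) : ℂ)⁻¹ := by
  simp_rw [constState_ψ, tiltState_ψ]
  have hVpos : 0 < (L ^ 3) ^ M := by positivity
  have hTpos : 0 < 1 + (M : ℝ) * ε ^ 2 := by positivity
  have hS : Continuous (planeWaveSum (M := M) L e0) := (contDiff_planeWaveSum L e0).continuous
  have hconj : conj (((Real.sqrt ((L ^ 3) ^ M) : ℝ) : ℂ)⁻¹) =
      ((Real.sqrt ((L ^ 3) ^ M) : ℝ) : ℂ)⁻¹ := by
    rw [map_inv₀, Complex.conj_ofReal]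
  simp_rw [hconj]
  obtain ⟨A, hA⟩ : ∃ A : ℂ, ((Real.sqrt ((L ^ 3) ^ M) : ℝ) : ℂ)⁻¹ = A := ⟨_, rfl⟩
  obtain ⟨B, hB⟩ : ∃ B : ℂ, ((Real.sqrt ((1 + M * ε ^ 2) * (L ^ 3) ^ M) : ℝ) : ℂ)⁻¹ = B := ⟨_, rfl⟩
  simp_rw [hA, hB]
  have hexp : ∀ X : Config M,
      A * (B * (1 + (ε : ℂ) * planeWaveSum L e0 X)) = A * B + (A * B * ε) * planeWaveSum L e0 X := by
    intro X
    ring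
  simp_rw [hexp]
  have i1 : IntegrableOn (fun _ : Config M => A * B) (cellN M L) volume :=
    integrableOn_cellN continuous_const L
  have i2 : IntegrableOn (fun X : Config M => (A * B * ε) * planeWaveSum L e0 X) (cellN M L) volume :=
    integrableOn_cellN (continuous_const.mul hS) L
  rw [integral_add i1 i2, setIntegral_cellN_const hL.le, integral_const_mul,
    setIntegral_cellN_planeWaveSum hL e0_ne_zero, mul_zero, add_zero, ← hA, ← hB]
  have hreal : (L ^ 3) ^ M * ((Real.sqrt ((L ^ 3) ^ M))⁻¹ *
      (Real.sqrt ((1 + M * ε ^ 2) * (L ^ 3) ^ M))⁻¹) = (Real.sqrt (1 + M * ε ^ 2))⁻¹ := by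
    rw [Real.sqrt_mul hTpos.le]
    have hsV : 0 < Real.sqrt ((L ^ 3) ^ M) := Real.sqrt_pos.2 hVpos
    have hsT : 0 < Real.sqrt (1 + M * ε ^ 2) := Real.sqrt_pos.2 hTpos
    field_simp
    nlinarith [Real.mul_self_sqrt hVpos.le, Real.sq_sqrt hVpos.le]
  exact_mod_cast hreal

/-- Hence `|⟨Ψ, Ψ'⟩| = (1 + Mε²)^{-1/2}`. [folklore] -/
theorem norm_integral_conj_constState_mul_tiltState (hL : 0 < L) (hM : 0 < M) (ε : ℝ) :
    ‖∫ X in cellN M L, conj ((affineState (n := e0) (a := (1 : ℂ)) (b := (0 : ℂ)) hL hM e0_ne_zero (Or.inl one_ne_zero)).ψ X) * (affineState (n := e0) (a := (1 : ℂ)) (b := ((ε : ℝ) : ℂ)) hL hM e0_ne_zero (Or.inl one_ne_zero)).ψ X‖ =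
      (Real.sqrt (1 + M * ε ^ 2))⁻¹ := by
  rw [integral_conj_constState_mul_tiltState hL hM ε, norm_inv, Complex.norm_real,
    Real.norm_of_nonneg (Real.sqrt_nonneg _)]

/-- And `|⟨Ψ, Ψ'⟩| < 1` as soon as `ε ≠ 0` (and `M ≥ 1`): the two rays are distinct. [folklore] -/
theorem norm_integral_conj_constState_mul_tiltState_lt_one (hL : 0 < L) (hM : 0 < M) {ε : ℝ}
    (hε : ε ≠ 0) :
    ‖∫ X in cellN M L, conj ((affineState (n := e0) (a := (1 : ℂ)) (b := (0 : ℂ)) hL hM e0_ne_zero (Or.inl one_ne_zero)).ψ X) * (affineState (n := e0) (a := (1 : ℂ)) (b := ((ε : ℝ) : ℂ)) hL hM e0_ne_zero (Or.inl one_ne_zero)).ψ X‖ < 1 := by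
  rw [norm_integral_conj_constState_mul_tiltState hL hM ε]
  have hM' : (0 : ℝ) < M := by exact_mod_cast hM
  have hε2 : 0 < ε ^ 2 := by positivity
  have h1 : 1 < Real.sqrt (1 + M * ε ^ 2) := by
    rw [Real.lt_sqrt zero_le_one]
    nlinarith [mul_pos hM' hε2]
  exact inv_lt_one_of_one_lt₀ h1

/-! ### The tagged pair: near-minimisers at one coupling are not one ray -/

/-- **Two low-energy tagged states with distinct rays (free gas).** For `v = 0`, every `N`, every
`L > 0` and every window `δ > 0` there are tagged periodic trial states `Ψ, Ψ'` (one impurity + `N`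
bath bosons, equal masses) with tagged energies `⟨Ψ,H Ψ⟩ = 0` and `⟨Ψ',HΨ'⟩ ≤ δ` — so both are
`δ`-near-minimisers of the free tagged Hamiltonian, whose ground-state energy is `0` — and
`|⟨Ψ, Ψ'⟩| < 1`. Used against the zero speed majorant in `LocalSpeedBound` of line
`llp-fidelity-arc` (§12 below). [folklore] -/
theorem exists_lowEnergy_tagged_pair_norm_inner_lt_one (N : ℕ) (hL : 0 < L) {δ : ℝ≥0∞}
    (hδ : 0 < δ) :
    ∃ Ψ Ψ' : TaggedPeriodicTrialState N L,
      taggedPeriodicEnergy 0 1 Ψ = 0 ∧ taggedPeriodicEnergy 0 1 Ψ' ≤ δ ∧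
      ‖∫ X in cellN (N + 1) L, conj (Ψ.ψ X) * Ψ'.ψ X‖ < 1 := by
  have hM : 0 < N + 1 := Nat.succ_pos N
  by_cases hδtop : δ = ⊤
  · refine ⟨(affineState (n := e0) (a := (1 : ℂ)) (b := (0 : ℂ)) hL hM e0_ne_zero (Or.inl one_ne_zero)).toTagged, (affineState (n := e0) (a := (1 : ℂ)) (b := ((1 : ℝ) : ℂ)) hL hM e0_ne_zero (Or.inl one_ne_zero)).toTagged, ?_, ?_, ?_⟩
    · rw [taggedPeriodicEnergy_one_toTagged, periodicEnergy_zero_constState]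
    · rw [hδtop]; exact le_top
    · simp only [PeriodicTrialState.toTagged_ψ]
      exact norm_integral_conj_constState_mul_tiltState_lt_one hL hM one_ne_zero
  · have hδpos : 0 < δ.toReal := ENNReal.toReal_pos hδ.ne' hδtop
    have hp : 0 < momSq L e0 := by
      rw [momSq_e0]
      positivity
    set D : ℝ := ((N + 1 : ℕ) : ℝ) * momSq L e0 + 1 with hD
    have hDpos : 0 < D := by positivity
    set ε : ℝ := Real.sqrt (δ.toReal / D) with hεdef
    have hε : 0 < ε := Real.sqrt_pos.2 (div_pos hδpos hDpos)
    have hε2 : ε ^ 2 = δ.toReal / D := Real.sq_sqrt (div_pos hδpos hDpos).le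
    refine ⟨(affineState (n := e0) (a := (1 : ℂ)) (b := (0 : ℂ)) hL hM e0_ne_zero (Or.inl one_ne_zero)).toTagged, (affineState (n := e0) (a := (1 : ℂ)) (b := ((ε : ℝ) : ℂ)) hL hM e0_ne_zero (Or.inl one_ne_zero)).toTagged, ?_, ?_, ?_⟩
    · rw [taggedPeriodicEnergy_one_toTagged, periodicEnergy_zero_constState]
    · rw [taggedPeriodicEnergy_one_toTagged]
      refine (periodicEnergy_zero_tiltState_le hL hM ε).trans ?_
      have key : ((N + 1 : ℕ) : ℝ) * ε ^ 2 * momSq L e0 ≤ δ.toReal := by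
        rw [hε2]
        have h1 : ((N + 1 : ℕ) : ℝ) * momSq L e0 ≤ D := by rw [hD]; linarith
        have h2 : 0 ≤ ((N + 1 : ℕ) : ℝ) * momSq L e0 := by positivity
        calc ((N + 1 : ℕ) : ℝ) * (δ.toReal / D) * momSq L e0
            = (((N + 1 : ℕ) : ℝ) * momSq L e0) / D * δ.toReal := by
              field_simp
          _ ≤ 1 * δ.toReal := by
              gcongr
              rw [div_le_one hDpos]
              exact h1
          _ = δ.toReal := one_mul _
      calc ENNReal.ofReal (((N + 1 : ℕ) : ℝ) * ε ^ 2 * momSq L e0)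
          ≤ ENNReal.ofReal δ.toReal := ENNReal.ofReal_le_ofReal key
        _ = δ := ENNReal.ofReal_toReal hδtop
    · simp only [PeriodicTrialState.toTagged_ψ]
      exact norm_integral_conj_constState_mul_tiltState_lt_one hL hM hε.ne'


/-- **The witness pair saturates spectral-gap rigidity (tightness).** For the free `M`-body torus
problem the gap above the constant ground state is `|k|² = (2π/L)²` and Parseval gives
`⟨Ψ,-ΔΨ⟩ ≥ |k|² (1 − |⟨Ψ₀, Ψ⟩|²)`; the tilted constant attains EQUALITY:
`⟨Ψ_ε,-ΔΨ_ε⟩ = |k|² (1 − |⟨Ψ₀,Ψ_ε⟩|²)` (`= M ε²|k|²/(1+Mε²)`). So the rigidity constant a prover of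
`LocalSpeedBound` needs ("`δ`-near-minimiser ⇒ within angle `arcsin √(δ/gap)` of the ground ray")
cannot be improved: at a node `λ` with budget `b = ∫_{[λ,λ']} s` the admissible window is
`δ ≲ gap_N · sin² b`, and `gap_N → 0` along `N` (free `4π²/L² ∼ N^{-2/3}`, interacting phonon
`c_s·2π/L ∼ N^{-1/3}`) — consistent with `δ` being chosen after `N` and `λ'` in the line, and with §7.
[folklore] -/
theorem tilt_saturates_gap_rigidity (hL : 0 < L) (hM : 0 < M) (ε : ℝ) :
    periodicEnergy 0
        (affineState (n := e0) (a := (1 : ℂ)) (b := ((ε : ℝ) : ℂ)) hL hM e0_ne_zero (Or.inl one_ne_zero)) =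
      ENNReal.ofReal (momSq L e0 * (1 -
        ‖∫ X in cellN M L,
            conj ((affineState (n := e0) (a := (1 : ℂ)) (b := (0 : ℂ)) hL hM e0_ne_zero
              (Or.inl one_ne_zero)).ψ X) *
              (affineState (n := e0) (a := (1 : ℂ)) (b := ((ε : ℝ) : ℂ)) hL hM e0_ne_zero
                (Or.inl one_ne_zero)).ψ X‖ ^ 2)) := by
  rw [periodicEnergy_zero_affineState_eq hL hM e0_ne_zero,
    norm_integral_conj_constState_mul_tiltState hL hM ε]
  congr 1
  have hε : ‖(ε : ℂ)‖ ^ 2 = ε ^ 2 := by rw [Complex.norm_real, Real.norm_eq_abs, sq_abs]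
  have hT : 0 < 1 + (M : ℝ) * ε ^ 2 := by positivity
  rw [hε, norm_one, one_pow, inv_pow, Real.sq_sqrt hT.le]
  field_simp
  ring

end WitnessPair

/-! ## §12 Targets: the PICKED line `llp-fidelity-arc` (lead pick 2026-08-16, `PICKED.md`)

Cheap attacks on the four registered stubs of `Lines/llp-fidelity-arc.lean` (paper unless marked
Lean). Verdict: **no stub is false as typed**; one typing TRAP is made a theorem below.

* `stub_endpoints` (`EndpointIdentification`, L) — (a) `E₀^per(N+1,L) ≤ E_{κ=1}(N,L)` (bosonic =
  absolute infimum over bath-symmetric states) is TRUE for every `v ≥ 0` (also `⊤`-valued) WITHOUT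
  Perron–Frobenius: for a tagged `f` put `ρ̄ = (N+1)⁻¹ ∑_{j} |f ∘ (0 j)|²` (transpositions), then
  `g_ε = √(ε² + ρ̄) − ε` is `C¹`, periodic, Bose-symmetric, `g_ε² ≤ ρ̄`, and POINTWISE
  `|∇ρ̄|² ≤ 4 ρ̄ · avg_j |∇(f∘(0 j))|²` (Cauchy–Schwarz) gives `|∇g_ε|² ≤ avg_j |∇ (f∘(0j))|²`, so
  `E(g_ε/‖g_ε‖) ≤ E(f)/‖g_ε‖² → E(f)` (monotone convergence `‖g_ε‖ → 1`); no a.e.-differentiability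
  of `|f|` is needed. (b) slice floor TRUE including the junk branch `E₀^per(N,L) = ⊤` (then every
  non-zero slice has energy `⊤` on a set of positive measure). (c) product energy TRUE
  (`taggedPeriodicEnergy_product` pattern, needs `Measurable v` — supplied by
  `IsRepulsiveFiniteRange`). (d) overlap identity TRUE (Fubini for a continuous bounded integrand on
  the bounded cell; no Bochner junk).
* `stub_arcChord` (`ArcChord`, M) — TRUE: `d = arccos |⟨·,·⟩|` is the Fubini–Study metric on rays
  (triangle inequality = the only real Lean work), Lebesgue-number chaining on `[0,1]`, ONE common
  `δ` as a finite minimum, intermediate near-minimisers exist by the hypothesis `E_λ ≠ ⊤`.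
* `stub_undressedSpeed` (`UndressedSpeed`, L) — plausible; hidden inputs at FIXED `(N,L)`:
  uniqueness + gap of the decoupled ground state `φ₀ ⊗ Θ₀` (bath Perron–Frobenius on the torus; true
  at low density for every admissible `v`, including hard shells whose configuration space
  disconnects — the all-free component wins by an `O(1)` confinement margin `≳ R₁⁻²` ≫ `ρa`), and
  `χ_F(0) ≤ (Cρ/4)∫ d³k/(2π)³ |1̂_S(k)|²/(k² max(ρa,k²)) = O_v(C √(ρ/a) |S|²)`, `S = supp v`;
  the `η` of `LocalSpeedBound` may depend on `N` (it is inside `∀ᶠ N`), which absorbs the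
  `O_N(λ'²)` curvature of the fixed-`N` analytic path.
* `stub_dressedPathBound` (`DressedPathBound`, XL heart) — consistent with Bogoliubov: with stubs
  1, 4 it gives `Z_N ≥ cos² θ` for EVERY `θ > 0` at `ρ < ρ₀(θ)`, i.e. `liminf_N Z_N → 1` as `ρ → 0`
  (Bogoliubov `Z = (n₀+1)/(N+1)·Z̃ = 1 − O(√(ρa³))` ✓). Hidden input: uniqueness of the ground RAY of
  `H_λ` on the tagged space at EVERY `λ ∈ [0,1]` (PF; the absolute ground state is bath-symmetric).
  One-loop size of the arc (undressed Born level): speed `≈ h′(λ) F(S_{h(λ)})`,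
  `F(S)² = (Cρ/4)∫|1̂_S|²/(k² max(ρa,k²))`, so by the layer-cake formula
  `arc ≈ const · (ρ/a)^{1/4} ∫₀^{v_max} |{v > h}| dh = const · (ρ/a)^{1/4} ‖v‖₁ → 0` as `ρ → 0`
  (finite for every admissible bounded `v`; the BORN coefficient `‖v‖₁ ≥ 8πa` replaces `a` until
  dressing screens it). For HARD CORES `‖v‖₁ = ∞`: the Born-level arc is INFINITE (`|{v > h}| = |B_R|`
  for all `h`), so the undressed mechanism of `stub_undressedSpeed` cannot simply be re-run at the
  nodes `λ > 0` — the DRESSED matrix element `⟨1_core(xⱼ−x₀)⟩_{Ψ_h} ∼ R² h^{-3/2}` (penetration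
  depth `h^{-1/2}`, boundary value `∼ h^{-1/2}`) against excitation energies `∼ h` is what makes the
  speed `∼ √ρ R h^{-7/4} h′(λ)`, i.e. `∼ (1−λ)^{-1/4}` near `λ = 1`, integrable: dressing is the
  whole content of the heart, already at one loop. Two-phonon pieces of `ρ_k` at `λ > 0` (vertex `u_{p+k} v_p`, both
  `∼ (ρa)^{1/4} p^{-1/2}` in the phonon region) contribute `Σ_k |∂û(k)|² · O((ρa)/(c²k))`-type
  terms, IR-finite in `d = 3` (`∫ k² dk / k`) and smaller than the one-phonon term by `√(ρa³)`:
  **no `log L` at two-phonon order** — the card's cheapest falsifier passes at the Bogoliubov level;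
  the XL difficulty is rigorous control (dressed recoil), not a hidden divergence. Hard cores: speed
  `∼ (1−λ)^{-1/2}` near `λ = 1` (penetration depth `h^{-1/2}`, `h = λ/(1−λ)`), integrable ✓.
* TRAP (theorem `Llp.not_localSpeedBound_zero_majorant` below, over VERBATIM COPIES of the line's
  definitions, fed by the landed free-gas pair
  `Negative.exists_lowEnergy_tagged_pair_norm_inner_lt_one`): `LocalSpeedBound v N L s λ` is NOT
  "metric speed ≤ s near λ"; it also forces `∫_{[λ,λ']} s > 0` for every admissible `λ' ≠ λ`, because
  `δ`-near-minimisers at one coupling never form a single ray (`δ > 0`). Already for `v = 0` — where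
  `H_λ` does not depend on `λ` and the true speed is `0` — the zero majorant fails at every node.
  Hence in `DressedPathBound` the majorant must have positive mass on every subinterval (a floor
  `s ≥ ε` costs `ε` of the budget `θ`, harmless), and on the saturated segment
  `λ ≥ v_max/(1+v_max)` of a bounded potential's ceiling path (`u_λ = v`, motionless) one may NOT
  take `s = 0`; `ArcChord`'s hypotheses are only ever instantiated with such `s`.
-/

namespace Llp

/-! ### Verbatim copies (2026-08-16) of the definitions of `Lines/llp-fidelity-arc.lean`
(namespace `…Cruxes.CorrectorClosure.LlpFidelityArc`; a `Lines/` file is not an importable module) -/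

variable {N : ℕ} {L : ℝ}

/-- Copy: the coupling ceiling `h(λ) = λ/(1-λ)`. [folklore] -/
def couplingHeight (lam : ℝ) : ℝ≥0∞ :=
  ENNReal.ofReal lam / ENNReal.ofReal (1 - lam)

/-- Copy: the clipped impurity–bath profile `u_λ = min(v, h(λ))`. [folklore] -/
def couplingProfile (v : ℝ → ℝ≥0∞) (lam : ℝ) (r : ℝ) : ℝ≥0∞ :=
  min (v r) (couplingHeight lam)

/-- Copy: the coupled tagged energy at coupling `λ`. [folklore] -/
def coupledEnergy (v : ℝ → ℝ≥0∞) (lam : ℝ) (Ψ : TaggedPeriodicTrialState N L) : ℝ≥0∞ :=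
  ∫⁻ X in cellN (N + 1) L, taggedKineticDensity 1 Ψ.ψ X +
    (impurityInteraction (couplingProfile v lam) L (X 0) (Matrix.vecTail X) +
      periodicInteraction v L (Matrix.vecTail X)) * (‖Ψ.ψ X‖₊ : ℝ≥0∞) ^ 2

/-- Copy: the coupled ground-state energy. [folklore] -/
def coupledGroundStateEnergy (v : ℝ → ℝ≥0∞) (lam : ℝ) (N : ℕ) (L : ℝ) : ℝ≥0∞ :=
  ⨅ Ψ : TaggedPeriodicTrialState N L, coupledEnergy v lam Ψ

/-- Copy: `δ`-near-minimiser at coupling `λ`. [folklore] -/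
structure IsNearMinimiser (v : ℝ → ℝ≥0∞) (lam : ℝ) (δ : ℝ≥0∞) (Ψ : TaggedPeriodicTrialState N L) :
    Prop where
  /-- `⟨Ψ, H_λ Ψ⟩ ≤ E_λ(N, L) + δ`. -/
  le : coupledEnergy v lam Ψ ≤ coupledGroundStateEnergy v lam N L + δ

/-- Copy: the cell inner product. [folklore] -/
def cellInner (Ψ Φ : TaggedPeriodicTrialState N L) : ℂ :=
  ∫ X in cellN (N + 1) L, conj (Ψ.ψ X) * Φ.ψ X

/-- Copy: the Fubini–Study angle `arccos |⟨Ψ, Φ⟩|`. [folklore] -/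
def fsAngle (Ψ Φ : TaggedPeriodicTrialState N L) : ℝ :=
  Real.arccos ‖cellInner Ψ Φ‖

/-- Copy: the derivative-free local speed bound at the node `λ`. [folklore] -/
structure LocalSpeedBound (v : ℝ → ℝ≥0∞) (N : ℕ) (L : ℝ) (s : ℝ → ℝ) (lam : ℝ) : Prop where
  /-- `∃ η > 0, ∀ λ' ∈ [0,1], λ' ≠ λ, |λ' - λ| < η → ∃ δ > 0, ∀` near-minimisers, `d ≤ ∫_{[λ,λ']} s`. -/
  bound : ∃ η : ℝ, 0 < η ∧ ∀ lam' ∈ Set.Icc (0 : ℝ) 1, lam' ≠ lam → |lam' - lam| < η →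
    ∃ δ : ℝ≥0∞, 0 < δ ∧ ∀ Ψ Ψ' : TaggedPeriodicTrialState N L,
      IsNearMinimiser v lam δ Ψ → IsNearMinimiser v lam' δ Ψ' →
        fsAngle Ψ Ψ' ≤ ∫ t in Set.uIcc lam lam', s t

/-! ### The free coupled family and the zero majorant -/

/-- For `v = 0` the clipped profile vanishes at every coupling: the path `H_λ` is constant. [folklore] -/
theorem couplingProfile_zero_pot (lam : ℝ) : couplingProfile 0 lam = 0 := by
  funext r
  exact min_eq_left zero_le

/-- For `v = 0` the coupled energy is the free tagged energy, at every coupling. [folklore] -/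
theorem coupledEnergy_zero_pot (lam : ℝ) (Ψ : TaggedPeriodicTrialState N L) :
    coupledEnergy 0 lam Ψ = taggedPeriodicEnergy 0 1 Ψ := by
  rw [coupledEnergy, couplingProfile_zero_pot]
  rfl

/-- For `v = 0` and `L > 0` the coupled ground-state energy is `0` at every coupling. [folklore] -/
theorem coupledGroundStateEnergy_zero_pot (lam : ℝ) (N : ℕ) (hL : 0 < L) :
    coupledGroundStateEnergy 0 lam N L = 0 := by
  refine le_antisymm ?_ zero_le
  obtain ⟨Ψ, -, h0, -, -⟩ :=
    exists_lowEnergy_tagged_pair_norm_inner_lt_one N hL zero_lt_one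
  calc coupledGroundStateEnergy 0 lam N L ≤ coupledEnergy 0 lam Ψ := iInf_le _ Ψ
    _ = 0 := by rw [coupledEnergy_zero_pot, h0]

/-- There is always an admissible second node: `λ' ∈ [0,1]`, `λ' ≠ λ`, `|λ' - λ| < η`. [folklore] -/
theorem exists_second_node {lam η : ℝ} (hlam : lam ∈ Set.Icc (0 : ℝ) 1) (hη : 0 < η) :
    ∃ lam' ∈ Set.Icc (0 : ℝ) 1, lam' ≠ lam ∧ |lam' - lam| < η := by
  obtain ⟨h0, h1⟩ := hlam
  set d : ℝ := min (η / 2) (1 / 2) with hd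
  have hdpos : 0 < d := lt_min (by linarith) (by norm_num)
  have hdη : d < η := (min_le_left _ _).trans_lt (by linarith)
  have hd2 : d ≤ 1 / 2 := min_le_right _ _
  by_cases hhalf : lam ≤ 1 / 2
  · refine ⟨lam + d, ⟨by linarith, by linarith⟩, by linarith, ?_⟩
    rw [add_sub_cancel_left, abs_of_pos hdpos]
    exact hdη
  · have hhalf : 1 / 2 < lam := lt_of_not_ge hhalf
    refine ⟨lam - d, ⟨by linarith, by linarith⟩, by linarith, ?_⟩
    rw [sub_sub_cancel_left, abs_neg, abs_of_pos hdpos]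
    exact hdη

/-- **The zero speed majorant never works** (free gas, every node): for `v = 0`, `L > 0`, every `N`
and every `λ ∈ [0,1]`, `¬ LocalSpeedBound 0 N L 0 λ` — although the free coupled family does not
move at all. Witness: Negative lemma `exists_lowEnergy_tagged_pair_norm_inner_lt_one` (constant vs
tilted constant, both `δ`-near-minimisers at ANY coupling, angle `arccos (1+(N+1)ε²)^{-1/2} > 0`).
[folklore] -/
theorem not_localSpeedBound_zero_majorant (N : ℕ) (hL : 0 < L) {lam : ℝ}
    (hlam : lam ∈ Set.Icc (0 : ℝ) 1) : ¬ LocalSpeedBound 0 N L (fun _ => 0) lam := by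
  rintro ⟨η, hη, h⟩
  obtain ⟨lam', hlam', hne, hclose⟩ := exists_second_node hlam hη
  obtain ⟨δ, hδ, hall⟩ := h lam' hlam' hne hclose
  obtain ⟨Ψ, Ψ', h0, hδ', hlt⟩ :=
    exists_lowEnergy_tagged_pair_norm_inner_lt_one N hL hδ
  have hΨ : IsNearMinimiser 0 lam δ Ψ :=
    ⟨by rw [coupledEnergy_zero_pot, h0]; exact zero_le⟩
  have hΨ' : IsNearMinimiser 0 lam' δ Ψ' :=
    ⟨by rw [coupledEnergy_zero_pot, coupledGroundStateEnergy_zero_pot lam' N hL, zero_add]; exact hδ'⟩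
  have hang := hall Ψ Ψ' hΨ hΨ'
  simp only [integral_zero] at hang
  have hpos : 0 < fsAngle Ψ Ψ' := Real.arccos_pos.2 hlt
  linarith

/-- Quantitative form of the same obstruction: whatever the majorant `s`, `LocalSpeedBound 0 N L s λ`
forces `0 < ∫_{[λ,λ']} s` for every admissible second node `λ'` (so `s` cannot vanish a.e. on any
one-sided neighbourhood of any node, even where the path is motionless). [folklore] -/
theorem integral_pos_of_localSpeedBound_free (N : ℕ) (hL : 0 < L) {lam : ℝ} {s : ℝ → ℝ}
    (h : LocalSpeedBound 0 N L s lam) :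
    ∃ η : ℝ, 0 < η ∧ ∀ lam' ∈ Set.Icc (0 : ℝ) 1, lam' ≠ lam → |lam' - lam| < η →
      0 < ∫ t in Set.uIcc lam lam', s t := by
  obtain ⟨η, hη, h⟩ := h
  refine ⟨η, hη, fun lam' hlam' hne hclose => ?_⟩
  obtain ⟨δ, hδ, hall⟩ := h lam' hlam' hne hclose
  obtain ⟨Ψ, Ψ', h0, hδ', hlt⟩ :=
    exists_lowEnergy_tagged_pair_norm_inner_lt_one N hL hδ
  have hΨ : IsNearMinimiser 0 lam δ Ψ :=
    ⟨by rw [coupledEnergy_zero_pot, h0]; exact zero_le⟩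
  have hΨ' : IsNearMinimiser 0 lam' δ Ψ' :=
    ⟨by rw [coupledEnergy_zero_pot, coupledGroundStateEnergy_zero_pot lam' N hL, zero_add]; exact hδ'⟩
  have hpos : 0 < fsAngle Ψ Ψ' := Real.arccos_pos.2 hlt
  exact hpos.trans_le (hall Ψ Ψ' hΨ hΨ')

end Llp

/-! ## §13 Barrier reduction: the crux is false in one dimension (what a proof must use)

Docstring-only (the tree's one-particle space `Space = ℝ³` is fixed, so the `d = 1` analogue is not a
statement over tree vocabulary). The crux is `K1 → IR` with K1 a momentum-UNIFORM static-response
(compressibility) bound `N m₋₁(p) ≤ C N / max(ρa, p²)` down to `p = 2π/L`, and IR (via §5,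
`(N+1) L⁻³|overlap|² ≤ ⟨Ψ, n₀ Ψ⟩`) at least as strong as torus BEC of near-minimisers.
In `d = 1` the same pair of statements is CONTRADICTORY rather than an implication:
* Pitaevskii–Stringari (`T = 0` uncertainty principle, Stringari 1995 §2.2 (8)–(11); catalogue entry
  `Literature.Barriers.AtomisticToContinuum.PitaevskiiStringariOneDimension`, audited 2026-08-15, with
  the proved analytic core `pitaevskiiStringariOneDimension_holds` and the order-of-limits narrowing
  `PitaevskiiStringariOneDimensionNarrow`): `n(q) ≥ n₀ mc/(2q) − ½` from the f-sum rule and a FINITE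
  compressibility; summed over the phonon window this is `n₀ (mcL/4π) log L ≤ N = ρL`, so a uniform
  susceptibility bound — the `d = 1` analogue of K1 — forces `n₀ → 0`; Momoi 1996 §1/§2.2 Thm 1:
  "the method … can be successfully applied only when we have a rigorous upper bound of the
  susceptibility at the whole momentum space" — which is exactly what K1 provides.
* Girardeau–Lenard (catalogue entry `OneDimensionalHardCore`): impenetrable bosons on a circle have
  `λ_max(γ)/N = O(N^{-1/2})` for ALL `N` (Szegő's inequality, Lenard 1964; constant by
  Claeys–Krasovsky 2015), hence by the `d = 1` analogue of §5 the insertion residue of the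
  Tonks–Girardeau gas is `Z_N ≤ (λ_max + 1)/(N+1) = O(N^{-1/2}) → 0`: the `d = 1` analogue of IR
  FAILS (insertion orthogonality catastrophe with interactions). Caveat on the hypothesis side: the TG
  static response is the free-Fermi Lindhard function, which is itself logarithmically UNBOUNDED at
  `p = 2k_F = 2πρ` (Peierls), so at the TG point the `d = 1` analogue of K1 fails too and `K1 → IR`
  holds there vacuously; the clean `d = 1` counter-model to the IMPLICATION is the Lieb–Liniger gas at
  finite coupling (Luttinger parameter `K > 1`: static response bounded at ALL momenta, the `2k_F`
  singularity being `|p − 2k_F|^{2K−2}`, while `n₀/N ∼ N^{-1/(2K)} → 0`) — physics-level on both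
  sides (rigorous `T = 0` no-order theorems in `d = 1` are conditional, Momoi 1996 Thm 1 / Koma 2007,
  or concern impenetrable bosons).
So `CorrectorClosure` is GENUINELY dimension-dependent: any proof must use an infrared fact that
fails in `d = 1`. The catalogue names it: the summability `L^{-d} ∑_{0<|k|≤κL} L/|k| = O(1) ⇔ d ≥ 2`
(PitaevskiiStringariOneDimensionNarrow, clause (ii): "ultraviolet uses of `d = 3` (scattering
length, Dyson lemma, Neumann box bounds) evade nothing"). In the route's own currency this is the
recoil integral of the first corrector, `‖χ₁‖² ≤ (ρ/4)∫ d^dk |v̂|² m₋₁(k)/k²`, finite iff `d ≥ 3`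
given `m₋₁` bounded (`d = 2`: logarithmic), and in the picked line it is `χ_F(0) < ∞`
(`stub_undressedSpeed`'s "`= ∞` in `d = 1`: the dimension test") — the line passes the barrier at the
right place. Conversely, every step of a proposed proof that is insensitive to `d` (energy
localisation, Temple, convexity in `t`, Cauchy–Schwarz on the cell, the FS geometry of §12) carries
no weight towards the crux. [cite: Stringari1995 §2.2; Momoi1996 §1, §2.2; Lenard1964;
ForresterEtAl2003 §2.2.2; LSSY2005 Ch. 5 §5.2]

## §14 Hypothesis-side census (not duplicated here)

The K1 crux `StaticResponseBound` (stmt-AtomisticToContinuum-12057) has its own standing disprover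
(`Cruxes/StaticResponseBound/Disproof.lean`, gen 2): `k ≠ 0` load-bearing (§B there), the
finite-energy guard `periodicEnergy v Ψ ≠ ⊤` load-bearing (§E, hard core `N = 2`), TIGHTNESS
`C ≥ 1/2` for every `v` (§C, one-particle witness) — together with §11 here (`C = 1` suffices at
`v = 0`) the free constant is pinned in `[1/2, 1]` — and the conditional uniformity analysis (§F).
For THIS crux the consequences are: (i) a proof of `CorrectorClosure` may assume WLOG `C ≥ 1`
(`Body.mono_C` there) and must thread the guard through every energy identity; (ii) K1 is consumed
at the bath density `ρ' = ρN/(N+1)` in the `(N+1)`-box (`sideLength ρ' N = sideLength ρ (N+1)`,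
gen-1 Scratch), where `ρ' < ρ < ρ₀` — no loss; (iii) nothing on the hypothesis side is refutable
cheaply, so `¬ CorrectorClosure` (§1) stays out of reach from BOTH ends. -/

/-! ## §15 One-loop calibration of the picked heart: the Fubini–Study arc is a geodesic to leading
order (`arc² = Bogoliubov depletion`, mode by mode)

For the lead of `llp-fidelity-arc` (calibration, not an obstruction). At one loop with the DRESSED
vertex (impurity–bath amplitude `8πa_λ`, `a_λ ↑ a` along the ceiling path), Bogoliubov bath
(`e_k = √(k⁴ + 2μk²)`, `μ = 8πρa`, `S_k = k²/e_k`) and equal-mass recoil `k²`, the speed of the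
ground-state ray is `‖∂_λΨ_λ‖ = 8π|∂_λ a_λ| √(ρ I₀)`, `I₀ = ∫ d³k/(2π)³ S_k/(e_k + k²)²`, so the total
arc is `8πa√(ρI₀)` and
  `arc² = (1/ρ) ∫ d³k/(2π)³ μ² S_k/(e_k+k²)² = (1/ρ)∫ d³k/(2π)³ v_k² = (8/(3√π)) √(ρa³)`
— EXACTLY the Bogoliubov depletion `1 − n₀/N ≈ 1.5045 √(ρa³)`, because of the mode-by-mode identity
`μ² S_k/(e_k + k²)² = v_k² = (k² + μ − e_k)/(2e_k)` (theorem `bogoliubov_arc_mode_identity` below, pure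
algebra from `e_k² = k⁴ + 2μk²`; numerically `G = ∫₀^∞ q³dq/(√(q²+1)(q√(q²+1)+q²)²) = 1/3`, phonon share
`q = k/√(2μ) < 1` equal to `√2 − 1`). Consequences: (i) `Z ≥ cos²(arc) = 1 − 1.5045√(ρa³) + O(ρa³)`
coincides to this order with Bogoliubov's `Z = (n₀+1)/(N+1)·Z̃`, `Z̃ → 1` (gen-2 header): the line's
inequality "arc ≥ chord" is SATURATED at leading order — the coupled ground-state path is a geodesic
to one loop and the method loses no slack at small `ρ`; (ii) the budget of `DressedPathBound` is met
as soon as `1.5045 √(ρa³) < θ²` (plus the floor of §12); (iii) the Born-level arc of §12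
(`∝ ‖v‖₁`, infinite for hard cores) overestimates by exactly the factor `‖v‖₁/(8πa)`: dressing is the
entire content; (iv) the same integral is the route's first-corrector norm `‖χ₁‖²` with `v̂ → 8πa`
(the planner's "≈ 1.8√(ρa³)" is `8/(3√π) ≈ 1.50` exactly). -/

/-- **Mode-by-mode identity behind `arc² = depletion`.** With the Bogoliubov dispersion
`e² = q² + 2μq` (`q = |k|²`), `2μ²q = (q + μ − e)(e + q)²`; equivalently
`μ² S_k/(e_k + k²)² = (k² + μ − e_k)/(2e_k) = v_k²` (`S_k = k²/e_k`): the one-loop fidelity-speed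
density of the dressed impurity equals the depletion density of the bath, mode by mode. [folklore] -/
theorem bogoliubov_arc_mode_identity (q μ e : ℝ) (hdisp : e ^ 2 = q ^ 2 + 2 * μ * q) :
    2 * μ ^ 2 * q = (q + μ - e) * (e + q) ^ 2 := by
  linear_combination (e + q - μ) * hdisp

/-- The same identity in quotient form (`e > 0`, `q > 0`): `μ² (q/e)/(e+q)² = (q + μ − e)/(2e)`.
[folklore] -/
theorem bogoliubov_arc_mode_identity_div {q μ e : ℝ} (hq : 0 < q) (he : 0 < e)
    (hdisp : e ^ 2 = q ^ 2 + 2 * μ * q) :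
    μ ^ 2 * (q / e) / (e + q) ^ 2 = (q + μ - e) / (2 * e) := by
  have h := bogoliubov_arc_mode_identity q μ e hdisp
  have heq : (e + q) ^ 2 ≠ 0 := by positivity
  rw [div_eq_div_iff heq (by positivity)]
  have h2 : μ ^ 2 * (q / e) * (2 * e) = 2 * μ ^ 2 * q := by
    field_simp
  rw [h2]
  exact h


/-! ## §16 (gen 4) The two other lines: `healing-scale-kac-insertion` (lead b, skeleton v3) and
`residue-area-law` (third lead, skeleton v1) — cheap-attack census, a vacuity threshold, and the
shared hidden input for hard cores

Three leads are seated (PICKED.md A/B + the third lead's pick `residue-area-law`, 2026-08-16).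
§12/§15 attacked line A. This section records the cheap attacks on every registered stub of lines
B and C (degenerate instances `N = 0`, `v = 0`, hard core / hard shell / graded shells, `E₀ = ⊤`,
junk hunt in every Bochner integral and `toReal`, quantifier order, mutation of hypotheses).
**Verdict: no stub of B or C is false as typed; two structural facts are made theorems below.**

### Line B (`Lines/healing-scale-kac-insertion.lean`, 7 stubs; bounded `v` threaded explicitly)
* `stub_uvTransfer` — TRUE, and sharper than stated: `B ≥ e^{-1/8}` for EVERY measurable `v` given
  the FK ground state `Φ₀` (Parseval in the tagged coordinate, Bose symmetry of `|ĉ_P|²`, AM–GM =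
  convexity of `exp`, Feynman–Kac domination `e^{-sH} ≤ e^{sΔ}` tested on `Φ₀ ≥ 0`, eigen-relation,
  `2TE₀/(N+1) = 1/8`). Junk branches are truths: `E₀ ∈ {0, ⊤}` ⇒ `E₀.toReal = 0` ⇒ `T = (N+1)/0 = 0`
  ⇒ the `T ≤ 0` branch ⇒ `B = ∫Φ₀² = 1` (`norm_eq`). Hard cores: `IsPeriodicGroundStateFK` is
  satisfiable in principle (`eigen`/`tendsto` force `Φ₀ = 0` on and inside the cores, where the
  killed flow vanishes for `T > 0`), and domination still holds.
* `stub_groundStateExists` — TRUE given the named fact `PeriodicGroundStateFeynmanKac` (bounded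
  `v ≤ C` ⇒ `v^per ≤ C` once `L > 2R₀`: at most one lattice image within range); blocked on its
  `_holds`, as the lead says.
* `stub_nearMinimiserRigidity` (B's version: fixed `N, L`, bounded `v^per`, FK ground states GIVEN) —
  TRUE: PF simplicity + compact resolvent at fixed volume; `N = 0` instance: `Θ₀ ≡ 1` on the point
  `Config 0`, `Φ₀ = L^{-3/2}`, `A = 1`, one-body near-minimisers converge to the constant mode ✓.
  The conclusion's left side `ofReal(L⁻³(∫Θ₀∫_cellΦ₀)²)` is junk-free (continuous data on bounded
  cells; the parametric inner integral is continuous — prover's burden, true).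
* `stub_responseDictionary` — consistent: K1 at bath density `ρ' = N/L³` (`sideLength ρ' N = L`,
  `0 < ρ' < ρ < ρ₀(K1)`), the ground-state representation in the limit of mollified `Θ₀`, and
  `∫gΘ₀² = 0` (translation invariance of the unique ground state) give `‖g_k‖²₋₁ ≤ C_K` with EXACTLY
  K1's constant `C_K = C N/max(ρ'a, p²)` (computation: insert `(1−tβ)Θ₀/‖·‖` into K1, divide by `t²`,
  `t → 0`). Its `∃ C` must be `≥ 1/2` (theorem `ofReal_sq_div_dirichletFormW_le_hMinusOneSqW` below
  + the paper evaluation after it).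
* `stub_firstCorrector` — TRUE (landed meanwhile, p80274): `(e + qQ)² ≥ 4eqQ`.
* `stub_kacClosure` (heart) — untouched by cheap attacks; Bogoliubov-consistent (gen-2 numerics
  j006427: first Kac corrector `O(√(ρa³))`, `L`-uniform). NEW typed fact: its `H₋₁` hypothesis with
  constant `C` is UNSATISFIABLE for `C < 1/2` by ANY translation-invariant weight (single-mode bound
  below), so the heart is VACUOUSLY true for `C < 1/2` and only the instances `C ≥ 1/2` carry content
  (harmless: it is consumed with Stub 4's `C`). Read per `N`, the heart is "(K1's consequence for the
  bath at this `N`) ⇒ (insertion residue of the TRUE ground states `≥ cK`)", i.e. `A = Z_N ≥ (9/16)cK`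
  (`A` does not involve `T`; mollification only enters `B`): by §5 this contains torus BEC of the FK
  ground states — the crux's strength, not more (for `C` below the true compressibility constant the
  hypothesis fails and the instance is vacuous; above it, `ρ₃(C)` may shrink).
* `stub_unboundedCase` — crux-sized by construction (the lead's own "honest hole"); see the shared
  hidden input below.

### Line C (`Lines/residue-area-law.lean`, 4 stubs; ALL admissible `v`)
* `stub_shortTime` — consistent: `𝒵(t) ∈ (0, L³]`; `log D(t₀) ≈ t₀² Var_{ψ₀}(W) + …` with
  `Var_{ψ₀}(W) = ρ'∫v² + ρ'²∫∫vv(g₂−1) = O(1)` uniformly in `N` for bounded `v`; for hard cores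
  `F(t) = 𝒵(t)/𝒵(0)` JUMPS at `0⁺` (`F(0⁺) = P(no overlap) < 1`: the flat state charges forbidden
  configurations, killed instantly), so `D(0⁺) = 1/P(no overlap) ≈ 1 + ρ|B_{R₀}|`, then
  `log D(t) − log D(0⁺) ≍ ρR₀²√t` (Wiener sausage) — bounded at any fixed `t₀`, uniformly in `N` ✓.
* `stub_dyadicTail` (heart) — Bogoliubov-consistent, with room: the ledger increment at scale `T` is
  `≍ r(T)/m` where `r(t) = ∫_{ω>0} e^{-tω}dμ_ac(ω)` and the flat state's spectral density vanishes
  LINEARLY at threshold (one phonon `k` + impurity recoil `−k`: `dμ/dω ≍ ρv̂(0)²ω/c⁵`), so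
  `r(T) ≍ T⁻²` and the dyadic sum converges; the finite-size slow scale `T(N) ≍ L/c` (phonon gap)
  carries ledger mass `≍ r(L/c) → 0` — NO escaping mass at one loop. STRUCTURAL point made a
  theorem below (`exists_bounded_sums_without_summable_majorant`): the summable-majorant form is
  strictly stronger than what `CorrectorClosure_of` consumes (only `Σ_{m<M} b_m ≤ Σ b`); an
  escaping-mass refutation of the stub (ledger mass `O(1)` at an `N`-dependent scale) would NOT
  refute the crux. Equivalent-strength restatement (given stubs 1, 3, 4): a TELESCOPED bound
  `∃ B, ∀ᶠ N, ∀ M, D(2^M t₀) ≤ e^B D(t₀)`, i.e.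
  `Z(2^{M+1}t₀)·Z(0)·Z(t₀)² ≤ e^B·Z(2^M t₀)²·Z(2t₀)·Z(0)` — necessary AND sufficient for `Z_N ≥ c`.
* `stub_groundStateExists`, `stub_nearMinimiserFrame` — TRUE for bounded `v` given the named FK fact;
  for `⊤`-valued `v` they contain the shared hidden input below. `IsPeriodicGroundStateFK` is the
  right interface for hard cores (its `eigen`/`tendsto` fields force `Θ₀ = 0` on caged / forbidden
  components and single out the all-free component PROVIDED it is strictly lowest and its symmetric
  ground state is simple).

### The shared hidden input for `⊤`-valued `v` (lines A (G)(iii), B `stub_unboundedCase` (i),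
C stubs 3–4): simplicity of the bosonic hard-core ground state at FIXED large `N`
Each line states as known ("true once `ρR₀³ ≪ 1`") that the dilute free region
`Ω_N = {X ∈ 𝕋_L^{3N} : |xᵢ − xⱼ|_𝕋 > R₀ ∀ i<j}` (modulo `S_N`) is connected, or at least that its
Dirichlet ground state in the symmetric sector is simple. IN PRINT THIS IS AN OPEN QUESTION at fixed
packing fraction: Baryshnikov–Bubenik–Kahle, *Min-type Morse theory for configuration spaces of hard
spheres* (IMRN 2014, arXiv:1108.3061) §6: "An important special case for which little seems known is:
what is the threshold radius `r = r(n)` for connectivity of `conf(n,r)`? … Diaconis, Lebeau, and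
Michel noted that `r ≤ c/n` is sufficient … It would be interesting to know if connectivity of the
configuration space ever extends into the thermodynamic limit, i.e. … `conf(n,r)` connected for
`r ≤ C n^{-1/d}`" — `r ≍ n^{-1/d}` in a unit box IS fixed density with fixed `R₀` in the box
`L = (N/ρ)^{1/3}`; the known regime `r ≤ c/n` is packing fraction `O(N^{1−d}) → 0`. (Finite clusters
in free space always disassemble — move the sphere extremal in a direction outward — so a second
component at low density must be a torus-spanning locked framework; none is known, none is
excluded. Measure-theoretically `Ω_N` is a thin sponge: `|Ω_N|/L^{3N} ≈ e^{-(2π/3)NρR₀³}`.) What the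
lines actually need is weaker than connectivity — the component of the dilute lattice configuration
carries a STRICTLY lowest, simple symmetric ground state (other components, if any, are locked
frameworks paying confinement energy `≳ R₀⁻² ≫ δ`; mirror-image pairs of chiral locked components
would be exactly degenerate but excited) — and nobody has written that down either. Consequence for
this crux: every hard-core statement of every line is, today, conditional on this fixed-`N` input;
bounded `v` is unaffected (PF for `−Δ + V`, `V ∈ L^∞(𝕋^{3N})`). [cite: BaryshnikovBubenikKahle2014 §6;
DiaconisLebeauMichel2011]
-/

section HMinusOneLower

variable {M : ℕ} {L : ℝ} {F g : Config M → ℝ}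

/-- **Single-mode (Cauchy–Schwarz / Bijl–Feynman) lower bound for the `H₋₁` norm.** Testing
Kipnis–Landim's variational formula with `φ = t g` and optimising in `t`: if `g` is itself a
periodic test function with `𝓔_F(g,g) > 0` then `‖g‖²₋₁ ≥ (∫ g² F²)² / 𝓔_F(g,g)`.
Paper evaluation for the density mode `g_k = Σⱼ cos(p·xⱼ)` (`p = 2πk/L ≠ 0`) and a normalised
TRANSLATION-INVARIANT weight `Θ₀²` (the unique ground state): `𝓔(g_k,g_k) = p²∫Σⱼsin²(p·xⱼ)Θ₀² = p²N/2`
exactly and `∫g_k²Θ₀² = N S_{Θ₀}(k)/2` with `S(k) = 1 + ρ'ĥ(p) → 1` (`|p| → ∞`, Riemann–Lebesgue,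
`h = g₂ − 1`), hence `‖g_k‖²₋₁ ≥ N S(k)²/(2p²)`: an upper bound `‖g_k‖²₋₁ ≤ C N/max(ρ'a,p²)` (the
hypothesis of `stub_kacClosure`, the conclusion of `stub_responseDictionary`, K1 in `H₋₁` currency)
forces `C ≥ S(k)² max(ρ'a,p²)/(2p²) ≥ S(k)²/2` for every `k ≠ 0`, so `C ≥ 1/2` — for EVERY `v`, not
only the free gas (K1's disprover, §C there, has the energy-currency version). [folklore] -/
theorem ofReal_sq_div_dirichletFormW_le_hMinusOneSqW (hg : IsPeriodicTest L g)
    (hD : 0 < dirichletFormW L F g g) :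
    ENNReal.ofReal ((∫ X in cellN M L, g X * g X * F X ^ 2) ^ 2 / dirichletFormW L F g g) ≤
      hMinusOneSqW L F g := by
  set P : ℝ := ∫ X in cellN M L, g X * g X * F X ^ 2 with hP
  set D : ℝ := dirichletFormW L F g g with hDdef
  have h := le_hMinusOneSqW L F g (hg.smul (P / D))
  rw [integral_mul_smul_mul_sq, dirichletFormW_smul_left, dirichletFormW_smul_right] at h
  have hne : D ≠ 0 := hD.ne'
  have : 2 * (P / D * P) - P / D * (P / D * D) = P ^ 2 / D := by
    field_simp
    ring
  rw [← hP, ← hDdef, this] at h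
  exact h

/-- Degenerate case of the single-mode bound: `𝓔_F(g,g) = 0` with `∫ g² F² ≠ 0` forces
`‖g‖²₋₁ = ⊤` (test with `t g`, `t → ±∞`). [folklore] -/
theorem hMinusOneSqW_eq_top_of_dirichletFormW_self_eq_zero (hg : IsPeriodicTest L g)
    (hD : dirichletFormW L F g g = 0) (hP : (∫ X in cellN M L, g X * g X * F X ^ 2) ≠ 0) :
    hMinusOneSqW L F g = ⊤ := by
  set P : ℝ := ∫ X in cellN M L, g X * g X * F X ^ 2 with hPdef
  refine ENNReal.eq_top_of_forall_nnreal_le fun r => ?_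
  have h := le_hMinusOneSqW L F g (hg.smul ((r : ℝ) / (2 * P)))
  rw [integral_mul_smul_mul_sq, dirichletFormW_smul_left, dirichletFormW_smul_right, ← hPdef, hD]
    at h
  have : 2 * ((r : ℝ) / (2 * P) * P) - (r : ℝ) / (2 * P) * ((r : ℝ) / (2 * P) * 0) = r := by
    field_simp
    ring
  rw [this, ENNReal.ofReal_coe_nnreal] at h
  exact h

/-- Contrapositive packaging against an `H₋₁` upper bound (hypothesis of `stub_kacClosure`, output of
`stub_responseDictionary`, K1 in `H₋₁` currency): `‖g‖²₋₁ ≤ B < ⊤` forces `(∫ g² F²)² ≤ B·𝓔_F(g,g)`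
— with `g = g_k` and the evaluation above, `B ≥ N S(k)²/(2p²)`. [folklore] -/
theorem sq_integral_sq_le_of_hMinusOneSqW_le (hg : IsPeriodicTest L g) {B : ℝ} (hB : 0 ≤ B)
    (h : hMinusOneSqW L F g ≤ ENNReal.ofReal B) :
    (∫ X in cellN M L, g X * g X * F X ^ 2) ^ 2 ≤ B * dirichletFormW L F g g :=
  (hMinusOneSqW_le_ofReal_iff hB).1 h g hg

end HMinusOneLower

/-- **Escaping mass (the summable-majorant form of `stub_dyadicTail` is strictly stronger than the
telescoped bound the composition consumes).** Nonnegative doubly-indexed families with uniformly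
bounded sums need not admit a summable UNIFORM majorant: `a N m = [m = N]` has every row sum `= 1`
but any majorant `b ≥ a N ·` for all `N` has `b m ≥ 1` for all `m`. With
`a N m = log D_N(2^{m+1}t₀) − log D_N(2^m t₀) ≥ 0` (log-convexity): `Z_N ≥ c` uniformly in `N`
bounds the row sums uniformly, while `stub_dyadicTail` asks for the summable uniform majorant — an
`O(1)` ledger mass sitting at an `N`-dependent scale `T(N) → ∞` would refute the stub without
refuting `CorrectorClosure`. Line-lead C: restate the heart as the telescoped bound (see §16 text).
[folklore] -/
theorem exists_bounded_sums_without_summable_majorant :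
    ∃ a : ℕ → ℕ → ℝ, (∀ N m, 0 ≤ a N m) ∧ (∀ N, ∑' m, a N m ≤ 1) ∧
      ¬ ∃ b : ℕ → ℝ, Summable b ∧ ∀ N m, a N m ≤ b m := by
  refine ⟨fun N m => if m = N then 1 else 0, ?_, ?_, ?_⟩
  · intro N m
    dsimp only
    split_ifs <;> norm_num
  · intro N
    simp only [tsum_ite_eq, le_refl]
  · rintro ⟨b, hb, hle⟩
    have h1 : ∀ m, (1 : ℝ) ≤ b m := fun m => by simpa using hle m m
    have ht := hb.tendsto_atTop_zero
    have hev : ∀ᶠ m in atTop, b m < 1 := ht.eventually (gt_mem_nhds one_pos)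
    obtain ⟨m, hm⟩ := hev.exists
    exact absurd (h1 m) (not_le.2 hm)

/-! ## §17 (gen 4) Heart calibration II for `stub_dressedPathExists` (line A, promote-stub
candidate): the two-body CEILING PATH is a near-geodesic in `L²` — an attempted non-rectifiability
kill and why it fails (kit job j013538; script `kit/ceiling_path_length.py`, pure python)

**The attack.** (D∃) + (G) force the ground-ray path `λ ↦ [Ω_λ]` to be RECTIFIABLE with
Fubini–Study length `≤ ∫₀¹ s ≤ θ` (chain the local existential bound through the rigidity limits:
`d(Ω_a,Ω_b) ≤ ∫_a^b s` for all `a < b`, exactly the ArcChord argument on sub-intervals). At short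
impurity–bath distances the `(N+1)`-body ground state factorises, `Ω_h ≈ Πⱼ f_h(xⱼ−x₀)·(φ₀⊗Θ)`, with
`f_h` the zero-energy pair factor of `u_h = min(v,h)` (reduced kinetic operator `−2Δ`, `f_h → 1`), and
the pair density near the impurity is `≈ ρ f_h²`; hence the ULTRAVIOLET part of the metric speed is
`speed_UV(h)² ≈ Var(Σⱼ ∂_h log f_h(xⱼ−x₀)) ≈ ρ‖∂_h f_h‖²_{L²(B_{R₀},d³r)}` and the UV arc is
`√ρ · Λ(v)`, `Λ(v) :=` the `L²(B_{R₀})`-LENGTH of `h ↦ f_h`, `0 ≤ h ≤ ∞` (the infrared part is §15's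
`(8/(3√π))^{1/2}(ρa³)^{1/4}`). If some admissible `v` had `Λ(v) = ∞` — a non-rectifiable two-body
path, e.g. a SLIDING SHARP FRONT (`‖1_{[0,t]} − 1_{[0,t']}‖₂ = |t−t'|^{1/2}`) or infinitely many
nearly orthogonal increments (gaps of graded concentric hard shells going dark ONE AT A TIME as the
ceiling rises, `Σ√gᵢ = ∞` with `Σgᵢ < ∞`) — then (D∃)'s conclusion would be FALSE for that `v` at
every `ρ` (given (G)), and the v4 stub set {(G), (A∃), (D∃)} would imply `¬K1`.

**Why it fails (structure of the radial zero-energy family; paper, all elementary).** Write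
`f_h = ẑ_h/r`, `ẑ_h = z/z'(R₀⁺)` with `z'' = (u_h/2)z`, `z(0)=0`: (i) `ẑ_h` is convex, increasing,
`0 ≤ ẑ_h' ≤ 1` (normalised outer slope), `0 ≤ ẑ_h ≤ r`, `ẑ_h(r) = r − a_h` for `r ≥ R₀`;
(ii) `h ↦ ẑ_h(r)` is non-increasing for every `r` and `h ↦ a_h` non-decreasing, `a_h ≤ R₀`
(comparison); (iii) hence NO sharp front of `O(1)` amplitude ever forms: where `u_h` is large `ẑ_h`
is exponentially small with slope still `≤ 1`, and a region that has just gone dark at radius `r_*`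
suppresses the bright region outside it to `ẑ ≈ r − r_*` (the s-wave node at an effective hard core)
— the increments of the graded-shell design are `≍ gᵢ^{3/2}`, summable. The family `{ẑ_h}` is a
monotone path of uniformly 1-Lipschitz convex functions; its `L¹`-length equals its `L¹`-chord
(`≤ R₀²/2`), and the `L²`-length could only diverge through many tiny localised moves, which convexity
prices at potential strength `≳ 1/(width·R₀)` each — self-screening then darkens the region.
(No proof of `sup_v Λ(v) < ∞` is claimed; the Born bound `Λ ≲ ‖v‖₁` and the total-variation bound
through `μ_h = u_h f_h d³r` are both INFINITE for hard cores — `∫₀^∞ f_h(r)dh = 4/(1−r)` on the unit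
core, log-divergent mass — so any proof must use the `L¹ → L²_loc` smoothing of the zero-energy
Green's function, as drefute anticipated: "the resolvent's smoothing on the boundary layer".)

**Numerics (kit j013538, `JOB_PPD=40`; the table below is the seat's local run at 20 points per
decade of `h`, `h ∈ [10⁻⁴, 10¹⁰]` geometric + the exact `h = ∞` endpoint, exact piecewise
transfer matrices on a boundary-refined radial grid (3–9·10³ nodes, refinement `10⁻⁸`), polygonal
length = lower bound converged to `≤ 3·10⁻⁵` relative (10 vs 20 points/decade)).** `Λ` = polygonal
`L²(B_{R₀},d³r)`-length of `h ↦ f_h`, chord `= ‖f₀ − f_∞‖ = ‖1 − f_v‖_{L²(B_{R₀})}`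
(`≤ (4π/3)^{1/2}R₀^{3/2} = 2.0466 R₀^{3/2}`, attained iff `f_v = 0` on `B_{R₀}`):

| admissible `v` (all radial, finite range `R₀`) | `R₀` | `Λ` | chord | `Λ`/chord | `Λ/R₀^{3/2}` |
|---|---|---|---|---|---|
| hard core `⊤·1_{[0,1]}` | 1 | 2.0941 | 2.0466 | 1.023 | 2.094 |
| hard shell `⊤·1_{[1,2]}` (cavity `r<1`) | 2 | 5.9000 | 5.7888 | 1.019 | 2.086 |
| soft core `V·1_{[0,1]}`, `V = 1 / 10 / 10² / 10³ / 10⁵` | 1 | 0.342 / 1.361 / 1.954 / 2.069 / 2.093 | 0.342 / 1.361 / 1.943 / 2.035 / 2.047 | 1.000–1.023 | ≤ 2.093 |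
| graded shells (`⊤` walls `2^{-j}`, gaps `0.5/j²`), `J = 8 / 14 / 18` | 2.76–2.80 | 9.583 / 9.746 / 9.791 | 9.383 / 9.527 / 9.566 | 1.021 / 1.023 / 1.024 | 2.090–2.095 |
| graded shells, gaps `0.5/j^{1.2}` (the `Σ√gᵢ = ∞` design), `J = 8 / 14 / 18` | 3.16–3.40 | 11.863 / 12.942 / 13.407 | 11.508 / 12.444 / 12.837 | 1.031 / 1.040 / 1.044 | 2.109–2.138 |
| same, REVERSED (thin walls inside), `J = 14` | 3.33 | 12.619 | 12.444 | 1.014 | 2.075 |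
| tall thin spikes `V_j = 4^j` on shells of thickness `4^{-j}` in `[1,2)` (BOUNDED `v`, `‖v‖₁ ∝ J`), `J = 4 / 8 / 12 / 16` | 2 | 4.089 / 4.831 / 5.159 / 5.345 | 4.064 / 4.778 / 5.085 / 5.253 | 1.006–1.018 | 1.45–1.89 |
| hard core + inverse-square edge `c/(r−1)²` on `(1,2]`, `c = 1 / 10` | 2 | 4.722 / 5.453 | 4.698 / 5.432 | 1.005 / 1.004 | 1.67 / 1.93 |
| Cantor dust (`⊤` walls = gaps = `2^{-j}`), `J = 8 / 16` | 2.99 / 3.00 | 10.836 / 10.877 | 10.593 / 10.635 | 1.023 / 1.023 | 2.093 |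

Reading: in all 22 cases `Λ/chord ∈ [1.000, 1.044]` — the ceiling path is a NEAR-GEODESIC of
`L²(B_{R₀})` — and `Λ ≤ 2.14 R₀^{3/2}`; the adversarial designs creep (`+0.004` in `Λ/chord` per four
more shells at `J ≈ 16`, increments `≍ j^{-1.8}`) but converge; the Born-divergent spike family stays
below its chord bound `2.047·2^{3/2} = 5.79`. Where the length sits: for `⊤`-valued `v`, 85–90 % of `Λ`
accrues in `h ∈ [10⁻¹, 10¹]` and the tail beyond `h = 10²` is `≤ 4 %` (per-decade factors `≈ 1/4–1/5`:
the hard-core tail `‖∂_κ ẑ‖ ≍ κ^{-5/2}`). CONSEQUENCES for the lead of (D∃): (a) no ultraviolet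
obstruction exists at the two-body level for ANY tested admissible shape, hard cores and pathological
`⊤`-sets included — numerically `Λ(v) ≤ 1.05‖1 − f_v‖_{L²(B_{R₀})} ≤ 2.15 R₀^{3/2}` (conjecture:
a universal `C R₀^{3/2}`); (b) the UV share of the budget `θ` is met once `√ρ·Λ(v) ≤ θ/2`, i.e.
`ρ R₀³ ≲ θ²/18`, uniformly in the shape of `v` — the `ρ₀(θ, v)` of the stub depends on `v` through
`R₀` (and `a`) only, at this level; (c) the quantities a rigorous dressed-recoil estimate can lean on
are (i)–(ii) above (convexity, `0 ≤ ẑ' ≤ 1`, monotonicity in `h`, `a_h ↑ a ≤ R₀`), NOT `‖v‖₁` or the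
variation of the scattering measure. The many-body transcription (pair density `≈ ρf_h²` near the
impurity, three-body corrections `O(ρ²)`) is the dilute-limit heuristic, uniform in `N`; at `N = 1`
(impurity + one bath particle on the torus) the same statement is an honest two-body spectral fact
with `ρ` replaced by `L⁻³`. -/


end Summit.AtomisticToContinuum.BoseEinsteinCondensation.Cruxes.CorrectorClosure.Disproof

end
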